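import Literature.Geometry.Hyperkaehler.Hyperholomorphic
import Literature.LinearAlgebra.Alternating.DarbouxBasis
import Literature.Geometry.Hyperkaehler.TwistorLineHodgeClassesDimension
import Literature.Geometry.Hyperkaehler.ComplexStructureAdaptedBasis
import Mathlib.Analysis.Normed.Operator.Bilinear
import Mathlib.Topology.Algebra.Module.FiniteDimension
import Mathlib.LinearAlgebra.Basis.Defs
import Mathlib.Tactic.LinearCombination
import Mathlib.LinearAlgebra.QuadraticForm.Signature
import Mathlib.Topology.LocallyConstant.Basic
import HarnessLib

/-!
# The signature invariant of the Hodge locus `Compl_Ω` of one class — Buskin–Izadi §5: eq. (9), Proposition 5.1,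
# Lemma 5.2 (pointwise, at the level of `G_Ω`), Lemma 5.3, and the `h`-orthonormal adapted bases (consolidated file)

Topic `Literature/Geometry/Hyperkaehler`, namespace `Literature.Geometry.Hyperkaehler.HodgeLocus`. THEOREMS ONLY (no
definition, no named fact, no `sorry`); every import is Mathlib, HarnessLib or a BUILT file of this directory
(`Hyperholomorphic`, `ComplexStructureAdaptedBasis`, `TwistorLineHodgeClassesDimension`) and of
`Literature/LinearAlgebra/Alternating` (`DarbouxBasis`). Nothing in this file is a statement about the Hodge conjecture, and
nothing here says that any object is hyperholomorphic, rotable or carries a twistor line: the statements are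
finite-dimensional real linear algebra and point-set topology of operators on a real normed space.

**Provenance ∕ consolidation (D-0064: one Lean file per source SECTION).** Written by the literature seat `lit-w-verbitsky` of
the cell `pub-hsemireg` (HodgeConjecture venture): the five Parts below are the seat's standalone drafts of 2026-08-25
(generations 15–16), consolidated into one module by generation 17 on 2026-08-26; Part F (three short theorems combining
Parts B–E) was written for this file by generation 17. Each of Parts A–E reproduces its draft VERBATIM —
the draft's module docstring (with its verbatim quotations of the source, which were read against the arXiv v2 text layer
and LaTeX source by a second seat) followed by its code, byte-identical; only the `import` lines were hoisted and
de-duplicated, the drafts' file-level `open` lines other than `open Module` were moved inside the Part's `namespace` block,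
and the anonymous `noncomputable section` is opened once. Where a Part's docstring names a companion draft by file name, the
correspondence is: `HodgeLocusTwistorLineSignature.lean` = Part A, `HodgeLocusSignatureSurjective.lean` = Part B,
`HodgeLocusSignatureLocallyConstant.lean` = Part C, `HodgeLocusAdaptedOrthogonalBasis.lean` = Part D,
`HodgeLocusEqualSignatureConjugate.lean` = Part E; "keyed", "leaf", "row V-V20" are that cell's filing vocabulary and carry
no mathematical content.

## Source

[BuskinIzadi2020TwistorLinesTori] N. Buskin, E. Izadi, *Twistor lines in the period domain of complex tori*, Geom. Dedicata
213 (2021) 21–47 = arXiv:1806.07831v2 (28 Jun 2020), §5 "Twistor path connectivity of `Compl_Ω`" (v2 pp. 23–27; "v2 p.N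
Lm" in the Parts = PDF page N, text-layer line m of arXiv v2). arXiv v1 LACKS §5 — cite v2 only. Setting (v2 p.23 L20–33):
`V_ℝ` a real vector space of dimension `4n`, `Ω` a real alternating `2`-form, `Compl_Ω` the complex structures `I` with
`Ω(I·, I·) = Ω`, `h(u, v) = Ω(u, Iv) − iΩ(u, v)` the associated hermitian form on `(V_ℝ, I)` with signature `(n₊, n₋, n₀)`,
`V₀` the null space of `Ω`, `S_Ω = {(k, l, n₀) | k + l + n₀ = 2n}`, `Sign : Compl±_Ω → S_Ω` (p.24 L6–16), `G_Ω = {g | g*Ω = Ω}`.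

## Contents (carrier: `F` = `V_ℝ` a real normed space, finite-dimensional where bases or signatures occur; `I : F →L[ℝ] F`
## with `I² = −1`; `Ω` a continuous alternating map `F [⋀^Fin 2]→L[ℝ] ℝ` (Part A: a continuous bilinear map); the signature is
## read either as dimensions of maximal `h`-positive ∕ `h`-negative real subspaces with the maximality bound, or through
## Mathlib's Sylvester indices `sigPos` ∕ `sigNeg` of the REAL quadratic form `q_I(u) = h(u, u) = Ω(u, Iu)`, which are `2n₊`, `2n₋`)

* Part A — eq. (9) (v2 p.26 L8–25): `T_I Compl_Ω ≅ {Y | YI = −IY, ᵗYΩ + ΩY = 0}` is `l_I`-invariant (`skew_conjI`, `skew_parts`,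
  `skew_lI`); Lemma 5.2's conjugating element from matched bases (`exists_conj_invariant_of_matchedBases`).
* Part B — Lemma 5.3 (v2 p.24 L50–52, proof p.25 L35–53): every `(n₊, n₋, n₀) ∈ S_Ω` is the signature at some `I ∈ Compl_Ω`
  (`exists_invariant_complexStructure_signature[_of_mem_SOmega]`, `exists_invariant_complexStructure_sigPos_eq`), via the
  printed `2 × 2`-block basis (Darboux on a complement of `V₀`), with the block machinery (`exists_blockBasis`,
  `apply₂_self_map_eq_sum`, the spans `P_S`, the counts `finrank_le_of_apply₂_self_map_pos ∕ _neg`), the null space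
  (`exists_nullSpace`, `map_mem_nullSpace`, `even_finrank_nullSpace`) and the Sylvester bridge (`exists_quadraticForm`,
  `sigPos_eq_of_maximal`, `sigNeg_eq_of_maximal`).
* Part C — Proposition 5.1 (v2 p.24 L17–19, proof L20–24): `Sign` is locally constant on `Compl_Ω` — `rad q_I = V₀`
  (`mem_radical_iff`, `radical_eq_nullSpace`), `sigPos + sigNeg + dim V₀ = dim V_ℝ`, lower semicontinuity of `sigPos` ∕ `sigNeg`
  in `I` for the operator norm (`exists_forall_sigPos_le`, `exists_forall_sigNeg_le`), hence `exists_forall_sigPos_eq_and_sigNeg_eq`,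
  `isLocallyConstant_sign` on the subtype `Compl_Ω`, `sign_eq_of_mem_connectedComponent`.
* Part D — the `h`-orthogonal ∕ `h`-orthonormal `I`-adapted bases the proof of Lemma 5.2 starts from (v2 p.25 L13–24), for any
  `I ∈ Compl_Ω` (`exists_adapted_orthogonal_basis`, `exists_adapted_blockBasis`, `exists_adapted_orthonormal_basis`; Gram–Schmidt:
  `exists_maximal_orthogonal_adapted_family`, `exists_orthogonal_decomposition`).
* Part E — Lemma 5.2 assembled POINTWISE at the level of `G_Ω` (v2 p.24 L33–36, proof p.25 L10–27): `I₁, I₂ ∈ Compl_Ω` have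
  the same signature iff some `g` with `g*Ω = Ω` conjugates `I₁` to `I₂` (`sigPos_sigNeg_eq_card_of_adapted_basis`,
  `exists_conj_invariant_of_sigPos_eq`, `sigPos_eq_of_conj_invariant`, `exists_conj_invariant_iff_sigPos_eq`) — Parts A, B, D combined.
* Part F — Theorem 5.4's FIRST SENTENCE with `π₀Compl±_Ω` replaced by the `G_Ω`-conjugacy classes in `Compl_Ω` (v2 p.24 L54–60
  with L6–16): `Sign(I) ∈ S_Ω` (`even_sigPos_and_even_sigNeg`, `exists_sigPos_eq_two_mul_and_sigNeg_eq_two_mul`) and the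
  three-clause `sign_orbit_bijection` (range, surjectivity = Part B, injectivity on `G_Ω`-orbits = Part E).

## What is NOT in this file

`Compl`, `Compl±`, `Compl_Ω`, `G_Ω`, `G⁰_Ω`, `Sign`, `S̃ign`, `π₀`, `L_Ω` as named objects (the statements quantify over operators,
subspaces and the subtype `{I | I² = −1, Ω(I·, I·) = Ω}` directly); the orientation superscript `±`; Lemma 5.2 PROPER — that the
conjugating `g` lies in the identity component `G⁰_Ω` (v2 p.25 L27–33) — and hence the identification of `Sign`-fibres with
connected components (p.24 L37–40) and the injectivity of `S̃ign` on `π₀`; Theorem 5.4's bijection AS PRINTED, on `π₀Compl±_Ω`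
(Part F has it on `G_Ω`-orbits only), the count `2n + 1 − n₀` of components, homogeneity `G⁰_Ω/U(n₊, n₋, n₀)`, the
complex-submanifold statement beyond its linear algebra (Part A), and the twistor PATH connectivity of
`Sign⁻¹(n − n₀⁄2, n − n₀⁄2, n₀)`; Cor. 5.5; Rem. 5.6. The signature CRITERION of Thm. 5.4 ∕ Cor. 5.5 (`n₊ = n₋`, `n₀` even for
`Ω` invariant under an anticommuting pair, and the converse construction of `J`) is the tree's
`TwistorLineHermitianFormSignature.lean` (complex carrier) and is not repeated.

## References

* [BuskinIzadi2020TwistorLinesTori] N. Buskin, E. Izadi, *Twistor lines in the period domain of complex tori*, Geom. Dedicata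
  213 (2021) 21–47 = arXiv:1806.07831v2, §5 (v2 pp. 23–27): p.23 L20–33 (`h`, `V₀`, signature), p.24 L6–16 (`S_Ω`, `Sign`),
  Prop. 5.1 (p.24 L17–24), Lemma 5.2 (p.24 L33–36; proof p.25 L10–34), Lemma 5.3 (p.24 L50–52; proof p.25 L35–53), Thm. 5.4
  (p.24 L54–74), eq. (9) (p.26 L8–25).
* [Lang2002] S. Lang, *Algebra*, 3rd ed., GTM 211 (2002), Ch. XV §8 Thm. 8.1 (symplectic basis of an alternating form) — through
  the tree's `Literature/LinearAlgebra/Alternating/DarbouxBasis.lean` (Part B).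
-/

noncomputable section

open Module

/-!
## Part A — standalone draft `HodgeLocusTwistorLineSignature.v6` (sha256∕16 074ce56f7a3c78b6), reproduced verbatim below
(its module docstring first: references to "this file" ∕ "this leaf" mean this Part; items it lists as
"NOT here" may be supplied by other Parts — see the file header; then its code, byte-identical).

# The Hodge locus `Compl_Ω` of one class: its tangent space (9) `{Y | YI = −IY, ᵗYΩ + ΩY = 0}` at `I` is `l_I`-invariant,
# and matched `h`-orthonormal bases at two periods of the same signature give `g ∈ G_Ω` with `I₂ = ᵍI₁`
# (Buskin–Izadi, §5: eq. (9) and Lemma 5.2's construction), the linear algebra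

Topic `Literature/Geometry/Hyperkaehler`, namespace `Literature.Geometry.Hyperkaehler.HodgeLocus`. Written by the literature
seat `lit-w-verbitsky` (gen 15) of the cell `pub-hsemireg` (HodgeConjecture venture), 2026-08-25, as a kernel leg of row V-V20
of that cell's Verbitsky table ("connectivity INSIDE the locus of one fixed (1,1)-class": [BI20] Thm. 2 = Thm. 5.4 with
Prop. 5.1 ∕ Lemma 5.2 ∕ Lemma 5.3 behind it). THEOREMS ONLY (no definition, no named fact, no `sorry`); PLAIN (Mathlib +
HarnessLib only). Nothing in this file is a statement about the Hodge conjecture, and nothing here says that any object of the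
cell is hyperholomorphic, rotable or carries a twistor line.

**Already in the tree, NOT repeated here.** The SIGNATURE CRITERION of Thm. 5.4 ∕ Cor. 5.5 — `h(Ju, Jv) = −h̄(u, v)` for
`Ω` invariant under an anticommuting pair, hence `n₊ = n₋` and `n₀` even, no twistor line through a Kähler class, the CONVERSE
construction of `J` from paired `h`-orthonormal bases (p.26 L40–p.27 L7), the Sylvester step producing those bases, and the
resulting `iff` — is the tree's `Literature/Geometry/Hyperkaehler/TwistorLineHermitianFormSignature.lean` (this seat's gen 7,
2026-08-24; carrier: a complex normed space with `I = i•`; headline `exists_anticommuting_invariant_iff_finrank_pos_eq_finrank_neg`,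
parity clause `even_finrank_nullSpace_of_anticommuting_invariant`) together with `KaehlerFormSquareNotInvariant.lean` §6 (the
definite corner) and, on the alternating-map carrier, `TwistorLineHodgeClassesDimension.lean` (`TwistorLine.not_forall_apply₂_map_pos`).
This file adds only the two pieces of §5's linear algebra those files do not carry: eq. (9) with its `l_I`-invariance, and
Lemma 5.2's conjugating element.

## Source, verbatim (arXiv v2 = the cell's numbering of record; "v2 p.N Lm" = PDF page N, text-layer line m of
## arXiv:1806.07831v2, sha256/16 9e1097db4f2fd005, glyphs checked on the arXiv v2 LaTeX source; §5 = pp. 23–27)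

N. Buskin, E. Izadi, *Twistor lines in the period domain of complex tori*, arXiv:1806.07831v2 (28 Jun 2020) = Geom. Dedicata
213 (2021) 21–47 (journal pages unseen by the cell), §5 "Twistor path connectivity of `Compl_Ω`".

* v2 p.23 L20–33: "Let `I` be a complex structure operator in `Compl_Ω`, that is, `Ω(Iu, Iv) = Ω(u, v)` for all `u, v ∈ V_ℝ`.
  On the vector space `(V_ℝ, I)`, considered as a complex vector space, the form `Ω` determines a hermitian form
  `h(u, v) := Ω(u, Iv) − iΩ(u, v)` (note that `h(u, Iv) = −ih(u, v)`, `h(Iu, v) = ih(u, v)`), which we will call the hermitian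
  form associated to `Ω` and `I`. The signature of `h` is a triple `(n₊, n₋, n₀)`, where `n₊, n₋` and `n₀` are the complex
  dimensions of, respectively, a maximal positive subspace `V₊`, a maximal negative subspace `V₋`, and the null subspace
  `V₀ = {u ∈ V_ℝ | h(u, v) = 0 for all v ∈ V_ℝ} = {u ∈ V_ℝ | Ω(u, v) = 0 for all v ∈ V_ℝ}` of `h` in `(V_ℝ, I)`, so that
  `n₊ + n₋ + n₀ = 2n`. The subspaces `V₊, V₋` and the numbers `n₊` and `n₋` depend, in general, on the choice of
  `I ∈ Compl_Ω`, while `V₀`, and hence `n₀`, depend only on `Ω`, `V₀` being invariant with respect to every complex structure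
  operator in `Compl_Ω`."
* v2 p.24 L33–36, **Lemma 5.2.** "The group `G⁰_Ω` acts transitively on each fiber of `Sign`. In particular, `S̃ign` is
  injective."; proof p.25 L10–34: "Let `I₁, I₂` be periods in `Compl±_Ω`. Assume that `Sign(I₁) = Sign(I₂)` … Let us choose an
  `h₁`-orthonormal basis `v₁, …, v_k` of the complex subpace `(V₊, I₁)` and an `h₂`-orthonormal basis `w₁, …, w_k` of the complex
  subpace `(W₊, I₂)`, similarly choose `−h₁`-orthonormal and `−h₂`-orthonormal bases for the subspaces `V₋, W₋`, and some
  (arbitrary) bases for `(V₀, I₁)` and `(V₀, I₂)`. Then we define `g ∈ G = GL(V_ℝ)` by setting `g(v₁) = w₁, g(I₁v₁) = I₂w₁,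
  g(v₂) = w₂, g(I₁v₂) = I₂w₂, …` and similarly for the remaining pairs of subspaces. Then we get `g ∈ G` such that `g*h₂ = h₁`
  and `I₂ = gI₁g⁻¹`, which is equivalent to saying that `g*Ω = Ω` and `I₂ = gI₁g⁻¹ = ᵍI₁`."
* v2 p.24 L54–74, **Theorem 5.4.** "The mapping `S̃ign : π₀Compl±_Ω → S_Ω` is a bijection, thus there are `2n + 1 − n₀`
  connected components of `Compl±_Ω` and they have the form `Sign⁻¹(n₊, n₋, n₀)`. Every connected component of `Compl±_Ω` is a
  homogeneous manifold of the type `G⁰_Ω/U(n₊, n₋, n₀)` and is a smooth complex submanifold in `Compl`. If `n₀` is even,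
  there is precisely one connected component of `Compl±_Ω` that contains twistor lines. This component is
  `Sign⁻¹(n − n₀⁄2, n − n₀⁄2, n₀)` [a stacked fraction `n₀` over `2`: `n₊ = n₋ = n − n₀/2`] and is twistor path connected. If `n₀` is odd, there are no connected components of
  `Compl±_Ω` containing a twistor line."
* v2 p.26 L8–25 (proof of Thm. 5.4, "The complex manifold structure"): "By definition `G_Ω = {g ∈ G | ᵗgΩg = Ω} ⊂ G`, so
  `T_eG_Ω ≅ {Y ∈ T_eG | ᵗYΩ + ΩY = 0}`. The stabilizer of `I` in `G_Ω` is `G_{I,G}` [sic; = `G_{I,Ω}`] `= G_I ∩ G_Ω`, thus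
  `T_I Compl_Ω ≅ T_eG_Ω/T_eG_{I,Ω}`. For `X ∈ T_eG_Ω`, consider the decomposition `X = ½(X + Xᴵ) + ½(X − Xᴵ)` into
  `I`-commuting and `I`-anticommuting components. Then `½(X + Xᴵ)` and `½(X − Xᴵ)` satisfy the equality `ᵗYΩ + ΩY = 0`,
  so that `½(X + Xᴵ) ∈ T_eG_{I,Ω}` and thus the isomorphism `T_I Compl_Ω ≅ T_eG_Ω/T_eG_{I,Ω}` implies the natural isomorphism
  (9) `T_I Compl_Ω ≅ {Y ∈ T_eG | YI = −IY, ᵗYΩ + ΩY = 0}`. Thus `T_I Compl_Ω` is obviously `l_I`-invariant, so it is a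
  complex subspace in `T_I Compl` for every `I ∈ Compl_Ω`, which shows that every connected component of `Compl_Ω` … is a
  complex submanifold in `Compl`."

## What is formalised (`F` = `V_ℝ`, a real normed space; `I, I₁, I₂ : F →L[ℝ] F` with square `−1`; `Ω : F →L[ℝ] F →L[ℝ] ℝ`
## bilinear; "`I ∈ Compl_Ω`" = `∀ u v, Ω (I u) (I v) = Ω u v`; "`Y ∈ T_eG_Ω`" = `∀ u v, Ω (Y u) v + Ω u (Y v) = 0`;
## `Xᴵ = −IXI`; `l_I(Y) = IY`)

* §1 eq. (9) (p.26 L8–25): `skew_conjI` (`T_eG_Ω` is stable under `X ↦ Xᴵ` when `I ∈ Compl_Ω`), **`skew_parts`** ("`½(X + Xᴵ)`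
  and `½(X − Xᴵ)` satisfy `ᵗYΩ + ΩY = 0`"), **`skew_lI`** ("`T_I Compl_Ω` is `l_I`-invariant": `Y ↦ IY` preserves
  `{Y | YI = −IY, ᵗYΩ + ΩY = 0}`) — the linear algebra of "every connected component of `Compl_Ω` is a complex submanifold in
  `Compl`".
* §2 Lemma 5.2 (p.24 L33–36, proof p.25 L10–34; finite dimension): **`exists_conj_invariant_of_matchedBases`** — for two periods
  `I₁, I₂` with `I_m`-adapted bases `r_m(β, i) = I_m^β c_{m,i}` on which `Ω` has THE SAME table (the printed choice:
  `h_m`-orthonormal ∕ `−h_m`-orthonormal ∕ null bases of the same sizes — "the same signature"), the printed `g`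
  (`g(v₁) = w₁, g(I₁v₁) = I₂w₁, …`; here `Basis.equiv`, continuous in finite dimension) satisfies `g*Ω = Ω` and `gI₁ = I₂g` —
  "`g ∈ G` such that … `g*Ω = Ω` and `I₂ = gI₁g⁻¹ = ᵍI₁`".

## What is NOT here

`Compl_Ω`, `Compl±_Ω`, `G_Ω`, `G⁰_Ω`, `Sign`, `S̃ign`, `π₀` as objects; Prop. 5.1 (local constancy of the signature); that the
`g` of §2 lies in the identity component `G⁰_Ω` (the printed Lemma 5.2 proper: transitivity of `G⁰_Ω` on the fibres of `Sign`)
and the existence of the orthonormal bases it starts from (Sylvester — in the tree for ONE period, see above); Lemma 5.3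
(every signature occurs: a construction on a normal form of `Ω`); the bijectivity ∕ homogeneity ∕ counting statements of
Thm. 5.4 and the twistor PATH connectivity of `Sign⁻¹(n − n₀⁄2, n − n₀⁄2, n₀)`; Rem. 5.6. The companion leaves
`TwistorPathDifferential.lean` ([BI20] §2) and `TwistorConeHodgeLocus.lean` (§3.2 Lemma 3.3) of the same seat are independent
of this one.

## References

* [BuskinIzadi2020TwistorLinesTori] N. Buskin, E. Izadi, *Twistor lines in the period domain of complex tori*, Geom.
  Dedicata 213 (2021) 21–47 = arXiv:1806.07831v2, §5 (pp. 23–27: the hermitian form `h` and `V₀`, Lemma 5.2 and its proof,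
  Thm. 5.4, eq. (9)) — read on the v2 PDF text layer (the cell's dump `texts-verbitsky/bi20v2/dump/` pp. 23–26) and the arXiv
  v2 LaTeX source (`texts-verbitsky/bi20v2/src/`); arXiv v1 (`paper:arxiv-1806.07831`) LACKS Thm. 2 ∕ §5's material ("Theorem 2
  and Corollary 3 have been added in the new version", arXiv v2 comment) — cite v2 only.
-/

namespace Literature.Geometry.Hyperkaehler.HodgeLocus

variable {F : Type*} [NormedAddCommGroup F] [NormedSpace ℝ F]

/-! ### §1 Eq. (9): `T_I Compl_Ω ≅ {Y | YI = −IY, ᵗYΩ + ΩY = 0}` and its invariance under `l_I` -/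

/-- `T_eG_Ω ≅ {Y ∈ T_eG | ᵗYΩ + ΩY = 0}` is stable under `I`-conjugation `X ↦ Xᴵ = −IXI` when `I ∈ Compl_Ω`, so that
"`½(X + Xᴵ)` and `½(X − Xᴵ)` satisfy the equality `ᵗYΩ + ΩY = 0`".
[cite: BuskinIzadi2020TwistorLinesTori, v2 §5, proof of Thm. 5.4 (p.26 L8–18)] -/
theorem skew_conjI {I X : F →L[ℝ] F} (hI : ∀ v, I (I v) = -v) {Ω : F →L[ℝ] F →L[ℝ] ℝ}
    (hΩI : ∀ u v, Ω (I u) (I v) = Ω u v) (hX : ∀ u v, Ω (X u) v + Ω u (X v) = 0) (u v : F) :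
    Ω ((-I.comp (X.comp I)) u) v + Ω u ((-I.comp (X.comp I)) v) = 0 := by
  simp only [_root_.neg_apply, ContinuousLinearMap.coe_comp, Function.comp_apply, map_neg, _root_.neg_apply]
  have h1 : Ω (I (X (I u))) v = -Ω (X (I u)) (I v) := by
    have := hΩI (X (I u)) (I v); rw [hI, map_neg] at this; linear_combination -this
  have h2 : Ω u (I (X (I v))) = -Ω (I u) (X (I v)) := by
    have := hΩI (I u) (X (I v)); rw [hI, map_neg, _root_.neg_apply] at this; linear_combination -this
  rw [h1, h2]
  linear_combination hX (I u) (I v)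

/-- The `I`-commuting and `I`-anticommuting parts of `X ∈ T_eG_Ω` lie in `T_eG_Ω`: "`½(X + Xᴵ) ∈ T_eG_{I,Ω}` and thus the
isomorphism `T_I Compl_Ω ≅ T_eG_Ω/T_eG_{I,Ω}` implies the natural isomorphism (9)
`T_I Compl_Ω ≅ {Y ∈ T_eG | YI = −IY, ᵗYΩ + ΩY = 0}`". [cite: BuskinIzadi2020TwistorLinesTori, v2 §5, proof of Thm. 5.4 (p.26 L11–21)] -/
theorem skew_parts {I X : F →L[ℝ] F} (hI : ∀ v, I (I v) = -v) {Ω : F →L[ℝ] F →L[ℝ] ℝ}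
    (hΩI : ∀ u v, Ω (I u) (I v) = Ω u v) (hX : ∀ u v, Ω (X u) v + Ω u (X v) = 0) :
    (∀ u v, Ω (((1 / 2 : ℝ) • (X - I.comp (X.comp I))) u) v + Ω u (((1 / 2 : ℝ) • (X - I.comp (X.comp I))) v) = 0) ∧
      ∀ u v, Ω (((1 / 2 : ℝ) • (X + I.comp (X.comp I))) u) v + Ω u (((1 / 2 : ℝ) • (X + I.comp (X.comp I))) v) = 0 := by
  have hc := skew_conjI hI hΩI hX
  refine ⟨fun u v ↦ ?_, fun u v ↦ ?_⟩
  · have h := hc u v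
    simp only [_root_.neg_apply, ContinuousLinearMap.coe_comp, Function.comp_apply, map_neg, _root_.smul_apply,
      _root_.sub_apply, map_smul, map_sub, smul_eq_mul, _root_.sub_apply] at h ⊢
    linear_combination (hX u v + h) / 2
  · have h := hc u v
    simp only [_root_.neg_apply, ContinuousLinearMap.coe_comp, Function.comp_apply, map_neg, _root_.smul_apply,
      _root_.add_apply, map_smul, map_add, smul_eq_mul, _root_.add_apply] at h ⊢
    linear_combination (hX u v - h) / 2

/-- **`T_I Compl_Ω` is `l_I`-invariant**: if `Y` anticommutes with `I` and satisfies `ᵗYΩ + ΩY = 0` (`I ∈ Compl_Ω`), then so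
does `l_I(Y) = IY` — "Thus `T_I Compl_Ω` is obviously `l_I`-invariant, so it is a complex subspace in `T_I Compl` for every
`I ∈ Compl_Ω`, which shows that every connected component of `Compl_Ω` … is a complex submanifold in `Compl`" (the linear
algebra of that sentence). [cite: BuskinIzadi2020TwistorLinesTori, v2 §5 Thm. 5.4 (p.24 L54–63), proof (p.26 L19–25)] -/
theorem skew_lI {I Y : F →L[ℝ] F} (hI : ∀ v, I (I v) = -v) {Ω : F →L[ℝ] F →L[ℝ] ℝ}
    (hΩI : ∀ u v, Ω (I u) (I v) = Ω u v) (hYI : ∀ v, Y (I v) = -I (Y v))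
    (hY : ∀ u v, Ω (Y u) v + Ω u (Y v) = 0) :
    (∀ v, (I.comp Y) (I v) = -I ((I.comp Y) v)) ∧ ∀ u v, Ω ((I.comp Y) u) v + Ω u ((I.comp Y) v) = 0 := by
  refine ⟨fun v ↦ by simp [hYI, hI], fun u v ↦ ?_⟩
  simp only [ContinuousLinearMap.coe_comp, Function.comp_apply]
  have h1 : Ω (I (Y u)) v = -Ω (Y u) (I v) := by
    have := hΩI (Y u) (I v); rw [hI, map_neg] at this; linear_combination -this
  have h2 := hY u (I v)
  rw [hYI, map_neg] at h2
  -- h2 : Ω (Y u) (I v) + -Ω u (I (Y v)) = 0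
  linear_combination h1 - h2

/-! ### §2 Lemma 5.2's construction: matched `h`-orthonormal bases give `g ∈ G_Ω` with `gI₁g⁻¹ = I₂` -/

/-- **Lemma 5.2 (Buskin–Izadi), the construction: "all hermitian forms `h` associated to `Ω` and `I ∈ Compl±_Ω` of the same
signature `(n₊, n₋, n₀)` are `G⁰_Ω`-equivalent."** Given, for two periods `I₁, I₂`, `I_m`-adapted bases `r_m(β, i) = I_m^β c_{m,i}`
on which `Ω` has THE SAME table (the printed choice: `h₁`-orthonormal, `−h₁`-orthonormal and null bases of `V₊, V₋, V₀` for `I₁`,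
likewise for `I₂`, of the same sizes — "the same signature"), the operator `g` with `g(r₁(β, i)) = r₂(β, i)` ("we define `g ∈ G`
by setting `g(v₁) = w₁, g(I₁v₁) = I₂w₁, …`") satisfies `g*Ω = Ω` and `gI₁g⁻¹ = I₂` ("`g*h₂ = h₁` and `I₂ = gI₁g⁻¹`, which is
equivalent to saying that `g*Ω = Ω` and `I₂ = gI₁g⁻¹`"). That `g` lies in the identity component `G⁰_Ω` when `I₁, I₂` lie in one
component of `Compl`, and the existence of the orthonormal bases, are NOT formalised.
[cite: BuskinIzadi2020TwistorLinesTori, v2 §5 Lemma 5.2 (p.24 L33–36), proof (p.25 L10–34)] -/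
theorem exists_conj_invariant_of_matchedBases [FiniteDimensional ℝ F] {I₁ I₂ : F →L[ℝ] F} (hI₁ : ∀ v, I₁ (I₁ v) = -v)
    (hI₂ : ∀ v, I₂ (I₂ v) = -v) {Ω : F →L[ℝ] F →L[ℝ] ℝ} {ι : Type*} (c₁ c₂ : ι → F)
    (r₁ r₂ : Basis (Bool × ι) ℝ F) (hr₁ : ∀ β i, r₁ (β, i) = bif β then I₁ (c₁ i) else c₁ i)
    (hr₂ : ∀ β i, r₂ (β, i) = bif β then I₂ (c₂ i) else c₂ i)
    (htable : ∀ x y : Bool × ι, Ω (r₁ x) (r₁ y) = Ω (r₂ x) (r₂ y)) :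
    ∃ g : F ≃L[ℝ] F, (∀ v, g (I₁ v) = I₂ (g v)) ∧ (∀ u v, Ω (g u) (g v) = Ω u v) ∧ ∀ x, g (r₁ x) = r₂ x := by
  -- `g` = the basis-to-basis map
  let g₀ : F ≃ₗ[ℝ] F := r₁.equiv r₂ (Equiv.refl _)
  let g : F ≃L[ℝ] F := g₀.toContinuousLinearEquiv
  have hg : ∀ x, g (r₁ x) = r₂ x := fun x ↦ by
    change g₀ (r₁ x) = r₂ x
    simp [g₀]
  -- the action of `I_m` on the bases
  have t0 : ∀ i, I₁ (r₁ (false, i)) = r₁ (true, i) := fun i ↦ by rw [hr₁, hr₁]; rfl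
  have t1 : ∀ i, I₁ (r₁ (true, i)) = -r₁ (false, i) := fun i ↦ by rw [hr₁, hr₁]; simp [hI₁]
  have s0 : ∀ i, I₂ (r₂ (false, i)) = r₂ (true, i) := fun i ↦ by rw [hr₂, hr₂]; rfl
  have s1 : ∀ i, I₂ (r₂ (true, i)) = -r₂ (false, i) := fun i ↦ by rw [hr₂, hr₂]; simp [hI₂]
  -- `g I₁ = I₂ g` on the basis, hence everywhere
  have e1 : ∀ x, g (I₁ (r₁ x)) = I₂ (g (r₁ x)) := by
    rintro ⟨β, i⟩
    cases β <;> simp only [t0, t1, s0, s1, hg, map_neg]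
  have hgI : ∀ v, g (I₁ v) = I₂ (g v) := fun v ↦ by
    have key : ((g : F →L[ℝ] F) : F →ₗ[ℝ] F) ∘ₗ (I₁ : F →ₗ[ℝ] F) = (I₂ : F →ₗ[ℝ] F) ∘ₗ ((g : F →L[ℝ] F) : F →ₗ[ℝ] F) :=
      r₁.ext fun x ↦ by simpa using e1 x
    simpa using LinearMap.congr_fun key v
  -- `Ω(g·, g·) = Ω` on basis pairs, hence everywhere
  have hgΩ : ∀ u v, Ω (g u) (g v) = Ω u v := by
    have step : ∀ x, (Ω (g (r₁ x))).comp (g : F →L[ℝ] F) = Ω (r₁ x) := fun x ↦ by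
      have key : (((Ω (g (r₁ x))).comp (g : F →L[ℝ] F) : F →L[ℝ] ℝ) : F →ₗ[ℝ] ℝ) =
          ((Ω (r₁ x) : F →L[ℝ] ℝ) : F →ₗ[ℝ] ℝ) :=
        r₁.ext fun y ↦ by simpa [hg] using (htable x y).symm
      exact ContinuousLinearMap.coe_inj.mp key
    intro u v
    have key : (((Ω.flip (g v)).comp (g : F →L[ℝ] F) : F →L[ℝ] ℝ) : F →ₗ[ℝ] ℝ) = ((Ω.flip v : F →L[ℝ] ℝ) : F →ₗ[ℝ] ℝ) :=
      r₁.ext fun x ↦ by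
        have := congrArg (fun T : F →L[ℝ] ℝ ↦ T v) (step x)
        simpa using this
    have := LinearMap.congr_fun key u
    simpa using this
  exact ⟨g, hgI, hgΩ, hg⟩

end Literature.Geometry.Hyperkaehler.HodgeLocus

/-!
## Part B — standalone draft `HodgeLocusSignatureSurjective.v3` (sha256∕16 a3c2c5ea1812f3aa), reproduced verbatim below
(its module docstring first: references to "this file" ∕ "this leaf" mean this Part; items it lists as
"NOT here" may be supplied by other Parts — see the file header; then its code, byte-identical).

# Every signature `(n₊, n₋, n₀)` with `n₊ + n₋ + n₀ = 2n` is the signature of the hermitian form of `Ω` at some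
# complex structure leaving `Ω` invariant (Buskin–Izadi, §5 Lemma 5.3: `S̃ign : π₀ Compl_Ω → S_Ω` is surjective),
# the construction on a `2 × 2`-block basis of `Ω`

Topic `Literature/Geometry/Hyperkaehler`, namespace `Literature.Geometry.Hyperkaehler.HodgeLocus`. Written by the literature
seat `lit-w-verbitsky` (gen 16) of the cell `pub-hsemireg` (HodgeConjecture venture), 2026-08-25, as a kernel leg of row
V-V20 of that cell's Verbitsky table ("connectivity INSIDE the locus `Compl_Ω` of one fixed `(1,1)`-class": [BI20] Thm. 2 =
Thm. 5.4, with Prop. 5.1 ∕ Lemma 5.2 ∕ Lemma 5.3 behind it). THEOREMS ONLY (no definition, no named fact, no `sorry`).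
Nothing in this file is a statement about the Hodge conjecture, and nothing here says that any object of the cell is
hyperholomorphic, rotable or carries a twistor line.

**Already in the tree or keyed, NOT repeated here.** The SIGNATURE CRITERION of Thm. 5.4 ∕ Cor. 5.5 (`n₊ = n₋`, `n₀` even,
for `Ω` invariant under an anticommuting pair; the converse construction of `J`; Sylvester's step) is the tree's
`TwistorLineHermitianFormSignature.lean` (this seat's gen 7; carrier: a complex normed space, `I = i•`); eq. (9) and
Lemma 5.2's conjugating element are the keyed leaf `HodgeLocusTwistorLineSignature.lean` (gen 15); [BI20] §1–§3's linear
algebra is `ComplexStructureAdaptedBasis.lean`, `AnticommutingComplexStructuresDimension.lean`, `TwistorPathDifferential.lean`,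
`TwistorConeHodgeLocus.lean`. This file adds Lemma 5.3 — the one statement of §5 those files list under "NOT here: Lemma 5.3
(every signature occurs: a construction on a normal form of `Ω`)" — on the REAL carrier `V_ℝ = F` with the `2`-form as an
alternating map `Ω : F [⋀^Fin 2]→L[ℝ] ℝ` and the complex structure an operator `I : F →L[ℝ] F`, `I² = −1` (the carrier of
`TwistorLineHodgeClassesDimension.lean`), the normal form being the tree's Darboux theorem
`Literature.LinearAlgebra.Alternating.exists_symplecticBasis_card` ([Lang2002, XV §8 Thm. 8.1]) on a complement of the null
space.

## Source, verbatim (N. Buskin, E. Izadi, *Twistor lines in the period domain of complex tori*, arXiv:1806.07831v2 (28 Jun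
## 2020) = Geom. Dedicata 213 (2021) 21–47, journal pages unseen by the cell; "v2 p.N Lm" = PDF page N, text-layer line m of
## the cell's dump `texts-verbitsky/bi20v2/dump/` (PDF sha256∕16 9e1097db4f2fd005), glyphs checked on the arXiv v2 LaTeX source
## `texts-verbitsky/bi20v2/src/Twistor-path-conn-06-20-20.tex` (sha256∕16 201e79451d245bd7, ll. 1713–1730))

* v2 p.23 L20–33: "Let `I` be a complex structure operator in `Compl_Ω`, that is, `Ω(Iu, Iv) = Ω(u, v)` for all
  `u, v ∈ V_ℝ`. On the vector space `(V_ℝ, I)`, considered as a complex vector space, the form `Ω` determines a hermitian form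
  `h(u, v) := Ω(u, Iv) − iΩ(u, v)` […] which we will call the hermitian form associated to `Ω` and `I`. The signature of `h`
  is a triple `(n₊, n₋, n₀)`, where `n₊`, `n₋` and `n₀` are the complex dimensions of, respectively, a maximal positive
  subspace `V₊`, a maximal negative subspace `V₋`, and the null subspace
  `V₀ = {u ∈ V_ℝ | h(u, v) = 0 for all v ∈ V_ℝ} = {u ∈ V_ℝ | Ω(u, v) = 0 for all v ∈ V_ℝ}` of `h` in `(V_ℝ, I)`, so that
  `n₊ + n₋ + n₀ = 2n`. The subspaces `V₊`, `V₋` and the numbers `n₊` and `n₋` depend, in general, on the choice of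
  `I ∈ Compl_Ω`, while `V₀`, and hence `n₀`, depend only on `Ω`, `V₀` being invariant with respect to every complex
  structure operator in `Compl_Ω`."  (`dim_ℝ V_ℝ = 4n`, §1.1 p.5 L22–24.)
* v2 p.24 L6–16: "We set `Compl±_Ω := Compl_Ω ∩ Compl±`. Consider the finite set
  `S_Ω := {(k, l, n₀) | k, l ∈ ℤ_{⩾0}, k + l + n₀ = 2n}` consisting of `2n − n₀ + 1` triples, and the mapping
  `Sign : Compl±_Ω → S_Ω`, `I ↦` the signature `(n₊, n₋, n₀)` of `h` assoc. to `Ω` and `I`."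
* v2 p.24 L50–52, **Lemma 5.3.** "The mapping `S̃ign : π₀Compl±_Ω → S_Ω` is surjective."
* v2 p.25 L35–53, **Proof of Lemma 5.3.** "Let `(n₊, n₋, n₀)` be a triple `∈ S_Ω`, `n₊ + n₋ + n₀ = 2n`. Let us prove that
  there exists `I ∈ Compl±_Ω` such that the hermitian form `h` associated to `Ω` and `I` has signature `(n₊, n₋, n₀)`.
  Choose a basis `v₁, …, v_{4n}` of `V_ℝ` such that the skew-symmetric matrix `Ω(v_i, v_j)` has `2 × 2`-block diagonal
  structure and set `L_Ω : V_ℝ → V_ℝ` to be the operator defined by this matrix in the chosen basis. By the definition of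
  `n₀` there are `n₊ + n₋ = 2n − n₀` nonzero `2×2`-blocks and `n₀` zero `2×2`-blocks in the matix [sic] of `L_Ω`. Let
  `V_ℝ = P₁ ⊕ ⋯ ⊕ P_{n₊} ⊕ Q₁ ⊕ ⋯ ⊕ Q_{n₋} ⊕ U` be a direct sum decomposition into `L_Ω`-invariant real `2`-planes
  `P_j, Q_j` and `2n₀`-dimensional real subspace `U = Ker L_Ω`, where `L_Ω|_{P_i}, L_Ω|_{Q_j}` are nonzero and `L_Ω|_U = 0`.
  Define `I : P_i → P_i`, `1 ⩽ i ⩽ n₊`, to be the appropriate negative multiple of `L_Ω|_{P_i}`, `I : Q_j → Q_j`,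
  `1 ⩽ j ⩽ n₋`, to be the appropriate positive multiple of `L_Ω|_{Q_j}`, and `I : U → U` to be an arbitrary operator so
  as to form an operator `I : V_ℝ → V_ℝ` satisfying `I² = −Id`. Then the decomposition
  `V_ℝ = P₁ ⊕ ⋯ ⊕ P_{n₊} ⊕ Q₁ ⊕ ⋯ ⊕ Q_{n₋} ⊕ U` is orthogonal with respect to `h(u, v) = Ω(u, Iv) − iΩ(u, v)`,
  `h|_{P_i} > 0`, `h|_{Q_j} < 0` and `h|_U = 0`. Thus we have constructed the required `I`, this proves the surjectivity of
  `S̃ign`."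

## What is formalised (`F` = `V_ℝ`, a real normed space, finite-dimensional where a basis is produced; `Ω : F [⋀^Fin 2]→L[ℝ] ℝ`;
## "`I ∈ Compl_Ω`" = `I² = −1 ∧ ∀ u v, Ω ![I u, I v] = Ω ![u, v]`; `h(u, u) = Ω ![u, I u]`; a "`2×2`-block basis" is a basis
## `β : K ⊕ K → F`, blocks `⟨e_k, f_k⟩ = ⟨β(inl k), β(inr k)⟩`, with `Ω(e_k, e_l) = Ω(f_k, f_l) = 0`, `Ω(e_k, f_l) = δ_kl κ_k`)

* §1 `exists_complexStructure_of_blockBasis` — the printed operator: for signs `ε_k = ±1` an `I` with `I² = −Id`,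
  `I e_k = ε_k f_k`, `I f_k = −ε_k e_k` (on a block with `κ_k > 0`, `ε_k = 1` is "the appropriate negative multiple of
  `L_Ω|_{P_i}`" and `ε_k = −1` "the appropriate positive multiple"; on a null block either is "an arbitrary operator").
* §2 **`apply₂_map_map_of_blockBasis`** — this `I` lies in `Compl_Ω` (`Ω(Iu, Iv) = Ω(u, v)`); **`apply₂_self_map_eq_sum`** —
  `h(u, u) = Ω(u, Iu) = Σ_k ε_k κ_k (x_k² + y_k²)` in the coordinates of `β`; `apply₂_eq_sum_blocks` — the block form of `Ω`
  itself, `Ω(u, v) = Σ_k κ_k (x_k(u) y_k(v) − y_k(u) x_k(v))`.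
* §3 the spans `P_S = ⟨e_k, f_k : k ∈ S⟩` of sets of blocks (`Submodule.span ℝ (β '' (S.disjSum S))`): `mem_span_blocks_iff`,
  `finrank_span_blocks` (`dim_ℝ P_S = 2·#S`), `map_mem_span_blocks` (`I`-stable: complex subspaces of `(V_ℝ, I)`),
  **`apply₂_self_map_pos_of_mem_span_blocks`** ∕ `…_neg_…` ∕ `…_nonpos_…` ("`h|_{P_i} > 0`, `h|_{Q_j} < 0` and `h|_U = 0`"),
  `apply₂_eq_zero_of_mem_span_blocks_disjoint` ("the decomposition … is orthogonal with respect to `h`"), and the signature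
  COUNT **`finrank_le_of_apply₂_self_map_pos`** ∕ `…_neg` — every real subspace on which `h(u, u) > 0` (resp. `< 0`) has real
  dimension `⩽ 2·#{k : ε_k κ_k > 0}` (resp. `< 0`): it meets the span of the other blocks, where `h ⩽ 0` (resp. `⩾ 0`), only
  in `0` — so these block counts ARE the indices `n₊`, `n₋` of p.23 ("dimensions of a maximal positive ∕ negative subspace").
* §4 the null space: `exists_nullSpace` (`V₀` as a submodule — the statements take ANY submodule `V₀` with the printed
  membership `u ∈ V₀ ↔ ∀ v, Ω(u, v) = 0`), **`map_mem_nullSpace`** ("`V₀` being invariant with respect to every complex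
  structure operator in `Compl_Ω`"), `apply₂_self_map_eq_zero_of_mem_nullSpace` (`h|_{V₀} = 0`), `even_finrank_nullSpace`
  (`dim_ℝ V₀ ≡ dim_ℝ V_ℝ (mod 2)`, so `n₀ = dim_ℂ V₀` is an integer when `dim_ℝ V_ℝ = 4n`), and **`exists_blockBasis`** — the
  printed basis: `K = ι ⊕ Fin n₀`, `κ = 1` on the `ι`-blocks (Darboux on a complement `W` of `V₀`, where `Ω` is non-degenerate:
  `exists_isCompl_darboux`, private) and `κ = 0` on `n₀` blocks spanning `V₀`, `dim_ℝ V_ℝ = 2(#ι + n₀)` ("`2n − n₀` nonzero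
  `2×2`-blocks and `n₀` zero `2×2`-blocks").
* §5 **`exists_invariant_complexStructure_signature`** — LEMMA 5.3's content: for `dim_ℝ V₀ = 2n₀` and ANY `n₊, n₋` with
  `dim_ℝ V_ℝ = 2(n₊ + n₋ + n₀)` there is `I ∈ Compl_Ω` with an `I`-stable `h`-positive subspace of real dimension `2n₊`, an
  `I`-stable `h`-negative one of real dimension `2n₋`, and no `h`-positive (resp. `h`-negative) real subspace of larger
  dimension — `Sign(I) = (n₊, n₋, n₀)`; **`exists_invariant_complexStructure_signature_of_mem_SOmega`** — the same in the
  printed numerology `dim_ℝ V_ℝ = 4n`, `(n₊, n₋, n₀) ∈ S_Ω` (`n₊ + n₋ + n₀ = 2n`).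
* §6 the same in the vocabulary of Sylvester's law of inertia (Mathlib's `sigPos` ∕ `sigNeg` of a quadratic form over an
  ordered field = the maximal dimension of a positive ∕ negative definite subspace, `sigPos_add_sigNeg_add_radical`):
  `exists_quadraticForm` (the real quadratic form `q_I(u) = h(u, u) = Ω(u, Iu)`), `sigPos_eq_of_maximal` ∕
  `sigNeg_eq_of_maximal` (bridge from the subspace-and-bound reading), and
  **`exists_invariant_complexStructure_sigPos_eq`**: `∃ I ∈ Compl_Ω` with `sigPos q_I = 2n₊`, `sigNeg q_I = 2n₋`,
  `dim_ℝ rad q_I = 2n₀`.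

## What is NOT here

`Compl`, `Compl±`, `Compl_Ω`, `G_Ω`, `Sign`, `S̃ign`, `π₀`, `L_Ω` as objects (the statements quantify over operators `I` and
subspaces directly; `S_Ω`'s count `2n − n₀ + 1` is `Finset.Nat.card_antidiagonal` and is not restated); the orientation
superscript `±` (which of `Compl⁺`, `Compl⁻` the constructed `I` lies in is not tracked — the printed proof does not track it
either); Prop. 5.1 (local constancy of `Sign` — topology), Lemma 5.2 proper (`G⁰_Ω`-transitivity; its conjugating element is
the keyed `HodgeLocusTwistorLineSignature.lean`), Thm. 5.4's bijectivity ∕ homogeneity ∕ complex-submanifold ∕ twistor-path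
statements, Cor. 5.5, Rem. 5.6. The signature of the HERMITIAN form `h` on the complex space `(V_ℝ, I)` is not
introduced as a function: as in `TwistorLineHermitianFormSignature.lean`, `n₊`, `n₋` enter as dimensions of positive ∕
negative subspaces together with the maximality bound (§5), or through Mathlib's `sigPos` ∕ `sigNeg` of the REAL
quadratic form `u ↦ h(u, u)` on `V_ℝ`, which are `2n₊`, `2n₋` (§6); that `rad q_I = V₀` as a subspace (only its
dimension `2n₀` is recorded).

## References

* [BuskinIzadi2020TwistorLinesTori] N. Buskin, E. Izadi, *Twistor lines in the period domain of complex tori*, Geom. Dedicata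
  213 (2021) 21–47 = arXiv:1806.07831v2, §5: p.23 L20–33 (the hermitian form `h`, `V₀`, signature), p.24 L6–16 (`S_Ω`, `Sign`),
  Lemma 5.3 (p.24 L50–52) and its proof (p.25 L35–53; LaTeX source ll. 1713–1730). arXiv v1 (`paper:arxiv-1806.07831`) LACKS
  §5's material ("Theorem 2 and Corollary 3 have been added in the new version") — cite v2 only.
* [Lang2002] S. Lang, *Algebra*, 3rd ed., GTM 211 (2002), Ch. XV §8 Thm. 8.1 (alternating forms: symplectic basis) — through
  the tree's `Literature/LinearAlgebra/Alternating/DarbouxBasis.lean`.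
-/

namespace Literature.Geometry.Hyperkaehler.HodgeLocus

variable {F : Type*} [NormedAddCommGroup F] [NormedSpace ℝ F]

/-! ### §0 Plumbing: the `2`-covector as a bilinear form -/

/-- The `2`-covector `Ω` as a bilinear form `(u, v) ↦ Ω(u, v)` (existence form, so that no definition is introduced).
[folklore] -/
private theorem exists_bilinForm (Ω : F [⋀^Fin 2]→L[ℝ] ℝ) :
    ∃ B : LinearMap.BilinForm ℝ F, ∀ u v, B u v = Ω ![u, v] :=
  ⟨LinearMap.mk₂ ℝ (fun u v => Ω ![u, v]) (apply₂_add_left Ω) (apply₂_smul_left Ω) (apply₂_add_right Ω)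
    (apply₂_smul_right Ω), fun _ _ => rfl⟩

/-- `Ω(u, u) = 0`. [folklore] -/
private theorem apply₂_self_eq_zero (Ω : F [⋀^Fin 2]→L[ℝ] ℝ) (u : F) : Ω ![u, u] = 0 := by
  have h := apply₂_swap Ω u u
  linarith

/-! ### §1 The complex structure attached to a `2 × 2`-block basis and a choice of signs

[BI20] p.25 L37–44: "Choose a basis `v₁, …, v_{4n}` of `V_ℝ` such that the skew-symmetric matrix `Ω(v_i, v_j)` has
`2×2`-block diagonal structure and set `L_Ω : V_ℝ → V_ℝ` to be the operator defined by this matrix in the chosen basis.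
[…] Define `I : P_i → P_i, 1 ⩽ i ⩽ n₊`, to be the appropriate negative multiple of `L_Ω|_{P_i}`, `I : Q_j → Q_j,
1 ⩽ j ⩽ n₋`, to be the appropriate positive multiple of `L_Ω|_{Q_j}`, and `I : U → U` to be an arbitrary operator so as
to form an operator `I : V_ℝ → V_ℝ` satisfying `I² = −Id`."  Here the basis is `β : K ⊕ K → V_ℝ`, the `k`-th block being
the plane `⟨e_k, f_k⟩ = ⟨β (inl k), β (inr k)⟩`, and the operator is `I e_k = ε_k f_k`, `I f_k = −ε_k e_k` for a sign
vector `ε : K → {±1}` (`ε_k = 1`: the rotation `e_k ↦ f_k ↦ −e_k`, the "negative multiple of `L_Ω|_{P_i}`" when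
`Ω(e_k, f_k) > 0`; `ε_k = −1`: the opposite rotation; on a null block either choice is "an arbitrary operator" with
square `−1`). -/

/-- **The operator `I` of [BI20] Lemma 5.3's proof exists**: for a basis `β` of `V_ℝ` indexed by `K ⊕ K` (blocks
`⟨β (inl k), β (inr k)⟩`) and signs `ε_k = ±1` there is a (continuous) linear operator `I` with `I² = −Id`,
`I β(inl k) = ε_k β(inr k)` and `I β(inr k) = −ε_k β(inl k)` ("… so as to form an operator `I : V_ℝ → V_ℝ` satisfying
`I² = −Id`"). [cite: BuskinIzadi2020TwistorLinesTori, v2 §5, proof of Lemma 5.3 (p.25 L37–48)] -/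
theorem exists_complexStructure_of_blockBasis {K : Type*} [Fintype K] (β : Basis (K ⊕ K) ℝ F) (ε : K → ℝ)
    (hε : ∀ k, ε k ^ 2 = 1) :
    ∃ I : F →L[ℝ] F, (∀ v, I (I v) = -v) ∧ (∀ k, I (β (.inl k)) = ε k • β (.inr k)) ∧
      ∀ k, I (β (.inr k)) = -(ε k • β (.inl k)) := by
  classical
  haveI : FiniteDimensional ℝ F := Module.Finite.of_basis β
  let t : K ⊕ K → F := Sum.elim (fun k => ε k • β (.inr k)) (fun k => -(ε k • β (.inl k)))
  let Iₗ : F →ₗ[ℝ] F := β.constr ℝ t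
  have h1 : ∀ k, Iₗ (β (.inl k)) = ε k • β (.inr k) := fun k => by
    simp [Iₗ, t]
  have h2 : ∀ k, Iₗ (β (.inr k)) = -(ε k • β (.inl k)) := fun k => by
    simp [Iₗ, t]
  have hε' : ∀ k, ε k * ε k = 1 := fun k => by rw [← sq]; exact hε k
  have hsq : Iₗ ∘ₗ Iₗ = -LinearMap.id := β.ext fun x => by
    rcases x with k | k
    · simp only [LinearMap.coe_comp, Function.comp_apply, h1, map_smul, h2, smul_neg, smul_smul, hε', one_smul,
        LinearMap.neg_apply, LinearMap.id_coe, id_eq]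
    · simp only [LinearMap.coe_comp, Function.comp_apply, h2, map_neg, map_smul, h1, smul_smul, hε', one_smul,
        LinearMap.neg_apply, LinearMap.id_coe, id_eq]
  refine ⟨LinearMap.toContinuousLinearMap Iₗ, fun v => ?_, fun k => ?_, fun k => ?_⟩
  · have := LinearMap.congr_fun hsq v
    simpa using this
  · simpa using h1 k
  · simpa using h2 k

/-! ### §2 `I ∈ Compl_Ω` and the hermitian form of `Ω` and `I` in the block basis

The hypotheses `hee`, `hff`, `hef` say that the matrix of `Ω` in the basis `β` is `2×2`-block diagonal with blocks
`((0, κ_k), (−κ_k, 0))` ("the skew-symmetric matrix `Ω(v_i, v_j)` has `2×2`-block diagonal structure"; `κ_k ≠ 0` on the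
planes `P_i, Q_j`, `κ_k = 0` on the blocks of `U = Ker L_Ω`). -/

/-- **`I ∈ Compl_Ω`**: the operator `I` (`I e_k = ε_k f_k`, `I f_k = −ε_k e_k`, `ε_k = ±1`) of a `2×2`-block basis of
`Ω` leaves `Ω` invariant, `Ω(Iu, Iv) = Ω(u, v)`. [cite: BuskinIzadi2020TwistorLinesTori, v2 §5, proof of Lemma 5.3
(p.25 L37–48: "Thus we have constructed the required `I`" — the required `I` lies in `Compl_Ω`, p.23 L20–21:
"`Ω(Iu, Iv) = Ω(u, v)` for all `u, v ∈ V_ℝ`")] -/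
theorem apply₂_map_map_of_blockBasis {K : Type*} [Fintype K] [DecidableEq K] (β : Basis (K ⊕ K) ℝ F)
    (Ω : F [⋀^Fin 2]→L[ℝ] ℝ) {κ ε : K → ℝ} (hε : ∀ k, ε k ^ 2 = 1)
    (hee : ∀ k l, Ω ![β (.inl k), β (.inl l)] = 0) (hff : ∀ k l, Ω ![β (.inr k), β (.inr l)] = 0)
    (hef : ∀ k l, Ω ![β (.inl k), β (.inr l)] = if k = l then κ k else 0)
    {I : F →L[ℝ] F} (hIe : ∀ k, I (β (.inl k)) = ε k • β (.inr k))
    (hIf : ∀ k, I (β (.inr k)) = -(ε k • β (.inl k))) (u v : F) :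
    Ω ![I u, I v] = Ω ![u, v] := by
  obtain ⟨B, hB⟩ := exists_bilinForm Ω
  have hfe : ∀ k l, Ω ![β (.inr k), β (.inl l)] = -(if l = k then κ l else 0) := fun k l => by
    rw [apply₂_swap, hef]
  have hε' : ∀ k, ε k * ε k = 1 := fun k => by rw [← sq]; exact hε k
  -- `Ω(I·, I·) = Ω` as bilinear forms: check on basis pairs
  have key : B.compl₁₂ (I : F →ₗ[ℝ] F) (I : F →ₗ[ℝ] F) = B := by
    refine LinearMap.BilinForm.ext_basis β fun x y => ?_
    simp only [LinearMap.compl₁₂_apply, ContinuousLinearMap.coe_coe, hB]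
    rcases x with k | k <;> rcases y with l | l
    · rw [hIe, hIe, apply₂_smul_left, apply₂_smul_right, hff, hee, smul_zero, smul_zero]
    · rw [hIe, hIf, apply₂_smul_left, apply₂_neg_right, apply₂_smul_right, hfe, hef]
      by_cases hkl : k = l
      · subst hkl
        simp only [if_true, smul_eq_mul]
        linear_combination (κ k) * hε' k
      · rw [if_neg (Ne.symm hkl), if_neg hkl]
        simp
    · rw [hIf, hIe, apply₂_neg_left, apply₂_smul_left, apply₂_smul_right, hef, hfe]
      by_cases hkl : k = l
      · subst hkl
        simp only [if_true, smul_eq_mul]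
        linear_combination (-(κ k)) * hε' k
      · rw [if_neg hkl, if_neg (Ne.symm hkl)]
        simp
    · rw [hIf, hIf, apply₂_neg_left, apply₂_neg_right, apply₂_smul_left, apply₂_smul_right, hee, hff, smul_zero,
        smul_zero, neg_zero, neg_zero]
  have h := LinearMap.congr_fun₂ key u v
  simpa only [LinearMap.compl₁₂_apply, ContinuousLinearMap.coe_coe, hB] using h

/-- **The hermitian form `h` of `Ω` and `I` in the block basis.** Its real part on the diagonal, `h(u, u) = Ω(u, Iu)`
(p.23 L22–24: "`h(u, v) := Ω(u, Iv) − iΩ(u, v)`"), is the diagonal form `Σ_k ε_k κ_k (x_k² + y_k²)` in the coordinates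
`u = Σ_k (x_k e_k + y_k f_k)`: "the decomposition `V_ℝ = P₁ ⊕ … ⊕ P_{n₊} ⊕ Q₁ ⊕ … ⊕ Q_{n₋} ⊕ U` is orthogonal with
respect to `h(u, v) = Ω(u, Iv) − iΩ(u, v)`, `h|_{P_i} > 0`, `h|_{Q_j} < 0` and `h|_U = 0`" (the blocks with
`ε_k κ_k > 0`, `< 0`, `= 0`). [cite: BuskinIzadi2020TwistorLinesTori, v2 §5, proof of Lemma 5.3 (p.25 L44–48)] -/
theorem apply₂_self_map_eq_sum {K : Type*} [Fintype K] [DecidableEq K] (β : Basis (K ⊕ K) ℝ F)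
    (Ω : F [⋀^Fin 2]→L[ℝ] ℝ) {κ ε : K → ℝ}
    (hee : ∀ k l, Ω ![β (.inl k), β (.inl l)] = 0) (hff : ∀ k l, Ω ![β (.inr k), β (.inr l)] = 0)
    (hef : ∀ k l, Ω ![β (.inl k), β (.inr l)] = if k = l then κ k else 0)
    {I : F →L[ℝ] F} (hIe : ∀ k, I (β (.inl k)) = ε k • β (.inr k))
    (hIf : ∀ k, I (β (.inr k)) = -(ε k • β (.inl k))) (u : F) :
    Ω ![u, I u] = ∑ k, ε k * κ k * (β.repr u (.inl k) ^ 2 + β.repr u (.inr k) ^ 2) := by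
  obtain ⟨B, hB⟩ := exists_bilinForm Ω
  have hfe : ∀ k l, Ω ![β (.inr k), β (.inl l)] = -(if l = k then κ l else 0) := fun k l => by
    rw [apply₂_swap, hef]
  -- the matrix `Ω(β x, I β y)` is diagonal with entries `ε_k κ_k` (twice)
  have M : ∀ x y : K ⊕ K,
      B (β x) (I (β y)) = if x = y then Sum.elim (fun k => ε k * κ k) (fun k => ε k * κ k) x else 0 := by
    intro x y
    rw [hB]
    rcases x with k | k <;> rcases y with l | l
    · rw [hIe, apply₂_smul_right, hef]
      by_cases h : k = l
      · subst h; simp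
      · simp [h]
    · rw [hIf, apply₂_neg_right, apply₂_smul_right, hee]; simp
    · rw [hIe, apply₂_smul_right, hff]; simp
    · rw [hIf, apply₂_neg_right, apply₂_smul_right, hfe]
      by_cases h : k = l
      · subst h; simp
      · simp [h, Ne.symm h]
  set c := β.repr u with hc
  have hu : u = ∑ x, c x • β x := (β.sum_repr u).symm
  calc Ω ![u, I u] = B u (I u) := (hB u (I u)).symm
    _ = ∑ x, ∑ y, c x * c y * B (β x) (I (β y)) := by
        conv_lhs => rw [hu]
        simp only [map_sum, map_smul, LinearMap.sum_apply, LinearMap.smul_apply, smul_eq_mul, Finset.mul_sum]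
        rw [Finset.sum_comm]
        refine Finset.sum_congr rfl fun x _ => Finset.sum_congr rfl fun y _ => ?_
        ring
    _ = ∑ x, c x * c x * Sum.elim (fun k => ε k * κ k) (fun k => ε k * κ k) x := by
        refine Finset.sum_congr rfl fun x _ => ?_
        simp only [M, mul_ite, mul_zero, Finset.sum_ite_eq, Finset.mem_univ, if_true]
    _ = ∑ k, ε k * κ k * (c (.inl k) ^ 2 + c (.inr k) ^ 2) := by
        rw [Fintype.sum_sum_type, ← Finset.sum_add_distrib]
        refine Finset.sum_congr rfl fun k _ => ?_
        simp only [Sum.elim_inl, Sum.elim_inr]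
        ring

/-- **`Ω` in the block basis**: `Ω(u, v) = Σ_k κ_k (x_k(u) y_k(v) − y_k(u) x_k(v))` — "the skew-symmetric matrix
`Ω(v_i, v_j)` has `2×2`-block diagonal structure". [cite: BuskinIzadi2020TwistorLinesTori, v2 §5, proof of Lemma 5.3
(p.25 L37–40)] -/
theorem apply₂_eq_sum_blocks {K : Type*} [Fintype K] [DecidableEq K] (β : Basis (K ⊕ K) ℝ F)
    (Ω : F [⋀^Fin 2]→L[ℝ] ℝ) {κ : K → ℝ}
    (hee : ∀ k l, Ω ![β (.inl k), β (.inl l)] = 0) (hff : ∀ k l, Ω ![β (.inr k), β (.inr l)] = 0)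
    (hef : ∀ k l, Ω ![β (.inl k), β (.inr l)] = if k = l then κ k else 0) (u v : F) :
    Ω ![u, v] = ∑ k, κ k * (β.repr u (.inl k) * β.repr v (.inr k) - β.repr u (.inr k) * β.repr v (.inl k)) := by
  obtain ⟨B, hB⟩ := exists_bilinForm Ω
  have hfe : ∀ k l, Ω ![β (.inr k), β (.inl l)] = -(if l = k then κ l else 0) := fun k l => by
    rw [apply₂_swap, hef]
  set c := β.repr u with hc
  set d := β.repr v with hd
  have hu : u = ∑ x, c x • β x := (β.sum_repr u).symm
  have hv : v = ∑ x, d x • β x := (β.sum_repr v).symm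
  -- row sums of the block matrix against the coordinates of `v`
  have row : ∀ x : K ⊕ K, ∑ y, d y * B (β x) (β y) =
      Sum.elim (fun k => κ k * d (.inr k)) (fun k => -(κ k * d (.inl k))) x := by
    intro x
    rcases x with k | k
    · rw [Fintype.sum_sum_type]
      simp only [hB, hee, mul_zero, Finset.sum_const_zero, zero_add, hef, mul_ite, Finset.sum_ite_eq,
        Finset.mem_univ, if_true, Sum.elim_inl]
      ring
    · rw [Fintype.sum_sum_type]
      simp only [hB, hfe, hff, mul_zero, Finset.sum_const_zero, add_zero, mul_neg, mul_ite, Finset.sum_neg_distrib,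
        Finset.sum_ite_eq', Finset.mem_univ, if_true, Sum.elim_inr]
      ring
  calc Ω ![u, v] = B u v := (hB u v).symm
    _ = ∑ y, ∑ x, d y * (c x * B (β x) (β y)) := by
        conv_lhs => rw [hu, hv]
        simp only [map_sum, map_smul, LinearMap.sum_apply, LinearMap.smul_apply, smul_eq_mul, Finset.mul_sum]
    _ = ∑ x, c x * ∑ y, d y * B (β x) (β y) := by
        rw [Finset.sum_comm]
        refine Finset.sum_congr rfl fun x _ => ?_
        rw [Finset.mul_sum]
        refine Finset.sum_congr rfl fun y _ => ?_
        ring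
    _ = ∑ k, κ k * (c (.inl k) * d (.inr k) - c (.inr k) * d (.inl k)) := by
        simp only [row]
        rw [Fintype.sum_sum_type, ← Finset.sum_add_distrib]
        refine Finset.sum_congr rfl fun k _ => ?_
        simp only [Sum.elim_inl, Sum.elim_inr]
        ring

/-! ### §3 The span of a set `S` of blocks: `P_S = ⟨e_k, f_k : k ∈ S⟩ = span (β '' (S ⊔ S))`

"Let `V_ℝ = P₁ ⊕ … ⊕ P_{n₊} ⊕ Q₁ ⊕ … ⊕ Q_{n₋} ⊕ U` be a direct sum decomposition into `L_Ω`-invariant real `2`-planes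
`P_j, Q_j` and `2n₀`-dimensional real subspace `U = Ker L_Ω`" (p.25 L40–42): the three summands are the spans of the
blocks with `ε_k κ_k > 0`, `< 0` and `κ_k = 0`. -/

/-- Membership in the span `P_S = ⟨e_k, f_k : k ∈ S⟩` of a set `S` of blocks: the coordinates outside `S` vanish (the
summands "`P₁ ⊕ … ⊕ P_{n₊}`", "`Q₁ ⊕ … ⊕ Q_{n₋}`", "`U`" of the printed decomposition are such spans).
[cite: BuskinIzadi2020TwistorLinesTori, v2 §5, proof of Lemma 5.3 (p.25 L42–44)] -/
theorem mem_span_blocks_iff {K : Type*} [Fintype K] (β : Basis (K ⊕ K) ℝ F) (S : Finset K)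
    (u : F) : u ∈ Submodule.span ℝ (β '' ↑(S.disjSum S)) ↔
      ∀ k ∉ S, β.repr u (.inl k) = 0 ∧ β.repr u (.inr k) = 0 := by
  rw [β.mem_span_image]
  constructor
  · intro h k hk
    constructor
    · by_contra hne
      have := h (Finsupp.mem_support_iff.mpr hne)
      rw [Finset.mem_coe, Finset.inl_mem_disjSum] at this
      exact hk this
    · by_contra hne
      have := h (Finsupp.mem_support_iff.mpr hne)
      rw [Finset.mem_coe, Finset.inr_mem_disjSum] at this
      exact hk this
  · intro h x hx
    rw [Finset.mem_coe] at hx ⊢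
    have hx' := Finsupp.mem_support_iff.mp hx
    rcases x with k | k
    · rw [Finset.inl_mem_disjSum]
      by_contra hk
      exact hx' (h k hk).1
    · rw [Finset.inr_mem_disjSum]
      by_contra hk
      exact hx' (h k hk).2

/-- The blocks `S` span a subspace of real dimension `2·#S` (complex dimension `#S` once it is `I`-stable: "real
`2`-planes `P_j, Q_j` and `2n₀`-dimensional real subspace `U`"). [cite: BuskinIzadi2020TwistorLinesTori, v2 §5, proof of
Lemma 5.3 (p.25 L42–44)] -/
theorem finrank_span_blocks {K : Type*} [Fintype K] (β : Basis (K ⊕ K) ℝ F) (S : Finset K) :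
    finrank ℝ (Submodule.span ℝ (β '' ↑(S.disjSum S))) = 2 * S.card := by
  classical
  have hli : LinearIndepOn ℝ id (β '' ↑(S.disjSum S)) := (β.linearIndependent.linearIndepOn _).id_image
  have himg : (β '' ↑(S.disjSum S) : Set F) = ↑((S.disjSum S).image β) := Finset.coe_image.symm
  rw [himg] at hli ⊢
  rw [finrank_span_finset_eq_card hli, Finset.card_image_of_injective _ β.injective, Finset.card_disjSum, two_mul]

/-- The span of a set of blocks is `I`-stable ("`L_Ω`-invariant real `2`-planes"; `I` is a multiple of `L_Ω` on each
plane), i.e. a complex subspace of `(V_ℝ, I)`. [cite: BuskinIzadi2020TwistorLinesTori, v2 §5, proof of Lemma 5.3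
(p.25 L40–44)] -/
theorem map_mem_span_blocks {K : Type*} [Fintype K] (β : Basis (K ⊕ K) ℝ F) {ε : K → ℝ} {I : F →L[ℝ] F}
    (hIe : ∀ k, I (β (.inl k)) = ε k • β (.inr k)) (hIf : ∀ k, I (β (.inr k)) = -(ε k • β (.inl k)))
    (S : Finset K) {u : F} (hu : u ∈ Submodule.span ℝ (β '' ↑(S.disjSum S))) :
    I u ∈ Submodule.span ℝ (β '' ↑(S.disjSum S)) := by
  have hle : Submodule.span ℝ (β '' ↑(S.disjSum S)) ≤
      (Submodule.span ℝ (β '' ↑(S.disjSum S))).comap (I : F →ₗ[ℝ] F) := by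
    rw [Submodule.span_le]
    rintro _ ⟨x, hx, rfl⟩
    rw [Finset.mem_coe] at hx
    simp only [SetLike.mem_coe, Submodule.mem_comap, ContinuousLinearMap.coe_coe]
    rcases x with k | k
    · rw [Finset.inl_mem_disjSum] at hx
      rw [hIe]
      exact Submodule.smul_mem _ _ (Submodule.subset_span ⟨.inr k, by simpa using hx, rfl⟩)
    · rw [Finset.inr_mem_disjSum] at hx
      rw [hIf]
      exact Submodule.neg_mem _ (Submodule.smul_mem _ _ (Submodule.subset_span ⟨.inl k, by simpa using hx, rfl⟩))
  exact hle hu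

/-- **`h|_{P_i} > 0`**: on the span of blocks with `ε_k κ_k > 0` the form `h(u, u) = Ω(u, Iu)` is positive definite.
[cite: BuskinIzadi2020TwistorLinesTori, v2 §5, proof of Lemma 5.3 (p.25 L44–48)] -/
theorem apply₂_self_map_pos_of_mem_span_blocks {K : Type*} [Fintype K] [DecidableEq K] (β : Basis (K ⊕ K) ℝ F)
    (Ω : F [⋀^Fin 2]→L[ℝ] ℝ) {κ ε : K → ℝ}
    (hee : ∀ k l, Ω ![β (.inl k), β (.inl l)] = 0) (hff : ∀ k l, Ω ![β (.inr k), β (.inr l)] = 0)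
    (hef : ∀ k l, Ω ![β (.inl k), β (.inr l)] = if k = l then κ k else 0)
    {I : F →L[ℝ] F} (hIe : ∀ k, I (β (.inl k)) = ε k • β (.inr k))
    (hIf : ∀ k, I (β (.inr k)) = -(ε k • β (.inl k))) (S : Finset K) (hS : ∀ k ∈ S, 0 < ε k * κ k)
    {u : F} (hu : u ∈ Submodule.span ℝ (β '' ↑(S.disjSum S))) (hu0 : u ≠ 0) : 0 < Ω ![u, I u] := by
  rw [apply₂_self_map_eq_sum β Ω hee hff hef hIe hIf u]
  have hz := (mem_span_blocks_iff β S u).mp hu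
  -- some coordinate of `u` is non-zero, necessarily in a block `k ∈ S`
  obtain ⟨x, hx⟩ : ∃ x, β.repr u x ≠ 0 := by
    by_contra h
    push Not at h
    exact hu0 (β.repr.map_eq_zero_iff.mp (Finsupp.ext h))
  obtain ⟨k, hkS, hk⟩ : ∃ k ∈ S, β.repr u (.inl k) ≠ 0 ∨ β.repr u (.inr k) ≠ 0 := by
    rcases x with k | k
    · by_cases hkS : k ∈ S
      · exact ⟨k, hkS, Or.inl hx⟩
      · exact absurd (hz k hkS).1 hx
    · by_cases hkS : k ∈ S
      · exact ⟨k, hkS, Or.inr hx⟩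
      · exact absurd (hz k hkS).2 hx
  apply Finset.sum_pos'
  · intro l _
    by_cases hl : l ∈ S
    · exact mul_nonneg (hS l hl).le (by positivity)
    · rw [(hz l hl).1, (hz l hl).2]
      simp
  · refine ⟨k, Finset.mem_univ _, mul_pos (hS k hkS) ?_⟩
    rcases hk with hk | hk
    · have := sq_pos_iff.mpr hk
      positivity
    · have := sq_pos_iff.mpr hk
      positivity

/-- **`h ⩽ 0` off the positive blocks**: on the span of blocks with `ε_k κ_k ⩽ 0` (the planes `Q_j` and the null space
`U`) the form `h(u, u) = Ω(u, Iu)` is non-positive. [cite: BuskinIzadi2020TwistorLinesTori, v2 §5, proof of Lemma 5.3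
(p.25 L44–48: "`h|_{Q_j} < 0` and `h|_U = 0`")] -/
theorem apply₂_self_map_nonpos_of_mem_span_blocks {K : Type*} [Fintype K] [DecidableEq K]
    (β : Basis (K ⊕ K) ℝ F) (Ω : F [⋀^Fin 2]→L[ℝ] ℝ) {κ ε : K → ℝ}
    (hee : ∀ k l, Ω ![β (.inl k), β (.inl l)] = 0) (hff : ∀ k l, Ω ![β (.inr k), β (.inr l)] = 0)
    (hef : ∀ k l, Ω ![β (.inl k), β (.inr l)] = if k = l then κ k else 0)
    {I : F →L[ℝ] F} (hIe : ∀ k, I (β (.inl k)) = ε k • β (.inr k))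
    (hIf : ∀ k, I (β (.inr k)) = -(ε k • β (.inl k))) (S : Finset K) (hS : ∀ k ∈ S, ε k * κ k ≤ 0)
    {u : F} (hu : u ∈ Submodule.span ℝ (β '' ↑(S.disjSum S))) : Ω ![u, I u] ≤ 0 := by
  rw [apply₂_self_map_eq_sum β Ω hee hff hef hIe hIf u]
  have hz := (mem_span_blocks_iff β S u).mp hu
  refine Finset.sum_nonpos fun l _ => ?_
  by_cases hl : l ∈ S
  · exact mul_nonpos_of_nonpos_of_nonneg (hS l hl) (by positivity)
  · rw [(hz l hl).1, (hz l hl).2]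
    simp

/-- **Maximality (the signature count): a positive subspace has real dimension at most `2·#{k : ε_k κ_k > 0}`.**
If `h(u, u) = Ω(u, Iu) > 0` on `P ∖ 0` (any real subspace `P`, in particular any complex one), then
`dim_ℝ P ⩽ 2·#S` for every set of blocks `S` containing all blocks with `ε_k κ_k > 0`: `P` meets the span of the
remaining blocks, where `h ⩽ 0`, only in `0`. With `apply₂_self_map_pos_of_mem_span_blocks` this says that the
positive index `n₊` of `h` (the complex dimension of a maximal positive subspace, p.23 L25–30) is the number of
blocks with `ε_k κ_k > 0`. [cite: BuskinIzadi2020TwistorLinesTori, v2 §5 (p.23 L25–30: "`n₊`, `n₋` and `n₀` are the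
complex dimensions of, respectively, a maximal positive subspace `V₊`, a maximal negative subspace `V₋`, and the null
subspace"), proof of Lemma 5.3 (p.25 L44–48)] -/
theorem finrank_le_of_apply₂_self_map_pos {K : Type*} [Fintype K] [DecidableEq K] (β : Basis (K ⊕ K) ℝ F)
    (Ω : F [⋀^Fin 2]→L[ℝ] ℝ) {κ ε : K → ℝ}
    (hee : ∀ k l, Ω ![β (.inl k), β (.inl l)] = 0) (hff : ∀ k l, Ω ![β (.inr k), β (.inr l)] = 0)
    (hef : ∀ k l, Ω ![β (.inl k), β (.inr l)] = if k = l then κ k else 0)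
    {I : F →L[ℝ] F} (hIe : ∀ k, I (β (.inl k)) = ε k • β (.inr k))
    (hIf : ∀ k, I (β (.inr k)) = -(ε k • β (.inl k))) (S : Finset K) (hSc : ∀ k ∉ S, ε k * κ k ≤ 0)
    {P : Submodule ℝ F} (hP : ∀ u ∈ P, u ≠ 0 → 0 < Ω ![u, I u]) : finrank ℝ P ≤ 2 * S.card := by
  haveI : FiniteDimensional ℝ F := Module.Finite.of_basis β
  set N := Submodule.span ℝ (β '' ↑(Sᶜ.disjSum Sᶜ)) with hN_def
  have hN : finrank ℝ N = 2 * Sᶜ.card := finrank_span_blocks β Sᶜ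
  have hinf : P ⊓ N = ⊥ := by
    rw [Submodule.eq_bot_iff]
    rintro u ⟨huP, huN⟩
    by_contra hu0
    have h1 := hP u huP hu0
    have h2 := apply₂_self_map_nonpos_of_mem_span_blocks β Ω hee hff hef hIe hIf Sᶜ
      (fun k hk => hSc k (Finset.mem_compl.mp hk)) huN
    linarith
  have h := Submodule.finrank_sup_add_finrank_inf_eq P N
  rw [hinf, finrank_bot, add_zero] at h
  have hle := Submodule.finrank_le (P ⊔ N)
  have hF : finrank ℝ F = 2 * Fintype.card K := by
    rw [finrank_eq_card_basis β, Fintype.card_sum, two_mul]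
  have hc : Sᶜ.card = Fintype.card K - S.card := Finset.card_compl S
  have : S.card ≤ Fintype.card K := Finset.card_le_univ S
  omega

/-- **`h|_{Q_j} < 0`**: on the span of blocks with `ε_k κ_k < 0` the form `h(u, u) = Ω(u, Iu)` is negative definite
(the positive statement for the operator `−I`, whose sign vector is `−ε`). [cite: BuskinIzadi2020TwistorLinesTori,
v2 §5, proof of Lemma 5.3 (p.25 L44–48)] -/
theorem apply₂_self_map_neg_of_mem_span_blocks {K : Type*} [Fintype K] [DecidableEq K] (β : Basis (K ⊕ K) ℝ F)
    (Ω : F [⋀^Fin 2]→L[ℝ] ℝ) {κ ε : K → ℝ}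
    (hee : ∀ k l, Ω ![β (.inl k), β (.inl l)] = 0) (hff : ∀ k l, Ω ![β (.inr k), β (.inr l)] = 0)
    (hef : ∀ k l, Ω ![β (.inl k), β (.inr l)] = if k = l then κ k else 0)
    {I : F →L[ℝ] F} (hIe : ∀ k, I (β (.inl k)) = ε k • β (.inr k))
    (hIf : ∀ k, I (β (.inr k)) = -(ε k • β (.inl k))) (S : Finset K) (hS : ∀ k ∈ S, ε k * κ k < 0)
    {u : F} (hu : u ∈ Submodule.span ℝ (β '' ↑(S.disjSum S))) (hu0 : u ≠ 0) : Ω ![u, I u] < 0 := by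
  have hIe' : ∀ k, (-I) (β (.inl k)) = (-ε k) • β (.inr k) := fun k => by simp [hIe]
  have hIf' : ∀ k, (-I) (β (.inr k)) = -((-ε k) • β (.inl k)) := fun k => by simp [hIf]
  have h := apply₂_self_map_pos_of_mem_span_blocks β Ω hee hff hef hIe' hIf' S
    (fun k hk => by have := hS k hk; linarith) hu hu0
  rw [_root_.neg_apply, apply₂_neg_right] at h
  linarith

/-- **Maximality on the negative side**: a negative subspace has real dimension at most `2·#{k : ε_k κ_k < 0}` (the
positive statement for `−I`): the negative index `n₋` is the number of blocks with `ε_k κ_k < 0`.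
[cite: BuskinIzadi2020TwistorLinesTori, v2 §5 (p.23 L25–30), proof of Lemma 5.3 (p.25 L44–48)] -/
theorem finrank_le_of_apply₂_self_map_neg {K : Type*} [Fintype K] [DecidableEq K] (β : Basis (K ⊕ K) ℝ F)
    (Ω : F [⋀^Fin 2]→L[ℝ] ℝ) {κ ε : K → ℝ}
    (hee : ∀ k l, Ω ![β (.inl k), β (.inl l)] = 0) (hff : ∀ k l, Ω ![β (.inr k), β (.inr l)] = 0)
    (hef : ∀ k l, Ω ![β (.inl k), β (.inr l)] = if k = l then κ k else 0)
    {I : F →L[ℝ] F} (hIe : ∀ k, I (β (.inl k)) = ε k • β (.inr k))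
    (hIf : ∀ k, I (β (.inr k)) = -(ε k • β (.inl k))) (S : Finset K) (hSc : ∀ k ∉ S, 0 ≤ ε k * κ k)
    {Q : Submodule ℝ F} (hQ : ∀ u ∈ Q, u ≠ 0 → Ω ![u, I u] < 0) : finrank ℝ Q ≤ 2 * S.card := by
  have hIe' : ∀ k, (-I) (β (.inl k)) = (-ε k) • β (.inr k) := fun k => by simp [hIe]
  have hIf' : ∀ k, (-I) (β (.inr k)) = -((-ε k) • β (.inl k)) := fun k => by simp [hIf]
  refine finrank_le_of_apply₂_self_map_pos β Ω hee hff hef hIe' hIf' S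
    (fun k hk => by have := hSc k hk; linarith) fun u hu hu0 => ?_
  have h := hQ u hu hu0
  rw [_root_.neg_apply, apply₂_neg_right]
  linarith

/-- **The block decomposition is `Ω`- and `h`-orthogonal**: vectors supported on disjoint sets of blocks pair to zero
under `Ω`, and — the second set being `I`-stable — under `h(u, v) = Ω(u, Iv) − iΩ(u, v)` ("the decomposition … is
orthogonal with respect to `h`"). [cite: BuskinIzadi2020TwistorLinesTori, v2 §5, proof of Lemma 5.3 (p.25 L44–46)] -/
theorem apply₂_eq_zero_of_mem_span_blocks_disjoint {K : Type*} [Fintype K] [DecidableEq K]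
    (β : Basis (K ⊕ K) ℝ F) (Ω : F [⋀^Fin 2]→L[ℝ] ℝ) {κ : K → ℝ}
    (hee : ∀ k l, Ω ![β (.inl k), β (.inl l)] = 0) (hff : ∀ k l, Ω ![β (.inr k), β (.inr l)] = 0)
    (hef : ∀ k l, Ω ![β (.inl k), β (.inr l)] = if k = l then κ k else 0) {S T : Finset K}
    (hST : Disjoint S T) {u v : F} (hu : u ∈ Submodule.span ℝ (β '' ↑(S.disjSum S)))
    (hv : v ∈ Submodule.span ℝ (β '' ↑(T.disjSum T))) : Ω ![u, v] = 0 := by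
  rw [apply₂_eq_sum_blocks β Ω hee hff hef u v]
  have hzu := (mem_span_blocks_iff β S u).mp hu
  have hzv := (mem_span_blocks_iff β T v).mp hv
  refine Finset.sum_eq_zero fun k _ => ?_
  by_cases hk : k ∈ S
  · have hkT : k ∉ T := Finset.disjoint_left.mp hST hk
    rw [(hzv k hkT).1, (hzv k hkT).2]
    ring
  · rw [(hzu k hk).1, (hzu k hk).2]
    ring

/-! ### §4 The null space `V₀` and a `2×2`-block basis of `Ω` (Darboux on a complement of `V₀`)

p.23 L25–33: "the null subspace `V₀ = {u ∈ V_ℝ | h(u, v) = 0 for all v ∈ V_ℝ} = {u ∈ V_ℝ | Ω(u, v) = 0 for all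
v ∈ V_ℝ}` of `h` in `(V_ℝ, I)` […] `V₀`, and hence `n₀`, depend only on `Ω`, `V₀` being invariant with respect to every
complex structure operator in `Compl_Ω`."  The basis: p.25 L37–42, "a basis `v₁, …, v_{4n}` of `V_ℝ` such that the
skew-symmetric matrix `Ω(v_i, v_j)` has `2×2`-block diagonal structure … `n₊ + n₋ = 2n − n₀` nonzero `2×2`-blocks and
`n₀` zero `2×2`-blocks" — here produced by the tree's Darboux theorem
(`Literature.LinearAlgebra.Alternating.exists_symplecticBasis_card`, [Lang2002, XV §8 Thm. 8.1]) on a complement of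
`V₀`, on which `Ω` is non-degenerate, together with any basis of `V₀` grouped in pairs. -/

/-- The null space `V₀ = {u | Ω(u, v) = 0 for all v}` of a real `2`-form, as a submodule (existence form: the statements
below take any submodule `V₀` with this membership). [cite: BuskinIzadi2020TwistorLinesTori, v2 §5 (p.23 L25–28)] -/
theorem exists_nullSpace (Ω : F [⋀^Fin 2]→L[ℝ] ℝ) :
    ∃ V₀ : Submodule ℝ F, ∀ u, u ∈ V₀ ↔ ∀ v, Ω ![u, v] = 0 := by
  obtain ⟨B, hB⟩ := exists_bilinForm Ω
  refine ⟨LinearMap.ker B, fun u => ?_⟩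
  rw [LinearMap.mem_ker, LinearMap.ext_iff]
  simp only [hB, LinearMap.zero_apply]

/-- **`V₀` is invariant with respect to every complex structure operator in `Compl_Ω`** (so that `n₀ = dim_ℂ V₀` makes
sense and "depends only on `Ω`"). [cite: BuskinIzadi2020TwistorLinesTori, v2 §5 (p.23 L30–33)] -/
theorem map_mem_nullSpace {I : F →L[ℝ] F} (hI : ∀ v, I (I v) = -v) (Ω : F [⋀^Fin 2]→L[ℝ] ℝ)
    (hΩI : ∀ u v, Ω ![I u, I v] = Ω ![u, v]) {V₀ : Submodule ℝ F} (hV₀ : ∀ u, u ∈ V₀ ↔ ∀ v, Ω ![u, v] = 0)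
    {u : F} (hu : u ∈ V₀) : I u ∈ V₀ := by
  rw [hV₀] at hu ⊢
  intro v
  have h := hΩI u (I v)
  rw [hI, apply₂_neg_right, hu] at h
  linarith

/-- **`h|_{V₀} = 0`**: the null space is `h`-isotropic for every `I`, `Ω(u, Iu) = 0` for `u ∈ V₀` ("`h|_U = 0`").
[cite: BuskinIzadi2020TwistorLinesTori, v2 §5 (p.23 L25–28), proof of Lemma 5.3 (p.25 L46)] -/
theorem apply₂_self_map_eq_zero_of_mem_nullSpace (I : F →L[ℝ] F) (Ω : F [⋀^Fin 2]→L[ℝ] ℝ) {V₀ : Submodule ℝ F}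
    (hV₀ : ∀ u, u ∈ V₀ ↔ ∀ v, Ω ![u, v] = 0) {u : F} (hu : u ∈ V₀) : Ω ![u, I u] = 0 :=
  (hV₀ u).mp hu (I u)

/-- Darboux on a complement `W` of the null space: `V_ℝ = W ⊕ V₀`, `Ω|_W` non-degenerate alternating, so `W` has a
symplectic basis `(e_i, f_i)`, `Ω(e_i, f_j) = δ_ij`, `Ω(e_i, e_j) = Ω(f_i, f_j) = 0`, `dim W = 2·#ι`.
[cite: Lang2002, Ch. XV §8 Thm. 8.1] -/
private theorem exists_isCompl_darboux [FiniteDimensional ℝ F] (Ω : F [⋀^Fin 2]→L[ℝ] ℝ) {V₀ : Submodule ℝ F}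
    (hV₀ : ∀ u, u ∈ V₀ ↔ ∀ v, Ω ![u, v] = 0) :
    ∃ (W : Submodule ℝ F) (ι : Type) (_ : Fintype ι) (_ : DecidableEq ι) (b : Basis (ι ⊕ ι) ℝ W),
      IsCompl W V₀ ∧ 2 * Fintype.card ι = finrank ℝ W ∧
      (∀ i j, Ω ![(b (.inl i) : F), b (.inl j)] = 0) ∧ (∀ i j, Ω ![(b (.inr i) : F), b (.inr j)] = 0) ∧
      ∀ i j, Ω ![(b (.inl i) : F), b (.inr j)] = if i = j then 1 else 0 := by
  obtain ⟨B, hB⟩ := exists_bilinForm Ω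
  obtain ⟨W, hW⟩ := V₀.exists_isCompl
  have hBa : (B.restrict W).IsAlt := fun x => by
    change B x x = 0
    rw [hB]
    exact apply₂_self_eq_zero Ω x
  have hBl : (B.restrict W).SeparatingLeft := by
    intro x hx
    have hxV : (x : F) ∈ V₀ := by
      rw [hV₀]
      intro v
      obtain ⟨z, hz, y, hy, rfl⟩ :=
        Submodule.mem_sup.mp (show v ∈ V₀ ⊔ W by rw [hW.sup_eq_top]; exact Submodule.mem_top)
      have h1 : Ω ![(x : F), z] = 0 := by rw [apply₂_swap, (hV₀ z).mp hz, neg_zero]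
      have h2 : Ω ![(x : F), y] = 0 := by
        have := hx ⟨y, hy⟩
        rwa [← hB]
      rw [apply₂_add_right, h1, h2, add_zero]
    have hx0 : (x : F) ∈ V₀ ⊓ W := ⟨hxV, x.2⟩
    rw [hW.inf_eq_bot, Submodule.mem_bot] at hx0
    exact Subtype.ext hx0
  have hBr : (B.restrict W).SeparatingRight := by
    intro y hy
    refine hBl y fun z => ?_
    have h := hy z
    change B z y = 0 at h
    change B y z = 0
    rw [hB] at h ⊢
    rw [apply₂_swap, h, neg_zero]
  obtain ⟨ι, _, _, b, hcard, h11, h22, h12⟩ :=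
    Literature.LinearAlgebra.Alternating.exists_symplecticBasis_card hBa ⟨hBl, hBr⟩
  refine ⟨W, ι, ‹_›, ‹_›, b, hW.symm, hcard, fun i j => ?_, fun i j => ?_, fun i j => ?_⟩
  · rw [← hB]; exact h11 i j
  · rw [← hB]; exact h22 i j
  · rw [← hB]; exact h12 i j

/-- **`dim V₀ ≡ dim V_ℝ (mod 2)`**: the null space of a real `2`-form on an even-dimensional space is even-dimensional
(the rank of an alternating form is even), so that `n₀ := dim_ℂ V₀ = ½ dim_ℝ V₀` is an integer and
"`n₊ + n₋ + n₀ = 2n`" for `dim_ℝ V_ℝ = 4n`. [cite: BuskinIzadi2020TwistorLinesTori, v2 §5 (p.23 L28–30)] -/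
theorem even_finrank_nullSpace [FiniteDimensional ℝ F] (Ω : F [⋀^Fin 2]→L[ℝ] ℝ) {V₀ : Submodule ℝ F}
    (hV₀ : ∀ u, u ∈ V₀ ↔ ∀ v, Ω ![u, v] = 0) (hF : Even (finrank ℝ F)) : Even (finrank ℝ V₀) := by
  obtain ⟨W, ι, _, _, b, hW, hcard, -, -, -⟩ := exists_isCompl_darboux Ω hV₀
  have h := Submodule.finrank_add_eq_of_isCompl hW
  obtain ⟨m, hm⟩ := hF
  exact ⟨m - Fintype.card ι, by omega⟩

/-- **A `2×2`-block basis of `Ω`** ("a basis `v₁, …, v_{4n}` of `V_ℝ` such that the skew-symmetric matrix `Ω(v_i, v_j)`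
has `2×2`-block diagonal structure … `2n − n₀` nonzero `2×2`-blocks and `n₀` zero `2×2`-blocks"): for a real `2`-form
`Ω` whose null space `V₀` has real dimension `2n₀` there is a basis `β` indexed by `K ⊕ K`, `K = ι ⊕ Fin n₀`, with
`Ω(e_k, e_l) = Ω(f_k, f_l) = 0`, `Ω(e_k, f_l) = δ_kl κ_k`, `κ = 1` on the `ι`-blocks and `κ = 0` on the `Fin n₀`-blocks,
the latter spanning `V₀` (`e_k = β(inl k)`, `f_k = β(inr k)`), and `dim_ℝ V_ℝ = 2(#ι + n₀)`.
[cite: BuskinIzadi2020TwistorLinesTori, v2 §5, proof of Lemma 5.3 (p.25 L37–42)]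
[cite: Lang2002, Ch. XV §8 Thm. 8.1] -/
theorem exists_blockBasis [FiniteDimensional ℝ F] (Ω : F [⋀^Fin 2]→L[ℝ] ℝ) {V₀ : Submodule ℝ F}
    (hV₀ : ∀ u, u ∈ V₀ ↔ ∀ v, Ω ![u, v] = 0) {n₀ : ℕ} (hn₀ : finrank ℝ V₀ = 2 * n₀) :
    ∃ (ι : Type) (_ : Fintype ι) (_ : DecidableEq ι) (β : Basis ((ι ⊕ Fin n₀) ⊕ (ι ⊕ Fin n₀)) ℝ F),
      2 * (Fintype.card ι + n₀) = finrank ℝ F ∧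
      (∀ k l, Ω ![β (.inl k), β (.inl l)] = 0) ∧ (∀ k l, Ω ![β (.inr k), β (.inr l)] = 0) ∧
      (∀ k l, Ω ![β (.inl k), β (.inr l)] =
        if k = l then Sum.elim (fun _ => (1 : ℝ)) (fun _ => 0) k else 0) ∧
      (∀ s, β (.inl (.inr s)) ∈ V₀) ∧ (∀ s, β (.inr (.inr s)) ∈ V₀) := by
  obtain ⟨W, ι, _, _, b, hW, hcard, h11, h22, h12⟩ := exists_isCompl_darboux Ω hV₀
  have hn₀' : finrank ℝ V₀ = n₀ + n₀ := by rw [hn₀, two_mul]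
  let c : Basis (Fin n₀ ⊕ Fin n₀) ℝ V₀ := (Module.finBasisOfFinrankEq ℝ V₀ hn₀').reindex finSumFinEquiv.symm
  let e := Equiv.sumSumSumComm ι ι (Fin n₀) (Fin n₀)
  let β₀ : Basis ((ι ⊕ ι) ⊕ (Fin n₀ ⊕ Fin n₀)) ℝ F := (b.prod c).map (Submodule.prodEquivOfIsCompl W V₀ hW)
  let β : Basis ((ι ⊕ Fin n₀) ⊕ (ι ⊕ Fin n₀)) ℝ F := β₀.reindex e
  have hb1 : ∀ i, β (.inl (.inl i)) = (b (.inl i) : F) := fun i => by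
    simp [β, β₀, e, Equiv.sumSumSumComm_symm, Equiv.sumSumSumComm_apply]
  have hb2 : ∀ i, β (.inr (.inl i)) = (b (.inr i) : F) := fun i => by
    simp [β, β₀, e, Equiv.sumSumSumComm_symm, Equiv.sumSumSumComm_apply]
  have hc1 : ∀ s, β (.inl (.inr s)) = (c (.inl s) : F) := fun s => by
    simp [β, β₀, e, Equiv.sumSumSumComm_symm, Equiv.sumSumSumComm_apply]
  have hc2 : ∀ s, β (.inr (.inr s)) = (c (.inr s) : F) := fun s => by
    simp [β, β₀, e, Equiv.sumSumSumComm_symm, Equiv.sumSumSumComm_apply]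
  -- the null vectors pair to zero with everything, on either side
  have hc0 : ∀ (x : Fin n₀ ⊕ Fin n₀) (v : F), Ω ![(c x : F), v] = 0 := fun x => (hV₀ _).mp (c x).2
  have hc0' : ∀ (x : Fin n₀ ⊕ Fin n₀) (v : F), Ω ![v, (c x : F)] = 0 := fun x v => by
    rw [apply₂_swap, hc0, neg_zero]
  refine ⟨ι, ‹_›, ‹_›, β, ?_, ?_, ?_, ?_, fun s => ?_, fun s => ?_⟩
  · have h := Submodule.finrank_add_eq_of_isCompl hW
    omega
  · rintro (i | s) (j | t)
    · rw [hb1, hb1]; exact h11 i j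
    · rw [hb1, hc1]; exact hc0' _ _
    · rw [hc1]; exact hc0 _ _
    · rw [hc1]; exact hc0 _ _
  · rintro (i | s) (j | t)
    · rw [hb2, hb2]; exact h22 i j
    · rw [hb2, hc2]; exact hc0' _ _
    · rw [hc2]; exact hc0 _ _
    · rw [hc2]; exact hc0 _ _
  · rintro (i | s) (j | t)
    · rw [hb1, hb2, h12]
      by_cases hij : i = j
      · subst hij; simp
      · rw [if_neg hij, if_neg (fun h => hij (Sum.inl_injective h))]
    · rw [hb1, hc2, hc0', if_neg Sum.inl_ne_inr]
    · rw [hc1, hc0 _ _]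
      simp
    · rw [hc1, hc0 _ _]
      simp
  · rw [hc1]; exact (c _).2
  · rw [hc2]; exact (c _).2

/-! ### §5 Lemma 5.3: every signature occurs -/

/-- **Lemma 5.3 (Buskin–Izadi), the linear algebra: every signature `(n₊, n₋, n₀)` occurs.** Let `Ω` be a real `2`-form
on `V_ℝ` with null space `V₀ = {u | Ω(u, ·) = 0}` of real dimension `2n₀`, and let `n₊, n₋` be any numbers with
`dim_ℝ V_ℝ = 2(n₊ + n₋ + n₀)`. Then there is a complex structure operator `I` (`I² = −Id`) with `I ∈ Compl_Ω`
(`Ω(Iu, Iv) = Ω(u, v)`) whose hermitian form `h(u, v) = Ω(u, Iv) − iΩ(u, v)` has signature `(n₊, n₋, n₀)`: there are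
`I`-stable (= complex) subspaces `P`, `Q` of complex dimensions `n₊`, `n₋` (real dimensions `2n₊`, `2n₋`) with
`h|_P > 0`, `h|_Q < 0`, and NO real subspace on which `h(u, u) = Ω(u, Iu)` is positive (resp. negative) definite has
real dimension `> 2n₊` (resp. `> 2n₋`) — so `n₊`, `n₋` ARE "the complex dimensions of, respectively, a maximal positive
subspace `V₊`, a maximal negative subspace `V₋`" (p.23 L25–30), and `n₀ = dim_ℂ V₀`. Printed: "Let `(n₊, n₋, n₀)` be a
triple `∈ S_Ω`, `n₊ + n₋ + n₀ = 2n`. Let us prove that there exists `I ∈ Compl^±_Ω` such that the hermitian form `h`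
associated to `Ω` and `I` has signature `(n₊, n₋, n₀)`. […] Thus we have constructed the required `I`, this proves the
surjectivity of `S̃ign`."  The superscript `±` (the two components `Compl⁺`, `Compl⁻` of the period domain, by
orientation) plays no role in the printed construction and is not tracked here; `Compl_Ω`, `Sign`, `S̃ign`, `π₀` are not
introduced as objects. [cite: BuskinIzadi2020TwistorLinesTori, v2 §5 Lemma 5.3 (p.24 L44–45), proof (p.25 L35–48)] -/
theorem exists_invariant_complexStructure_signature [FiniteDimensional ℝ F] (Ω : F [⋀^Fin 2]→L[ℝ] ℝ)
    {V₀ : Submodule ℝ F} (hV₀ : ∀ u, u ∈ V₀ ↔ ∀ v, Ω ![u, v] = 0) {n₀ npos nneg : ℕ}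
    (hn₀ : finrank ℝ V₀ = 2 * n₀) (hdim : finrank ℝ F = 2 * (npos + nneg + n₀)) :
    ∃ I : F →L[ℝ] F, (∀ v, I (I v) = -v) ∧ (∀ u v, Ω ![I u, I v] = Ω ![u, v]) ∧
      (∃ P : Submodule ℝ F, (∀ u ∈ P, I u ∈ P) ∧ finrank ℝ P = 2 * npos ∧
        ∀ u ∈ P, u ≠ 0 → 0 < Ω ![u, I u]) ∧
      (∀ P : Submodule ℝ F, (∀ u ∈ P, u ≠ 0 → 0 < Ω ![u, I u]) → finrank ℝ P ≤ 2 * npos) ∧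
      (∃ Q : Submodule ℝ F, (∀ u ∈ Q, I u ∈ Q) ∧ finrank ℝ Q = 2 * nneg ∧
        ∀ u ∈ Q, u ≠ 0 → Ω ![u, I u] < 0) ∧
      (∀ Q : Submodule ℝ F, (∀ u ∈ Q, u ≠ 0 → Ω ![u, I u] < 0) → finrank ℝ Q ≤ 2 * nneg) := by
  classical
  obtain ⟨ι, _, _, β₀, hdim₀, hee₀, hff₀, hef₀, -, -⟩ := exists_blockBasis Ω hV₀ hn₀
  have hι : Fintype.card ι = npos + nneg := by omega
  -- relabel the `2n − n₀` non-degenerate blocks as `n₊` blocks `P_i` and `n₋` blocks `Q_j`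
  let σ : ι ≃ Fin npos ⊕ Fin nneg := (Fintype.equivFinOfCardEq hι).trans finSumFinEquiv.symm
  let τ : ι ⊕ Fin n₀ ≃ (Fin npos ⊕ Fin nneg) ⊕ Fin n₀ := σ.sumCongr (Equiv.refl _)
  let β : Basis (((Fin npos ⊕ Fin nneg) ⊕ Fin n₀) ⊕ ((Fin npos ⊕ Fin nneg) ⊕ Fin n₀)) ℝ F :=
    β₀.reindex (τ.sumCongr τ)
  have hβl : ∀ k, β (.inl k) = β₀ (.inl (τ.symm k)) := fun k => by simp [β]
  have hβr : ∀ k, β (.inr k) = β₀ (.inr (τ.symm k)) := fun k => by simp [β]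
  -- the block data `κ` (`1` on the planes, `0` on the null blocks) and the signs `ε` (`+1` on `P_i` and `U`, `−1` on `Q_j`)
  set κ : (Fin npos ⊕ Fin nneg) ⊕ Fin n₀ → ℝ := Sum.elim (fun _ => 1) (fun _ => 0) with hκ_def
  set ε : (Fin npos ⊕ Fin nneg) ⊕ Fin n₀ → ℝ := Sum.elim (Sum.elim (fun _ => 1) (fun _ => -1)) (fun _ => 1)
    with hε_def
  have hκτ : ∀ k, Sum.elim (fun _ => (1 : ℝ)) (fun _ => 0) (τ.symm k) = κ k := by
    rintro (a | s) <;> simp [τ, κ]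
  have hee : ∀ k l, Ω ![β (.inl k), β (.inl l)] = 0 := fun k l => by rw [hβl, hβl]; exact hee₀ _ _
  have hff : ∀ k l, Ω ![β (.inr k), β (.inr l)] = 0 := fun k l => by rw [hβr, hβr]; exact hff₀ _ _
  have hef : ∀ k l, Ω ![β (.inl k), β (.inr l)] = if k = l then κ k else 0 := fun k l => by
    rw [hβl, hβr, hef₀, hκτ]
    by_cases hkl : k = l
    · subst hkl; simp
    · rw [if_neg hkl, if_neg (fun h => hkl (τ.symm.injective h))]
  have hε : ∀ k, ε k ^ 2 = 1 := by rintro ((a | b) | s) <;> simp [ε]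
  obtain ⟨I, hI, hIe, hIf⟩ := exists_complexStructure_of_blockBasis β ε hε
  have hΩI := apply₂_map_map_of_blockBasis β Ω hε hee hff hef hIe hIf
  -- the positive blocks `P_1, …, P_{n₊}` and the negative blocks `Q_1, …, Q_{n₋}`
  let Sp : Finset ((Fin npos ⊕ Fin nneg) ⊕ Fin n₀) :=
    Finset.univ.map ⟨fun a => Sum.inl (Sum.inl a), fun a b h => by simpa using h⟩
  let Sn : Finset ((Fin npos ⊕ Fin nneg) ⊕ Fin n₀) :=
    Finset.univ.map ⟨fun b => Sum.inl (Sum.inr b), fun a b h => by simpa using h⟩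
  have hSp_mem : ∀ k, k ∈ Sp ↔ ∃ a, Sum.inl (Sum.inl a) = k := fun k => by simp [Sp]
  have hSn_mem : ∀ k, k ∈ Sn ↔ ∃ b, Sum.inl (Sum.inr b) = k := fun k => by simp [Sn]
  have hSp_card : Sp.card = npos := by simp [Sp]
  have hSn_card : Sn.card = nneg := by simp [Sn]
  have hSp : ∀ k ∈ Sp, 0 < ε k * κ k := fun k hk => by
    obtain ⟨a, rfl⟩ := (hSp_mem k).mp hk
    simp [ε, κ]
  have hSpc : ∀ k ∉ Sp, ε k * κ k ≤ 0 := by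
    rintro ((a | b) | s) hk
    · exact absurd ((hSp_mem _).mpr ⟨a, rfl⟩) hk
    · simp [ε, κ]
    · simp [ε, κ]
  have hSn : ∀ k ∈ Sn, ε k * κ k < 0 := fun k hk => by
    obtain ⟨b, rfl⟩ := (hSn_mem k).mp hk
    simp [ε, κ]
  have hSnc : ∀ k ∉ Sn, 0 ≤ ε k * κ k := by
    rintro ((a | b) | s) hk
    · simp [ε, κ]
    · exact absurd ((hSn_mem _).mpr ⟨b, rfl⟩) hk
    · simp [ε, κ]
  refine ⟨I, hI, hΩI, ⟨Submodule.span ℝ (β '' ↑(Sp.disjSum Sp)), fun u hu => map_mem_span_blocks β hIe hIf Sp hu,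
      by rw [finrank_span_blocks, hSp_card],
      fun u hu hu0 => apply₂_self_map_pos_of_mem_span_blocks β Ω hee hff hef hIe hIf Sp hSp hu hu0⟩,
    fun P hP => ?_, ⟨Submodule.span ℝ (β '' ↑(Sn.disjSum Sn)), fun u hu => map_mem_span_blocks β hIe hIf Sn hu,
      by rw [finrank_span_blocks, hSn_card],
      fun u hu hu0 => apply₂_self_map_neg_of_mem_span_blocks β Ω hee hff hef hIe hIf Sn hSn hu hu0⟩,
    fun Q hQ => ?_⟩
  · have h := finrank_le_of_apply₂_self_map_pos β Ω hee hff hef hIe hIf Sp hSpc hP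
    rwa [hSp_card] at h
  · have h := finrank_le_of_apply₂_self_map_neg β Ω hee hff hef hIe hIf Sn hSnc hQ
    rwa [hSn_card] at h

/-- **Lemma 5.3 as printed, in [BI20]'s numerology**: `dim_ℝ V_ℝ = 4n`, `n₀ = dim_ℂ V₀` (real dimension `2n₀`), and a
triple `(n₊, n₋, n₀) ∈ S_Ω = {(k, l, n₀) | k, l ∈ ℤ_{⩾0}, k + l + n₀ = 2n}` ("consisting of `2n − n₀ + 1` triples"):
"there exists `I ∈ Compl^±_Ω` such that the hermitian form `h` associated to `Ω` and `I` has signature `(n₊, n₋, n₀)`",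
in the reading of `exists_invariant_complexStructure_signature`. (That `dim_ℝ V₀` is even here is
`even_finrank_nullSpace`.) [cite: BuskinIzadi2020TwistorLinesTori, v2 §5 Lemma 5.3 (p.24 L44–45), proof (p.25 L35–48),
with `S_Ω` and `Sign` from p.24 L14–24] -/
theorem exists_invariant_complexStructure_signature_of_mem_SOmega [FiniteDimensional ℝ F]
    (Ω : F [⋀^Fin 2]→L[ℝ] ℝ) {V₀ : Submodule ℝ F} (hV₀ : ∀ u, u ∈ V₀ ↔ ∀ v, Ω ![u, v] = 0)
    {n n₀ npos nneg : ℕ} (hF : finrank ℝ F = 4 * n) (hn₀ : finrank ℝ V₀ = 2 * n₀)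
    (hS : npos + nneg + n₀ = 2 * n) :
    ∃ I : F →L[ℝ] F, (∀ v, I (I v) = -v) ∧ (∀ u v, Ω ![I u, I v] = Ω ![u, v]) ∧
      (∃ P : Submodule ℝ F, (∀ u ∈ P, I u ∈ P) ∧ finrank ℝ P = 2 * npos ∧
        ∀ u ∈ P, u ≠ 0 → 0 < Ω ![u, I u]) ∧
      (∀ P : Submodule ℝ F, (∀ u ∈ P, u ≠ 0 → 0 < Ω ![u, I u]) → finrank ℝ P ≤ 2 * npos) ∧
      (∃ Q : Submodule ℝ F, (∀ u ∈ Q, I u ∈ Q) ∧ finrank ℝ Q = 2 * nneg ∧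
        ∀ u ∈ Q, u ≠ 0 → Ω ![u, I u] < 0) ∧
      (∀ Q : Submodule ℝ F, (∀ u ∈ Q, u ≠ 0 → Ω ![u, I u] < 0) → finrank ℝ Q ≤ 2 * nneg) :=
  exists_invariant_complexStructure_signature Ω hV₀ hn₀ (by omega)

/-! ### §6 The same in the vocabulary of Sylvester's law (`sigPos`, `sigNeg`: Mathlib's maximal dimension of a
positive ∕ negative definite subspace of a quadratic form over an ordered field)

"The signature of `h` is a triple `(n₊, n₋, n₀)`, where `n₊, n₋ and n₀` are the complex dimensions of, respectively, a
maximal positive subspace `V₊`, a maximal negative subspace `V₋`, and the null subspace `V₀`" (p.23 L26–30): for the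
REAL quadratic form `q_I(u) = h(u, u) = Ω(u, Iu)` on `V_ℝ` these are `sigPos q_I = 2n₊`, `sigNeg q_I = 2n₋`,
`dim_ℝ rad(q_I) = 2n₀` (real dimensions; Mathlib's `sigPos_add_sigNeg_add_radical` is the printed
"`n₊ + n₋ + n₀ = 2n`"). -/

/-- The real quadratic form `q_I(u) = h(u, u) = Ω(u, Iu)` of `Ω` and an operator `I` (existence form).
[cite: BuskinIzadi2020TwistorLinesTori, v2 §5 (p.23 L20–25)] -/
theorem exists_quadraticForm (I : F →L[ℝ] F) (Ω : F [⋀^Fin 2]→L[ℝ] ℝ) :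
    ∃ q : QuadraticForm ℝ F, ∀ u, q u = Ω ![u, I u] := by
  obtain ⟨B, hB⟩ := exists_bilinForm Ω
  exact ⟨LinearMap.BilinMap.toQuadraticMap (B.compl₂ (I : F →ₗ[ℝ] F)), fun u => by
    rw [LinearMap.BilinMap.toQuadraticMap_apply, LinearMap.compl₂_apply, ContinuousLinearMap.coe_coe, hB]⟩

/-- **`sigPos q_I` is the number the printed signature calls `n₊` (doubled, as a real dimension)**: if some subspace of
real dimension `m` is `h`-positive and no `h`-positive subspace has larger dimension, then `sigPos q_I = m`.
[cite: BuskinIzadi2020TwistorLinesTori, v2 §5 (p.23 L26–30)] -/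
theorem sigPos_eq_of_maximal [FiniteDimensional ℝ F] {I : F →L[ℝ] F} {Ω : F [⋀^Fin 2]→L[ℝ] ℝ}
    {q : QuadraticForm ℝ F} (hq : ∀ u, q u = Ω ![u, I u]) {m : ℕ}
    (hex : ∃ P : Submodule ℝ F, finrank ℝ P = m ∧ ∀ u ∈ P, u ≠ 0 → 0 < Ω ![u, I u])
    (hmax : ∀ P : Submodule ℝ F, (∀ u ∈ P, u ≠ 0 → 0 < Ω ![u, I u]) → finrank ℝ P ≤ m) :
    sigPos q = m := by
  apply le_antisymm
  · obtain ⟨V, hV, hpos⟩ := exists_finrank_eq_sigPos_and_posDef q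
    rw [← hV]
    refine hmax V fun u hu hu0 => ?_
    have h := hpos ⟨u, hu⟩ (fun h => hu0 (congrArg Subtype.val h))
    rwa [QuadraticMap.restrict_apply, hq] at h
  · obtain ⟨P, hP, hpos⟩ := hex
    rw [← hP]
    refine le_sigPos_of_posDef q fun x hx => ?_
    rw [QuadraticMap.restrict_apply, hq]
    exact hpos x x.2 fun h => hx (Subtype.ext h)

/-- The negative counterpart: `sigNeg q_I = m` from an `h`-negative subspace of dimension `m` and the bound.
[cite: BuskinIzadi2020TwistorLinesTori, v2 §5 (p.23 L26–30)] -/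
theorem sigNeg_eq_of_maximal [FiniteDimensional ℝ F] {I : F →L[ℝ] F} {Ω : F [⋀^Fin 2]→L[ℝ] ℝ}
    {q : QuadraticForm ℝ F} (hq : ∀ u, q u = Ω ![u, I u]) {m : ℕ}
    (hex : ∃ Q : Submodule ℝ F, finrank ℝ Q = m ∧ ∀ u ∈ Q, u ≠ 0 → Ω ![u, I u] < 0)
    (hmax : ∀ Q : Submodule ℝ F, (∀ u ∈ Q, u ≠ 0 → Ω ![u, I u] < 0) → finrank ℝ Q ≤ m) :
    sigNeg q = m := by
  apply le_antisymm
  · obtain ⟨V, hV, hpos⟩ := exists_finrank_eq_sigNeg_and_negDef q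
    rw [← hV]
    refine hmax V fun u hu hu0 => ?_
    have h := hpos ⟨u, hu⟩ (fun h => hu0 (congrArg Subtype.val h))
    rw [QuadraticMap.restrict_apply, QuadraticMap.neg_apply, hq] at h
    linarith
  · obtain ⟨P, hP, hpos⟩ := hex
    rw [← hP]
    refine le_sigNeg_of_negDef q fun x hx => ?_
    rw [QuadraticMap.restrict_apply, QuadraticMap.neg_apply, hq]
    have := hpos x x.2 fun h => hx (Subtype.ext h)
    linarith

/-- **Lemma 5.3 in Sylvester's vocabulary.** For `dim_ℝ V₀ = 2n₀` and `dim_ℝ V_ℝ = 2(n₊ + n₋ + n₀)` there is `I ∈ Compl_Ω`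
(`I² = −1`, `Ω(Iu, Iv) = Ω(u, v)`) such that the real quadratic form `q_I(u) = h(u, u) = Ω(u, Iu)` has
`sigPos q_I = 2n₊`, `sigNeg q_I = 2n₋` and radical of real dimension `2n₀` — "the hermitian form `h` associated to `Ω` and
`I` has signature `(n₊, n₋, n₀)`". [cite: BuskinIzadi2020TwistorLinesTori, v2 §5 Lemma 5.3 (p.24 L50–52), proof
(p.25 L35–53), with p.23 L26–30] -/
theorem exists_invariant_complexStructure_sigPos_eq [FiniteDimensional ℝ F] (Ω : F [⋀^Fin 2]→L[ℝ] ℝ)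
    {V₀ : Submodule ℝ F} (hV₀ : ∀ u, u ∈ V₀ ↔ ∀ v, Ω ![u, v] = 0) {n₀ npos nneg : ℕ}
    (hn₀ : finrank ℝ V₀ = 2 * n₀) (hdim : finrank ℝ F = 2 * (npos + nneg + n₀)) :
    ∃ I : F →L[ℝ] F, (∀ v, I (I v) = -v) ∧ (∀ u v, Ω ![I u, I v] = Ω ![u, v]) ∧
      ∀ q : QuadraticForm ℝ F, (∀ u, q u = Ω ![u, I u]) →
        sigPos q = 2 * npos ∧ sigNeg q = 2 * nneg ∧ finrank ℝ q.radical = 2 * n₀ := by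
  obtain ⟨I, hI, hΩI, hP, hPmax, hQ, hQmax⟩ := exists_invariant_complexStructure_signature Ω hV₀ hn₀ hdim
  refine ⟨I, hI, hΩI, fun q hq => ?_⟩
  have h1 : sigPos q = 2 * npos :=
    sigPos_eq_of_maximal hq (by obtain ⟨P, h1, h2, h3⟩ := hP; exact ⟨P, h2, h3⟩) hPmax
  have h2 : sigNeg q = 2 * nneg :=
    sigNeg_eq_of_maximal hq (by obtain ⟨Q, h1, h2, h3⟩ := hQ; exact ⟨Q, h2, h3⟩) hQmax
  have h3 := QuadraticForm.sigPos_add_sigNeg_add_radical (Q := q)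
  refine ⟨h1, h2, ?_⟩
  omega

end Literature.Geometry.Hyperkaehler.HodgeLocus

/-!
## Part C — standalone draft `HodgeLocusSignatureLocallyConstant.v1` (sha256∕16 dea5ac914d2f2985), reproduced verbatim below
(its module docstring first: references to "this file" ∕ "this leaf" mean this Part; items it lists as
"NOT here" may be supplied by other Parts — see the file header; then its code, byte-identical).

# The signature of the hermitian form of `Ω` is locally constant on the Hodge locus `Compl_Ω`
# (Buskin–Izadi, §5 Proposition 5.1: `Sign : Compl_Ω → S_Ω` is constant on every connected component)

Topic `Literature/Geometry/Hyperkaehler`, namespace `Literature.Geometry.Hyperkaehler.HodgeLocus`. Written by the literature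
seat `lit-w-verbitsky` (gen 16) of the cell `pub-hsemireg` (HodgeConjecture venture), 2026-08-25, as a kernel leg of row
V-V20 of that cell's Verbitsky table ([BI20] Thm. 2 = Thm. 5.4 "connectivity INSIDE the locus `Compl_Ω` of one fixed
`(1,1)`-class", with Prop. 5.1 ∕ Lemma 5.2 ∕ Lemma 5.3 behind it). THEOREMS ONLY (no definition, no named fact, no
`sorry`). Nothing in this file is a statement about the Hodge conjecture, and nothing here says that any object of the
cell is hyperholomorphic, rotable or carries a twistor line.

This file is Proposition 5.1 — the one TOPOLOGICAL ingredient of §5 that is finite-dimensional analysis: the signature of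
the hermitian form `h_I` of `Ω` and `I` does not change along a connected family of `I ∈ Compl_Ω`. The signature is read
through Mathlib's `sigPos` ∕ `sigNeg` (the maximal dimension of a positive ∕ negative definite subspace of a quadratic
form over an ordered field; Sylvester's law `sigPos_add_sigNeg_add_radical`) of the REAL quadratic form
`q_I(u) = h_I(u, u) = Ω(u, Iu)` on `V_ℝ` — twice the printed complex dimensions `n₊`, `n₋`. Companion leaves of the same
seat: `HodgeLocusSignatureSurjective.lean` (Lemma 5.3, every signature occurs; keyed, not imported here) and
`HodgeLocusTwistorLineSignature.lean` (eq. (9), Lemma 5.2's conjugating element); the signature CRITERION of Thm. 5.4 is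
the tree's `TwistorLineHermitianFormSignature.lean`.

## Source, verbatim (N. Buskin, E. Izadi, *Twistor lines in the period domain of complex tori*, arXiv:1806.07831v2 (28 Jun
## 2020) = Geom. Dedicata 213 (2021) 21–47, journal pages unseen by the cell; "v2 p.N Lm" = PDF page N, text-layer line m of
## the cell's dump `texts-verbitsky/bi20v2/dump/` (PDF sha256∕16 9e1097db4f2fd005), checked on the arXiv v2 LaTeX source
## `texts-verbitsky/bi20v2/src/Twistor-path-conn-06-20-20.tex` (sha256∕16 201e79451d245bd7, ll. 1603–1612))

* v2 p.23 L20–33: "Let `I` be a complex structure operator in `Compl_Ω`, that is, `Ω(Iu, Iv) = Ω(u, v)` for all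
  `u, v ∈ V_ℝ`. […] the form `Ω` determines a hermitian form `h(u, v) := Ω(u, Iv) − iΩ(u, v)` […]. The signature of `h` is
  a triple `(n₊, n₋, n₀)`, where `n₊`, `n₋` and `n₀` are the complex dimensions of, respectively, a maximal positive
  subspace `V₊`, a maximal negative subspace `V₋`, and the null subspace
  `V₀ = {u ∈ V_ℝ | h(u, v) = 0 for all v ∈ V_ℝ} = {u ∈ V_ℝ | Ω(u, v) = 0 for all v ∈ V_ℝ}` of `h` in `(V_ℝ, I)`, so that
  `n₊ + n₋ + n₀ = 2n`. The subspaces `V₊`, `V₋` and the numbers `n₊` and `n₋` depend, in general, on the choice of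
  `I ∈ Compl_Ω`, while `V₀`, and hence `n₀`, depend only on `Ω` […]."
* v2 p.24 L6–16: "We set `Compl±_Ω := Compl_Ω ∩ Compl±`. Consider the finite set
  `S_Ω := {(k, l, n₀) | k, l ∈ ℤ_{⩾0}, k + l + n₀ = 2n}` […] and the mapping `Sign : Compl±_Ω → S_Ω`, `I ↦` the signature
  `(n₊, n₋, n₀)` of `h` assoc. to `Ω` and `I`."
* v2 p.24 L17–19, **Proposition 5.1.** "The mapping `Sign : Compl±_Ω → S_Ω` is constant on every connected component of
  `Compl_Ω`."
* v2 p.24 L20–24, **Proof.** "Since `n₀` is the dimension of the kernel of `Ω`, and `Ω` is fixed, `n₀` is constant. Now the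
  fact that `n₊` and `n₋` are locally constant follows from the fact that they are both lower semi-continuous (since being
  positive or negative are open conditions) and their sum is constant. □"
* v2 p.24 L25–30: "Proposition 5.1 allows us to define the induced mapping `S̃ign : π₀Compl±_Ω → S_Ω` on the set
  `π₀Compl±_Ω` of connected components of `Compl±_Ω`."

## What is formalised (`F` = `V_ℝ`, a real normed space, finite-dimensional from §2's Sylvester count on;
## `Ω : F [⋀^Fin 2]→L[ℝ] ℝ`; "`I ∈ Compl_Ω`" = `I² = −1 ∧ ∀ u v, Ω ![I u, I v] = Ω ![u, v]`, topologised as a subspace of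
## `End(V_ℝ) = F →L[ℝ] F` (operator norm); `q_I` = any quadratic form with `q_I u = Ω ![u, I u]`)

* §1 `exists_quadraticForm_family` — the forms `q_I`, all `I` at once (existence; no definition).
* §2 "`n₀` is constant … their sum is constant": **`mem_radical_iff`** ∕ `radical_eq_nullSpace` — for `I ∈ Compl_Ω`,
  `rad q_I = V₀ = {u | Ω(u, ·) = 0}` (polar form `2Ω(u, Iv)`, via the tree's `TwistorLine.apply₂_map_right_comm`); hence
  **`sigPos_add_sigNeg_add_finrank_nullSpace`**: `sigPos q_I + sigNeg q_I + dim_ℝ V₀ = dim_ℝ V_ℝ` for every `I ∈ Compl_Ω`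
  ("`n₊ + n₋ + n₀ = 2n`").
* §3 "lower semi-continuous (since being positive or negative are open conditions)": **`exists_forall_sigPos_le`** — for
  any operator `I₀` there is `δ > 0` with `sigPos q_{I₀} ⩽ sigPos q_I` whenever `‖I − I₀‖ < δ` (a `q_{I₀}`-positive
  definite subspace of dimension `sigPos q_{I₀}` stays `q_I`-positive: minimum of `Ω(u, I₀u)` on its unit sphere, compact
  in finite dimension, against `|Ω(u, (I − I₀)u)| ⩽ ‖Ω‖‖I − I₀‖`); `exists_forall_sigNeg_le` — the same for `sigNeg`
  (`q_{−I} = −q_I`). These need no `Compl_Ω` hypothesis.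
* §4 **`exists_forall_sigPos_eq_and_sigNeg_eq`** — PROP. 5.1 in `δ`-form: for `I₀ ∈ Compl_Ω` there is `δ > 0` such that
  every `I ∈ Compl_Ω` with `‖I − I₀‖ < δ` has `sigPos q_I = sigPos q_{I₀}` and `sigNeg q_I = sigNeg q_{I₀}`;
  **`isLocallyConstant_sign`** — `I ↦ (sigPos q_I, sigNeg q_I)` is `IsLocallyConstant` on the subtype `Compl_Ω`;
  **`sign_eq_of_mem_connectedComponent`** — AS PRINTED: two operators in the same connected component of `Compl_Ω` have the
  same signature.

## What is NOT here

`Compl`, `Compl±`, `S_Ω`, `Sign`, `S̃ign`, `π₀` as objects (the statements use the subtype `{I | I² = −1, Ω(I·, I·) = Ω}`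
of `F →L[ℝ] F` and Mathlib's `connectedComponent` ∕ `IsLocallyConstant`); the orientation superscript `±`; the manifold
structure of `Compl` (the topology used is the operator-norm topology of `End(V_ℝ)`, which induces the manifold topology on
the submanifold `Compl`); Lemma 5.2, Lemma 5.3, Thm. 5.4, Cor. 5.5. The signature of the hermitian form `h` on `(V_ℝ, I)` is
not introduced as a function: it is read as `(sigPos q_I, sigNeg q_I)` of the real form `u ↦ h(u, u)` (real dimensions
`2n₊`, `2n₋`), `n₀ = dim V₀` being fixed.

## References

* [BuskinIzadi2020TwistorLinesTori] N. Buskin, E. Izadi, *Twistor lines in the period domain of complex tori*, Geom. Dedicata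
  213 (2021) 21–47 = arXiv:1806.07831v2, §5: p.23 L20–33 (`h`, signature, `V₀`), p.24 L6–16 (`S_Ω`, `Sign`), Prop. 5.1
  (p.24 L17–19) and its proof (p.24 L20–24), p.24 L25–30 (`S̃ign`). arXiv v1 LACKS §5's material — cite v2 only.
-/

section PartC

open Metric
open scoped Topology

namespace Literature.Geometry.Hyperkaehler.HodgeLocus

open Literature.Geometry.Hyperkaehler.TwistorLine (apply₂_map_left apply₂_map_right_comm)

variable {F : Type*} [NormedAddCommGroup F] [NormedSpace ℝ F]

/-! ### §1 The quadratic forms `q_I(u) = h_I(u, u) = Ω(u, Iu)`, all operators `I` at once -/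

/-- The real quadratic forms `q_I(u) = h_I(u, u) = Ω(u, Iu)` of `Ω` and the operators `I` of `V_ℝ`, as ONE family
(existence form, so that no definition is introduced; `Sign(I)` below is read on `q_I` through Mathlib's `sigPos` ∕
`sigNeg`, the maximal dimensions of positive ∕ negative definite subspaces — p.23 L26–30 doubled to real dimensions).
[cite: BuskinIzadi2020TwistorLinesTori, v2 §5 (p.23 L20–30)] -/
theorem exists_quadraticForm_family (Ω : F [⋀^Fin 2]→L[ℝ] ℝ) :
    ∃ q : (F →L[ℝ] F) → QuadraticForm ℝ F, ∀ I u, q I u = Ω ![u, I u] := by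
  let B : LinearMap.BilinForm ℝ F := LinearMap.mk₂ ℝ (fun u v => Ω ![u, v]) (apply₂_add_left Ω)
    (apply₂_smul_left Ω) (apply₂_add_right Ω) (apply₂_smul_right Ω)
  exact ⟨fun I => LinearMap.BilinMap.toQuadraticMap (B.compl₂ (I : F →ₗ[ℝ] F)), fun I u => by
    rw [LinearMap.BilinMap.toQuadraticMap_apply, LinearMap.compl₂_apply]; rfl⟩

/-! ### §2 "`n₀` is constant": for `I ∈ Compl_Ω` the radical of `q_I` is the null space `V₀` of `Ω`, so
`sigPos q_I + sigNeg q_I = dim_ℝ V_ℝ − dim_ℝ V₀` does not depend on `I`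

p.24 L20: "Since `n₀` is the dimension of the kernel of `Ω`, and `Ω` is fixed, `n₀` is constant"; p.23 L28–30: the null
subspace of `h` "`= {u ∈ V_ℝ | Ω(u, v) = 0 for all v ∈ V_ℝ}`", "so that `n₊ + n₋ + n₀ = 2n`". -/

/-- For `I ∈ Compl_Ω` (`I² = −1`, `Ω(Iu, Iv) = Ω(u, v)`) the radical of `q_I(u) = Ω(u, Iu)` is the null space of `Ω`:
`u ∈ rad q_I ↔ Ω(u, ·) = 0` (the polar form of `q_I` is `2Ω(u, Iv)`, and `I` is invertible).
[cite: BuskinIzadi2020TwistorLinesTori, v2 §5 (p.23 L26–30; p.24 L20)] -/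
theorem mem_radical_iff {I : F →L[ℝ] F} (hI : ∀ v, I (I v) = -v) {Ω : F [⋀^Fin 2]→L[ℝ] ℝ}
    (hΩI : ∀ u v, Ω ![I u, I v] = Ω ![u, v]) {q : QuadraticForm ℝ F} (hq : ∀ u, q u = Ω ![u, I u]) (u : F) :
    u ∈ q.radical ↔ ∀ v, Ω ![u, v] = 0 := by
  rw [QuadraticMap.mem_radical_iff']
  have polar : ∀ n, q (u + n) = q n + (Ω ![u, I u] + 2 * Ω ![u, I n]) := fun n => by
    rw [hq, hq, map_add, apply₂_add_left, apply₂_add_right, apply₂_add_right,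
      apply₂_map_right_comm hI Ω hΩI n u]
    ring
  constructor
  · rintro ⟨h0, h⟩ v
    rw [hq] at h0
    have h1 := h (-(I v))
    rw [polar, h0, I.map_neg, hI, neg_neg] at h1
    linarith
  · intro h
    refine ⟨by rw [hq, h], fun n => ?_⟩
    rw [polar, h, h, mul_zero, add_zero, add_zero]

/-- Hence `rad q_I = V₀` for every `I ∈ Compl_Ω` and any submodule `V₀` with the printed membership.
[cite: BuskinIzadi2020TwistorLinesTori, v2 §5 (p.23 L28–33)] -/
theorem radical_eq_nullSpace {I : F →L[ℝ] F} (hI : ∀ v, I (I v) = -v) {Ω : F [⋀^Fin 2]→L[ℝ] ℝ}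
    (hΩI : ∀ u v, Ω ![I u, I v] = Ω ![u, v]) {q : QuadraticForm ℝ F} (hq : ∀ u, q u = Ω ![u, I u])
    {V₀ : Submodule ℝ F} (hV₀ : ∀ u, u ∈ V₀ ↔ ∀ v, Ω ![u, v] = 0) : q.radical = V₀ := by
  ext u
  rw [mem_radical_iff hI hΩI hq, hV₀]

/-- **"`n₊ + n₋ + n₀ = 2n`", with `n₀` independent of `I`**: `sigPos q_I + sigNeg q_I + dim_ℝ V₀ = dim_ℝ V_ℝ` for every
`I ∈ Compl_Ω` (Sylvester's law for `q_I`, Mathlib's `sigPos_add_sigNeg_add_radical`, with §2's `rad q_I = V₀`) — "their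
sum is constant". [cite: BuskinIzadi2020TwistorLinesTori, v2 §5 (p.23 L28–30), proof of Prop. 5.1 (p.24 L20–23)] -/
theorem sigPos_add_sigNeg_add_finrank_nullSpace [FiniteDimensional ℝ F] {I : F →L[ℝ] F} (hI : ∀ v, I (I v) = -v)
    {Ω : F [⋀^Fin 2]→L[ℝ] ℝ} (hΩI : ∀ u v, Ω ![I u, I v] = Ω ![u, v]) {q : QuadraticForm ℝ F}
    (hq : ∀ u, q u = Ω ![u, I u]) {V₀ : Submodule ℝ F} (hV₀ : ∀ u, u ∈ V₀ ↔ ∀ v, Ω ![u, v] = 0) :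
    sigPos q + sigNeg q + finrank ℝ V₀ = finrank ℝ F := by
  rw [← radical_eq_nullSpace hI hΩI hq hV₀]
  exact QuadraticForm.sigPos_add_sigNeg_add_radical

/-! ### §3 `n₊` and `n₋` are lower semi-continuous in `I` ("since being positive or negative are open conditions") -/

/-- **`n₊` is lower semi-continuous**: a positive definite subspace of `q_{I₀}` stays positive definite for `q_I`,
`I` near `I₀` in operator norm (minimise `Ω(u, I₀u)` over the unit sphere of the subspace — compact in finite
dimension — and use `|Ω(u, (I − I₀)u)| ⩽ ‖Ω‖·‖I − I₀‖`), so `sigPos q_{I₀} ⩽ sigPos q_I`. No hypothesis `I ∈ Compl_Ω` is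
needed for this half. [cite: BuskinIzadi2020TwistorLinesTori, v2 §5, proof of Prop. 5.1 (p.24 L21–23: "`n₊` and `n₋` are
locally constant follows from the fact that they are both lower semi-continuous (since being positive or negative are
open conditions)")] -/
theorem exists_forall_sigPos_le [FiniteDimensional ℝ F] (Ω : F [⋀^Fin 2]→L[ℝ] ℝ) (I₀ : F →L[ℝ] F)
    {q₀ : QuadraticForm ℝ F} (hq₀ : ∀ u, q₀ u = Ω ![u, I₀ u]) :
    ∃ δ > 0, ∀ I : F →L[ℝ] F, ‖I - I₀‖ < δ →
      ∀ q : QuadraticForm ℝ F, (∀ u, q u = Ω ![u, I u]) → sigPos q₀ ≤ sigPos q := by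
  obtain ⟨V, hV, hpos⟩ := exists_finrank_eq_sigPos_and_posDef q₀
  rw [← hV]
  by_cases hV0 : V = ⊥
  · refine ⟨1, one_pos, fun I _ q _ => ?_⟩
    rw [hV0, finrank_bot]
    exact Nat.zero_le _
  -- the unit sphere of `V` is compact and non-empty
  obtain ⟨v₁, hv₁V, hv₁⟩ := (Submodule.ne_bot_iff V).mp hV0
  set S : Set F := (V : Set F) ∩ sphere (0 : F) 1 with hS_def
  have hSc : IsCompact S := (isCompact_sphere (0 : F) 1).inter_left V.closed_of_finiteDimensional
  have hSne : S.Nonempty := by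
    refine ⟨‖v₁‖⁻¹ • v₁, V.smul_mem _ hv₁V, ?_⟩
    rw [mem_sphere_zero_iff_norm, norm_smul, norm_inv, norm_norm, inv_mul_cancel₀ (norm_ne_zero_iff.mpr hv₁)]
  -- `u ↦ Ω(u, I₀u)` is continuous and attains a positive minimum on `S`
  have hf : Continuous fun u : F => Ω ![u, I₀ u] := by
    have h2 : Continuous fun u : F => (![u, I₀ u] : Fin 2 → F) := by
      refine continuous_pi fun i => ?_
      fin_cases i
      · exact continuous_id
      · exact I₀.continuous
    exact Ω.coe_continuous.comp h2
  obtain ⟨u₀, ⟨hu₀V, hu₀S⟩, hmin⟩ := hSc.exists_isMinOn hSne hf.continuousOn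
  have hu₀n : ‖u₀‖ = 1 := mem_sphere_zero_iff_norm.mp hu₀S
  have hu₀0 : u₀ ≠ 0 := by rintro rfl; simp at hu₀n
  have hm : 0 < Ω ![u₀, I₀ u₀] := by
    have h := hpos ⟨u₀, hu₀V⟩ (fun h => hu₀0 (congrArg Subtype.val h))
    rwa [QuadraticMap.restrict_apply, hq₀] at h
  refine ⟨Ω ![u₀, I₀ u₀] / (‖Ω‖ + 1), by positivity, fun I hI q hq => ?_⟩
  refine le_sigPos_of_posDef q fun x hx => ?_
  rw [QuadraticMap.restrict_apply, hq]
  -- the unit vector `u = x / ‖x‖ ∈ S`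
  have hxn : 0 < ‖(x : F)‖ := norm_pos_iff.mpr fun h => hx (Subtype.ext h)
  set u : F := ‖(x : F)‖⁻¹ • (x : F) with hu_def
  have hu : ‖u‖ = 1 := by rw [hu_def, norm_smul, norm_inv, norm_norm, inv_mul_cancel₀ hxn.ne']
  have huS : u ∈ S := ⟨V.smul_mem _ x.2, mem_sphere_zero_iff_norm.mpr hu⟩
  have h1 : Ω ![u₀, I₀ u₀] ≤ Ω ![u, I₀ u] := isMinOn_iff.mp hmin u huS
  have h2 : |Ω ![u, (I - I₀) u]| ≤ ‖Ω‖ * ‖I - I₀‖ := by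
    calc |Ω ![u, (I - I₀) u]| = ‖Ω ![u, (I - I₀) u]‖ := (Real.norm_eq_abs _).symm
      _ ≤ ‖Ω‖ * ∏ i, ‖(![u, (I - I₀) u] : Fin 2 → F) i‖ := Ω.le_opNorm _
      _ = ‖Ω‖ * ‖(I - I₀) u‖ := by simp [Fin.prod_univ_two, hu]
      _ ≤ ‖Ω‖ * ‖I - I₀‖ := by
        refine mul_le_mul_of_nonneg_left ?_ (norm_nonneg _)
        simpa [hu] using (I - I₀).le_opNorm u
  have h3 : ‖Ω‖ * ‖I - I₀‖ < Ω ![u₀, I₀ u₀] := by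
    have hΩ : 0 ≤ ‖Ω‖ := norm_nonneg _
    calc ‖Ω‖ * ‖I - I₀‖ ≤ ‖Ω‖ * (Ω ![u₀, I₀ u₀] / (‖Ω‖ + 1)) := mul_le_mul_of_nonneg_left hI.le hΩ
      _ < Ω ![u₀, I₀ u₀] := by
        rw [mul_div_assoc', div_lt_iff₀ (by positivity)]
        nlinarith
  have h4 : 0 < Ω ![u, I u] := by
    have h5 : Ω ![u, I u] = Ω ![u, I₀ u] + Ω ![u, (I - I₀) u] := by
      rw [_root_.sub_apply, ← apply₂_add_right, add_sub_cancel]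
    have h6 := (abs_le.mp h2).1
    linarith
  -- scale back from `u` to `x`
  have h7 : Ω ![u, I u] = ‖(x : F)‖⁻¹ * (‖(x : F)‖⁻¹ * Ω ![(x : F), I x]) := by
    simp only [hu_def, map_smul, apply₂_smul_left, apply₂_smul_right, smul_eq_mul]
  rw [h7] at h4
  have hi : 0 < ‖(x : F)‖⁻¹ := inv_pos.mpr hxn
  exact (mul_pos_iff_of_pos_left hi).mp ((mul_pos_iff_of_pos_left hi).mp h4)

/-- **`n₋` is lower semi-continuous** (the previous statement for `−I₀`, `−I`: `q_{−I} = −q_I` and `sigNeg q = sigPos (−q)`).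
[cite: BuskinIzadi2020TwistorLinesTori, v2 §5, proof of Prop. 5.1 (p.24 L21–23)] -/
theorem exists_forall_sigNeg_le [FiniteDimensional ℝ F] (Ω : F [⋀^Fin 2]→L[ℝ] ℝ) (I₀ : F →L[ℝ] F)
    {q₀ : QuadraticForm ℝ F} (hq₀ : ∀ u, q₀ u = Ω ![u, I₀ u]) :
    ∃ δ > 0, ∀ I : F →L[ℝ] F, ‖I - I₀‖ < δ →
      ∀ q : QuadraticForm ℝ F, (∀ u, q u = Ω ![u, I u]) → sigNeg q₀ ≤ sigNeg q := by
  have hq₀' : ∀ u, (-q₀) u = Ω ![u, (-I₀) u] := fun u => by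
    rw [QuadraticMap.neg_apply, hq₀, _root_.neg_apply, apply₂_neg_right]
  obtain ⟨δ, hδ, h⟩ := exists_forall_sigPos_le Ω (-I₀) hq₀'
  refine ⟨δ, hδ, fun I hI q hq => ?_⟩
  have hq' : ∀ u, (-q) u = Ω ![u, (-I) u] := fun u => by
    rw [QuadraticMap.neg_apply, hq, _root_.neg_apply, apply₂_neg_right]
  have hI' : ‖-I - -I₀‖ < δ := by rwa [← neg_sub', norm_neg, norm_sub_rev, norm_sub_rev I₀]
  have := h (-I) hI' (-q) hq'
  rwa [sigPos_neg, sigPos_neg] at this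

/-! ### §4 Proposition 5.1: `Sign` is locally constant on `Compl_Ω` -/

/-- **Proposition 5.1 (Buskin–Izadi), `δ`-form.** "The mapping `Sign : Compl±_Ω → S_Ω` is constant on every connected
component of `Compl_Ω`" — locally: for `I₀ ∈ Compl_Ω` there is `δ > 0` such that every `I ∈ Compl_Ω` with
`‖I − I₀‖ < δ` has the same signature, `sigPos q_I = sigPos q_{I₀}` and `sigNeg q_I = sigNeg q_{I₀}` (`n₀ = dim V₀` being
the same for all `I`): "Since `n₀` is the dimension of the kernel of `Ω`, and `Ω` is fixed, `n₀` is constant. Now the fact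
that `n₊` and `n₋` are locally constant follows from the fact that they are both lower semi-continuous […] and their sum
is constant." [cite: BuskinIzadi2020TwistorLinesTori, v2 §5 Prop. 5.1 (p.24 L17–19), proof (p.24 L20–24)] -/
theorem exists_forall_sigPos_eq_and_sigNeg_eq [FiniteDimensional ℝ F] (Ω : F [⋀^Fin 2]→L[ℝ] ℝ) {I₀ : F →L[ℝ] F}
    (hI₀ : ∀ v, I₀ (I₀ v) = -v) (hΩI₀ : ∀ u v, Ω ![I₀ u, I₀ v] = Ω ![u, v]) {q₀ : QuadraticForm ℝ F}
    (hq₀ : ∀ u, q₀ u = Ω ![u, I₀ u]) :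
    ∃ δ > 0, ∀ I : F →L[ℝ] F, (∀ v, I (I v) = -v) → (∀ u v, Ω ![I u, I v] = Ω ![u, v]) → ‖I - I₀‖ < δ →
      ∀ q : QuadraticForm ℝ F, (∀ u, q u = Ω ![u, I u]) → sigPos q = sigPos q₀ ∧ sigNeg q = sigNeg q₀ := by
  -- a null space of `Ω` (the radical of `q₀`)
  obtain ⟨V₀, hV₀⟩ : ∃ V₀ : Submodule ℝ F, ∀ u, u ∈ V₀ ↔ ∀ v, Ω ![u, v] = 0 :=
    ⟨q₀.radical, mem_radical_iff hI₀ hΩI₀ hq₀⟩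
  obtain ⟨δ₁, hδ₁, h₁⟩ := exists_forall_sigPos_le Ω I₀ hq₀
  obtain ⟨δ₂, hδ₂, h₂⟩ := exists_forall_sigNeg_le Ω I₀ hq₀
  refine ⟨min δ₁ δ₂, lt_min hδ₁ hδ₂, fun I hI hΩI hd q hq => ?_⟩
  have hp := h₁ I (lt_of_lt_of_le hd (min_le_left _ _)) q hq
  have hn := h₂ I (lt_of_lt_of_le hd (min_le_right _ _)) q hq
  have hs₀ := sigPos_add_sigNeg_add_finrank_nullSpace hI₀ hΩI₀ hq₀ hV₀
  have hs := sigPos_add_sigNeg_add_finrank_nullSpace hI hΩI hq hV₀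
  omega

/-- **Proposition 5.1, topological form: `Sign` is locally constant on `Compl_Ω`.** On the subspace
`Compl_Ω = {I | I² = −1, Ω(I·, I·) = Ω}` of `End(V_ℝ)` (operator-norm topology) the map
`I ↦ (sigPos q_I, sigNeg q_I)` — the signature `(n₊, n₋, n₀)` up to doubling, `n₀` being fixed — is locally constant, for
any family `q_I` of quadratic forms with `q_I(u) = Ω(u, Iu)` (`exists_quadraticForm_family`).
[cite: BuskinIzadi2020TwistorLinesTori, v2 §5 Prop. 5.1 (p.24 L17–19), proof (p.24 L20–24)] -/
theorem isLocallyConstant_sign [FiniteDimensional ℝ F] (Ω : F [⋀^Fin 2]→L[ℝ] ℝ)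
    {q : (F →L[ℝ] F) → QuadraticForm ℝ F} (hq : ∀ I u, q I u = Ω ![u, I u]) :
    IsLocallyConstant fun I : {I : F →L[ℝ] F // (∀ v, I (I v) = -v) ∧ ∀ u v, Ω ![I u, I v] = Ω ![u, v]} =>
      (sigPos (q I.1), sigNeg (q I.1)) := by
  rw [IsLocallyConstant.iff_eventually_eq]
  rintro ⟨I₀, hI₀, hΩI₀⟩
  obtain ⟨δ, hδ, h⟩ := exists_forall_sigPos_eq_and_sigNeg_eq Ω hI₀ hΩI₀ (hq I₀)
  rw [Metric.eventually_nhds_iff]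
  refine ⟨δ, hδ, ?_⟩
  rintro ⟨I, hI, hΩI⟩ hd
  rw [Subtype.dist_eq, dist_eq_norm] at hd
  obtain ⟨h1, h2⟩ := h I hI hΩI hd (q I) (hq I)
  simp only [h1, h2]

/-- **Proposition 5.1 as printed: "The mapping `Sign : Compl±_Ω → S_Ω` is constant on every connected component of
`Compl_Ω`"** — two operators of `Compl_Ω` in the same connected component (of the subspace `Compl_Ω` of `End(V_ℝ)`)
have hermitian forms of the same signature: `sigPos q_I = sigPos q_J` and `sigNeg q_I = sigNeg q_J` (and the common
`n₀ = dim_ℂ V₀`). [cite: BuskinIzadi2020TwistorLinesTori, v2 §5 Prop. 5.1 (p.24 L17–19)] -/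
theorem sign_eq_of_mem_connectedComponent [FiniteDimensional ℝ F] (Ω : F [⋀^Fin 2]→L[ℝ] ℝ)
    {q : (F →L[ℝ] F) → QuadraticForm ℝ F} (hq : ∀ I u, q I u = Ω ![u, I u])
    (I J : {I : F →L[ℝ] F // (∀ v, I (I v) = -v) ∧ ∀ u v, Ω ![I u, I v] = Ω ![u, v]})
    (hJ : J ∈ connectedComponent I) :
    sigPos (q I.1) = sigPos (q J.1) ∧ sigNeg (q I.1) = sigNeg (q J.1) := by
  have h := (isLocallyConstant_sign Ω hq).apply_eq_of_isPreconnected isPreconnected_connectedComponent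
    mem_connectedComponent hJ
  exact ⟨congrArg Prod.fst h, congrArg Prod.snd h⟩

end Literature.Geometry.Hyperkaehler.HodgeLocus

end PartC

/-!
## Part D — standalone draft `HodgeLocusAdaptedOrthogonalBasis.v1` (sha256∕16 68f7e0157bc07fe4), reproduced verbatim below
(its module docstring first: references to "this file" ∕ "this leaf" mean this Part; items it lists as
"NOT here" may be supplied by other Parts — see the file header; then its code, byte-identical).

# For `I ∈ Compl_Ω` the hermitian form `h` of `Ω` and `I` has an orthogonal basis: an `I`-adapted basis `(c_i, I c_i)`
# of `V_ℝ` with `h(c_i, c_j) = 0` for `i ≠ j` (Buskin–Izadi §5, the bases the proof of Lemma 5.2 starts from)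

Topic `Literature/Geometry/Hyperkaehler`, namespace `Literature.Geometry.Hyperkaehler.HodgeLocus`. Written by the literature
seat `lit-w-verbitsky` (gen 16) of the cell `pub-hsemireg` (HodgeConjecture venture), 2026-08-25, as a kernel leg of row
V-V20 of that cell's Verbitsky table ([BI20] Thm. 2 = Thm. 5.4 with Prop. 5.1 ∕ Lemma 5.2 ∕ Lemma 5.3 behind it). THEOREMS
ONLY (no definition, no named fact, no `sorry`). Nothing in this file is a statement about the Hodge conjecture, and nothing
here says that any object of the cell is hyperholomorphic, rotable or carries a twistor line.

The proof of Lemma 5.2 STARTS from `h`-orthonormal bases of the complex space `(V_ℝ, I)` adapted to the decomposition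
`V₊ ⊕ V₋ ⊕ V₀` — for TWO periods `I₁, I₂` — and builds `g` with `g*Ω = Ω`, `I₂ = ᵍI₁` out of them; the keyed companion leaf
`HodgeLocusTwistorLineSignature.lean` (gen 15) formalises that construction TAKING the matched bases as hypotheses, and the
tree's `TwistorLineHermitianFormSignature.lean` (gen 7) produces such bases on the COMPLEX carrier (`E` a complex normed
space, `I = i•`, via the spectral theorem). This file produces them on the REAL carrier of the lineage's twistor-line files
(`F = V_ℝ` a real normed space, `I : F →L[ℝ] F` with `I² = −1`, `Ω : F [⋀^Fin 2]→L[ℝ] ℝ`), for an ARBITRARY `I ∈ Compl_Ω`,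
by the elementary Gram–Schmidt argument for the hermitian form `h` (no spectral theorem): a maximal `h`-orthogonal family
with `h(c_i, c_i) ≠ 0` is split off, `h` vanishes identically on its `h`-orthogonal complement (polarisation), which is a
complex subspace and receives an arbitrary `I`-adapted basis (the tree's `ComplexStructure.exists_adapted_basis`). The
output is at the same time a `2×2`-block basis of `Ω` adapted to `I` in the sense of the companion leaf
`HodgeLocusSignatureSurjective.lean` (Lemma 5.3), so that leaf's coordinate formula `h(u, u) = Σ_k ε_k κ_k (x_k² + y_k²)`
and signature counts apply to every `I ∈ Compl_Ω`, not only to the operators constructed there.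

## Source, verbatim (N. Buskin, E. Izadi, *Twistor lines in the period domain of complex tori*, arXiv:1806.07831v2 (28 Jun
## 2020) = Geom. Dedicata 213 (2021) 21–47, journal pages unseen by the cell; "v2 p.N Lm" = PDF page N, text-layer line m of
## the cell's dump `texts-verbitsky/bi20v2/dump/` (PDF sha256∕16 9e1097db4f2fd005), checked on the arXiv v2 LaTeX source
## `texts-verbitsky/bi20v2/src/Twistor-path-conn-06-20-20.tex` (sha256∕16 201e79451d245bd7, ll. 1683–1711))

* v2 p.23 L20–30: "Let `I` be a complex structure operator in `Compl_Ω`, that is, `Ω(Iu, Iv) = Ω(u, v)` for all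
  `u, v ∈ V_ℝ`. On the vector space `(V_ℝ, I)`, considered as a complex vector space, the form `Ω` determines a hermitian form
  `h(u, v) := Ω(u, Iv) − iΩ(u, v)` (note that `h(u, Iv) = −ih(u, v)`, `h(Iu, v) = ih(u, v)`), which we will call the
  hermitian form associated to `Ω` and `I`. The signature of `h` is a triple `(n₊, n₋, n₀)`, where `n₊`, `n₋` and `n₀` are
  the complex dimensions of, respectively, a maximal positive subspace `V₊`, a maximal negative subspace `V₋`, and the null
  subspace `V₀ = {u ∈ V_ℝ | h(u, v) = 0 for all v ∈ V_ℝ} = {u ∈ V_ℝ | Ω(u, v) = 0 for all v ∈ V_ℝ}` of `h` in `(V_ℝ, I)`, so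
  that `n₊ + n₋ + n₀ = 2n`."
* v2 p.25 L10–24 (proof of Lemma 5.2): "Let `I₁, I₂` be periods in `Compl±_Ω`. Assume that `Sign(I₁) = Sign(I₂)`, that is,
  the associated hermitian forms `h₁` on `(V_ℝ, I₁)` and `h₂` on `(V_ℝ, I₂)` have the same signature `(k, l, m)`. First we fix
  orthogonal decompositions into maximal positive, negative and null subspaces `V_ℝ = V₊ ⊕ V₋ ⊕ V₀` of `(V_ℝ, I₁)` with
  respect to `h₁` and `V_ℝ = W₊ ⊕ W₋ ⊕ V₀` of `(V_ℝ, I₂)` with respect to `h₂`, here `dim_ℂ V₊ = k = dim_ℂ W₊`,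
  `dim_ℂ V₋ = l = dim_ℂ W₋` and `V₀` is the null subspace for `Ω`, `dim_ℂ V₀ = m`. Let us choose an `h₁`-orthonormal basis
  `v₁, …, v_k` of the complex subpace `(V₊, I₁)` and an `h₂`-orthonormal basis `w₁, …, w_k` of the complex subpace
  `(W₊, I₂)`, similarly choose `−h₁`-orthonormal and `−h₂`-orthonormal bases for the subspaces `V₋, W₋`, and some
  (arbitrary) bases for `(V₀, I₁)` and `(V₀, I₂)`."

## What is formalised (`F` = `V_ℝ`, a real normed space, finite-dimensional from §3 on; "`I ∈ Compl_Ω`" = `I² = −1 ∧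
## ∀ u v, Ω ![I u, I v] = Ω ![u, v]`; `h(u, v) = Ω(u, Iv) − iΩ(u, v)`, so "`u ⊥_h c`" = `Ω ![u, c] = 0 ∧ Ω ![u, I c] = 0`
## and `h(c, c) = Ω ![c, I c]`; an "adapted family" is `c : Fin k → F` together with the `I c_i`)

* §1 `apply₂_sum_adapted` — pairing `Σ_i (a_i c_i + b_i I c_i)` against `I c_j` ∕ `c_j` reads off `a_j η_j` ∕ `−b_j η_j`
  (`η_j = h(c_j, c_j)`) for an `h`-orthogonal family; `linearIndependent_adapted_of_orthogonal` — an `h`-orthogonal family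
  with all `η_i ≠ 0` is linearly independent together with its `I`-images.
* §2 `exists_orthogonalFamilyComplement` (the `h`-orthogonal complement of a family as a submodule),
  `map_mem_orthogonalFamilyComplement` (it is a complex subspace), **`exists_orthogonal_decomposition`** — Gram–Schmidt
  against `h`: `u = Σ_i (a_i c_i + b_i I c_i) + u'`, `u' ⊥_h` the family (`a_i = Ω(u, I c_i)/η_i`, `b_i = −Ω(u, c_i)/η_i`).
* §3 **`exists_maximal_orthogonal_adapted_family`** — a longest `h`-orthogonal adapted family with all `η_i ≠ 0`; every
  vector `h`-orthogonal to it has `h(u, u) = 0`; `apply₂_eq_zero_of_forall_apply₂_self_map_eq_zero` — polarisation: on a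
  complex subspace where `h(u, u) ≡ 0`, `h ≡ 0` (`Ω(u, Iv) = 0` and `Ω(u, v) = 0`), via the tree's
  `TwistorLine.apply₂_map_right_comm` (`Ω(·, I·)` is symmetric for `I ∈ Compl_Ω`).
* §4 **`exists_adapted_orthogonal_basis`** — THE ORTHOGONAL-BASIS THEOREM: every `I ∈ Compl_Ω` has an `I`-adapted basis
  `(c_i, I c_i)_{i<M}` of `V_ℝ` with `h(c_i, c_j) = 0` for `i ≠ j` (the family of §3 followed by an `I`-adapted basis of its
  `h`-orthogonal complement, the tree's `ComplexStructure.exists_adapted_basis` on that subspace; linear independence by the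
  dimension count `dim V_ℝ = 2k + 2l`); **`exists_adapted_blockBasis`** — the same in the block-basis shape of
  `HodgeLocusSignatureSurjective.lean` (`Ω(e_i, e_j) = Ω(f_i, f_j) = 0`, `Ω(e_i, f_j) = δ_ij η_i`, `I e_i = f_i`, `I f_i = −e_i`);
  **`exists_adapted_orthonormal_basis`** — with `h(c_i, c_i) ∈ {1, −1, 0}` after rescaling ("`h₁`-orthonormal",
  "`−h₁`-orthonormal", "arbitrary" on `V₀`).

## What is NOT here

The grouping of the orthonormal basis into `V₊ ⊕ V₋ ⊕ V₀` with the COUNTS `(k, l, m) = Sign(I)` made explicit (the counts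
of `η_i = 1, −1, 0` are the signature by `HodgeLocusSignatureSurjective.lean` §3 ∕ §6 — not re-derived here); the matching of
two such bases for `I₁, I₂` of the same signature and the element `g` (`HodgeLocusTwistorLineSignature.lean`); `G⁰_Ω`;
Prop. 5.1, Lemma 5.3, Thm. 5.4. `Compl_Ω`, `Sign` are not introduced as objects.

## References

* [BuskinIzadi2020TwistorLinesTori] N. Buskin, E. Izadi, *Twistor lines in the period domain of complex tori*, Geom. Dedicata
  213 (2021) 21–47 = arXiv:1806.07831v2, §5: p.23 L20–30 (the hermitian form `h` of `Ω` and `I`, its signature), Lemma 5.2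
  (p.24 L33–36) and its proof (p.25 L10–34, the orthonormal adapted bases at L13–24). arXiv v1 LACKS §5 — cite v2 only.
-/

namespace Literature.Geometry.Hyperkaehler.HodgeLocus

open Literature.Geometry.Hyperkaehler.TwistorLine (apply₂_map_left apply₂_map_right_comm)
open Literature.Geometry.Hyperkaehler.ComplexStructure (exists_adapted_basis)

variable {F : Type*} [NormedAddCommGroup F] [NormedSpace ℝ F]

/-! ### §1 The symmetric form `g(u, v) = Re h(u, v) = Ω(u, Iv)` of `I ∈ Compl_Ω`: pairing against an orthogonal
adapted family -/

/-- The `2`-covector `Ω` as a bilinear form, existence form with the arguments in the printed order `Ω(u, v) = B u v`.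
[folklore] -/
private theorem exists_bilinForm' (Ω : F [⋀^Fin 2]→L[ℝ] ℝ) :
    ∃ B : LinearMap.BilinForm ℝ F, ∀ u v, Ω ![u, v] = B u v :=
  ⟨LinearMap.mk₂ ℝ (fun u v => Ω ![u, v]) (apply₂_add_left Ω) (apply₂_smul_left Ω) (apply₂_add_right Ω)
    (apply₂_smul_right Ω), fun _ _ => rfl⟩

/-- **Pairing a combination `x = Σ_i (a_i c_i + b_i I c_i)` of an `h`-orthogonal `I`-adapted family against `I c_j` and
`c_j`**: `Ω(x, I c_j) = a_j η_j` and `Ω(x, c_j) = −b_j η_j`, `η_j = Ω(c_j, I c_j) = h(c_j, c_j)` — the coordinates in an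
`h`-orthogonal basis are read off by `h` ("an `h₁`-orthonormal basis `v₁, …, v_k` of the complex subpace `(V₊, I₁)` …").
[cite: BuskinIzadi2020TwistorLinesTori, v2 §5, proof of Lemma 5.2 (p.25 L16–24)] -/
theorem apply₂_sum_adapted {I : F →L[ℝ] F} (hI : ∀ v, I (I v) = -v) (Ω : F [⋀^Fin 2]→L[ℝ] ℝ)
    (hΩI : ∀ u v, Ω ![I u, I v] = Ω ![u, v]) {k : ℕ} {c : Fin k → F}
    (horth : ∀ i j, i ≠ j → Ω ![c i, c j] = 0 ∧ Ω ![c i, I (c j)] = 0) (a b : Fin k → ℝ) (j : Fin k) :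
    Ω ![∑ i, (a i • c i + b i • I (c i)), I (c j)] = a j * Ω ![c j, I (c j)] ∧
      Ω ![∑ i, (a i • c i + b i • I (c i)), c j] = -(b j * Ω ![c j, I (c j)]) := by
  obtain ⟨B, hB⟩ := exists_bilinForm' Ω
  have hcc : ∀ i, Ω ![c i, c i] = 0 := fun i => by
    have h := apply₂_swap Ω (c i) (c i); linarith
  -- the tables
  have t2 : ∀ i, Ω ![I (c i), I (c j)] = 0 := fun i => by
    rw [hΩI]
    by_cases h : i = j
    · subst h; exact hcc i
    · exact (horth i j h).1
  have t3 : ∀ i, Ω ![c i, c j] = 0 := fun i => by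
    by_cases h : i = j
    · subst h; exact hcc i
    · exact (horth i j h).1
  constructor
  · rw [hB, map_sum, LinearMap.sum_apply]
    simp only [map_add, map_smul, LinearMap.add_apply, LinearMap.smul_apply, smul_eq_mul, ← hB]
    rw [Finset.sum_eq_single j]
    · rw [t2, mul_zero, add_zero]
    · intro i _ hij
      rw [(horth i j hij).2, t2, mul_zero, mul_zero, add_zero]
    · intro h
      exact absurd (Finset.mem_univ j) h
  · rw [hB, map_sum, LinearMap.sum_apply]
    simp only [map_add, map_smul, LinearMap.add_apply, LinearMap.smul_apply, smul_eq_mul, ← hB]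
    rw [Finset.sum_eq_single j]
    · rw [t3, mul_zero, zero_add, apply₂_map_left hI Ω hΩI, mul_neg]
    · intro i _ hij
      rw [t3, apply₂_map_left hI Ω hΩI, (horth i j hij).2, mul_zero, neg_zero, mul_zero, add_zero]
    · intro h
      exact absurd (Finset.mem_univ j) h

/-- **An `h`-orthogonal `I`-adapted family with all `h(c_i, c_i) ≠ 0` is linearly independent together with its
`I`-images** (the real basis `v₁, I₁v₁, …, v_k, I₁v_k` underlying "`g(v₁) = w₁, g(I₁v₁) = I₂w₁, …`").
[cite: BuskinIzadi2020TwistorLinesTori, v2 §5, proof of Lemma 5.2 (p.25 L16–26)] -/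
theorem linearIndependent_adapted_of_orthogonal {I : F →L[ℝ] F} (hI : ∀ v, I (I v) = -v)
    (Ω : F [⋀^Fin 2]→L[ℝ] ℝ) (hΩI : ∀ u v, Ω ![I u, I v] = Ω ![u, v]) {k : ℕ} {c : Fin k → F}
    (horth : ∀ i j, i ≠ j → Ω ![c i, c j] = 0 ∧ Ω ![c i, I (c j)] = 0) (hη : ∀ i, Ω ![c i, I (c i)] ≠ 0) :
    LinearIndependent ℝ (Sum.elim c (fun i => I (c i))) := by
  rw [Fintype.linearIndependent_iff]
  intro g hg
  have hsum : ∑ i, (g (.inl i) • c i + g (.inr i) • I (c i)) = 0 := by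
    rw [Finset.sum_add_distrib]
    simpa [Fintype.sum_sum_type] using hg
  have key := fun j => apply₂_sum_adapted hI Ω hΩI horth (fun i => g (.inl i)) (fun i => g (.inr i)) j
  simp only [hsum] at key
  have h0 : ∀ w, Ω ![(0 : F), w] = 0 := fun w => by simpa using apply₂_smul_left Ω (0 : ℝ) (0 : F) w
  rintro (j | j)
  · have h := (key j).1
    rw [h0] at h
    exact (mul_eq_zero.mp h.symm).resolve_right (hη j)
  · have h := (key j).2
    rw [h0] at h
    have h' : g (.inr j) * Ω ![c j, I (c j)] = 0 := by linarith
    exact (mul_eq_zero.mp h').resolve_right (hη j)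

/-! ### §2 The `h`-orthogonal complement of an adapted family and the projection onto the family -/

/-- The `h`-orthogonal complement `{u | h(u, c_i) = 0 ∀ i} = {u | Ω(u, c_i) = Ω(u, I c_i) = 0 ∀ i}` of a family, as a
submodule (existence form). [cite: BuskinIzadi2020TwistorLinesTori, v2 §5, proof of Lemma 5.2 (p.25 L13–16: "orthogonal
decompositions into maximal positive, negative and null subspaces")] -/
theorem exists_orthogonalFamilyComplement (Ω : F [⋀^Fin 2]→L[ℝ] ℝ) (I : F →L[ℝ] F) {k : ℕ} (c : Fin k → F) :
    ∃ W : Submodule ℝ F, ∀ u, u ∈ W ↔ ∀ i, Ω ![u, c i] = 0 ∧ Ω ![u, I (c i)] = 0 := by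
  obtain ⟨B, hB⟩ := exists_bilinForm' Ω
  refine ⟨LinearMap.ker (LinearMap.pi fun i => B.flip (c i)) ⊓
    LinearMap.ker (LinearMap.pi fun i => B.flip (I (c i))), fun u => ?_⟩
  simp only [Submodule.mem_inf, LinearMap.mem_ker, funext_iff, LinearMap.pi_apply, Pi.zero_apply]
  constructor
  · rintro ⟨h1, h2⟩ i
    exact ⟨by rw [hB]; exact h1 i, by rw [hB]; exact h2 i⟩
  · intro h
    exact ⟨fun i => by have h' := (h i).1; rwa [hB] at h', fun i => by have h' := (h i).2; rwa [hB] at h'⟩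

/-- The `h`-orthogonal complement of a family is `I`-stable (a complex subspace of `(V_ℝ, I)`), for `I ∈ Compl_Ω`.
[cite: BuskinIzadi2020TwistorLinesTori, v2 §5, proof of Lemma 5.2 (p.25 L13–16)] -/
theorem map_mem_orthogonalFamilyComplement {I : F →L[ℝ] F} (hI : ∀ v, I (I v) = -v) (Ω : F [⋀^Fin 2]→L[ℝ] ℝ)
    (hΩI : ∀ u v, Ω ![I u, I v] = Ω ![u, v]) {k : ℕ} {c : Fin k → F} {u : F}
    (hu : ∀ i, Ω ![u, c i] = 0 ∧ Ω ![u, I (c i)] = 0) (i : Fin k) :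
    Ω ![I u, c i] = 0 ∧ Ω ![I u, I (c i)] = 0 := by
  refine ⟨?_, by rw [hΩI]; exact (hu i).1⟩
  rw [apply₂_map_left hI Ω hΩI, (hu i).2, neg_zero]

/-- **Projection onto an `h`-orthogonal adapted family with `h(c_i, c_i) ≠ 0`**: every `u` is
`Σ_i (a_i c_i + b_i I c_i) + u'` with `a_i = Ω(u, I c_i)/η_i`, `b_i = −Ω(u, c_i)/η_i` and `u'` `h`-orthogonal to the family
(Gram–Schmidt against `h`; the decomposition "`V_ℝ = V₊ ⊕ V₋ ⊕ V₀`" of the printed proof is obtained this way).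
[cite: BuskinIzadi2020TwistorLinesTori, v2 §5, proof of Lemma 5.2 (p.25 L13–16)] -/
theorem exists_orthogonal_decomposition {I : F →L[ℝ] F} (hI : ∀ v, I (I v) = -v) (Ω : F [⋀^Fin 2]→L[ℝ] ℝ)
    (hΩI : ∀ u v, Ω ![I u, I v] = Ω ![u, v]) {k : ℕ} {c : Fin k → F}
    (horth : ∀ i j, i ≠ j → Ω ![c i, c j] = 0 ∧ Ω ![c i, I (c j)] = 0) (hη : ∀ i, Ω ![c i, I (c i)] ≠ 0) (u : F) :
    ∃ u' : F, (∀ i, Ω ![u', c i] = 0 ∧ Ω ![u', I (c i)] = 0) ∧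
      u = ∑ i, ((Ω ![u, I (c i)] / Ω ![c i, I (c i)]) • c i + (-Ω ![u, c i] / Ω ![c i, I (c i)]) • I (c i)) + u' := by
  set x := ∑ i, ((Ω ![u, I (c i)] / Ω ![c i, I (c i)]) • c i + (-Ω ![u, c i] / Ω ![c i, I (c i)]) • I (c i)) with hx
  have key := fun j => apply₂_sum_adapted hI Ω hΩI horth (fun i => Ω ![u, I (c i)] / Ω ![c i, I (c i)])
    (fun i => -Ω ![u, c i] / Ω ![c i, I (c i)]) j
  refine ⟨u - x, fun i => ⟨?_, ?_⟩, by abel⟩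
  · rw [sub_eq_add_neg, apply₂_add_left, apply₂_neg_left, (key i).2, div_mul_cancel₀ _ (hη i)]
    ring
  · rw [sub_eq_add_neg, apply₂_add_left, apply₂_neg_left, (key i).1, div_mul_cancel₀ _ (hη i)]
    ring

/-! ### §3 A maximal `h`-orthogonal adapted family with `h(c_i, c_i) ≠ 0`; `h` vanishes on its orthogonal complement -/

/-- **A maximal non-degenerate `h`-orthogonal adapted family**: there is an `h`-orthogonal `I`-adapted family
`c_1, …, c_k` with all `η_i = h(c_i, c_i) ≠ 0` such that `h(u, u) = Ω(u, Iu) = 0` for every `u` `h`-orthogonal to the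
family (a longest such family; a vector with `h(u, u) ≠ 0` orthogonal to it would extend it). This is the orthogonal-basis
theorem for the hermitian form `h` on `(V_ℝ, I)` — the bases "`h₁`-orthonormal […] of the complex subpace `(V₊, I₁)`",
"`−h₁`-orthonormal […] for the subspaces `V₋`" of the printed proof, up to normalisation.
[cite: BuskinIzadi2020TwistorLinesTori, v2 §5, proof of Lemma 5.2 (p.25 L13–24)] -/
theorem exists_maximal_orthogonal_adapted_family [FiniteDimensional ℝ F] {I : F →L[ℝ] F} (hI : ∀ v, I (I v) = -v)
    (Ω : F [⋀^Fin 2]→L[ℝ] ℝ) (hΩI : ∀ u v, Ω ![I u, I v] = Ω ![u, v]) :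
    ∃ (k : ℕ) (c : Fin k → F), (∀ i j, i ≠ j → Ω ![c i, c j] = 0 ∧ Ω ![c i, I (c j)] = 0) ∧
      (∀ i, Ω ![c i, I (c i)] ≠ 0) ∧
      ∀ u, (∀ i, Ω ![u, c i] = 0 ∧ Ω ![u, I (c i)] = 0) → Ω ![u, I u] = 0 := by
  classical
  let P : ℕ → Prop := fun j => ∃ c : Fin j → F,
    (∀ i i', i ≠ i' → Ω ![c i, c i'] = 0 ∧ Ω ![c i, I (c i')] = 0) ∧ ∀ i, Ω ![c i, I (c i)] ≠ 0
  have hP0 : P 0 := ⟨Fin.elim0, fun i => Fin.elim0 i, fun i => Fin.elim0 i⟩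
  have hPbound : ∀ j, P j → 2 * j ≤ finrank ℝ F := fun j ⟨c, hc, hη⟩ => by
    have h := (linearIndependent_adapted_of_orthogonal hI Ω hΩI hc hη).fintype_card_le_finrank
    simpa [Fintype.card_sum, Fintype.card_fin, two_mul] using h
  set m := Nat.findGreatest P (finrank ℝ F) with hm
  obtain ⟨c, hc, hη⟩ : P m := Nat.findGreatest_spec (Nat.zero_le _) hP0
  refine ⟨m, c, hc, hη, fun u hu => ?_⟩
  by_contra hne
  -- `u` extends the family, contradicting maximality
  have hP1 : P (m + 1) := by
    refine ⟨Fin.append c ![u], fun i i' hii' => ?_, fun i => ?_⟩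
    · induction i using Fin.addCases with
      | left i =>
        induction i' using Fin.addCases with
        | left i' =>
          rw [Fin.append_left, Fin.append_left]
          exact hc i i' fun h => hii' (by rw [h])
        | right i' =>
          rw [Fin.append_left, Fin.append_right, Fin.fin_one_eq_zero i', Matrix.cons_val_zero]
          refine ⟨by rw [apply₂_swap, (hu i).1, neg_zero], ?_⟩
          rw [apply₂_swap, apply₂_map_left hI Ω hΩI, (hu i).2, neg_zero, neg_zero]
      | right i =>
        induction i' using Fin.addCases with
        | left i' =>
          rw [Fin.append_right, Fin.append_left, Fin.fin_one_eq_zero i, Matrix.cons_val_zero]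
          exact hu i'
        | right i' =>
          exact absurd (by rw [Fin.fin_one_eq_zero i, Fin.fin_one_eq_zero i']) hii'
    · induction i using Fin.addCases with
      | left i => rw [Fin.append_left]; exact hη i
      | right i => rw [Fin.append_right, Fin.fin_one_eq_zero i, Matrix.cons_val_zero]; exact hne
  have hle : m + 1 ≤ finrank ℝ F := by have := hPbound _ hP1; omega
  exact Nat.findGreatest_is_greatest (Nat.lt_succ_self _) hle hP1

/-- **Polarisation**: if `h(u, u) = Ω(u, Iu)` vanishes on an `I`-stable subspace `W` (for `I ∈ Compl_Ω`), then `h` — both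
`Re h = Ω(·, I·)` and `Im h = −Ω` — vanishes identically on `W` (the null subspace "`V₀`" part of the printed
decomposition, where "some (arbitrary) bases for `(V₀, I₁)`" are taken). [cite: BuskinIzadi2020TwistorLinesTori, v2 §5,
proof of Lemma 5.2 (p.25 L13–24)] -/
theorem apply₂_eq_zero_of_forall_apply₂_self_map_eq_zero {I : F →L[ℝ] F} (hI : ∀ v, I (I v) = -v)
    (Ω : F [⋀^Fin 2]→L[ℝ] ℝ) (hΩI : ∀ u v, Ω ![I u, I v] = Ω ![u, v]) {W : Submodule ℝ F}
    (hWI : ∀ u ∈ W, I u ∈ W) (h0 : ∀ u ∈ W, Ω ![u, I u] = 0) {u v : F} (hu : u ∈ W) (hv : v ∈ W) :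
    Ω ![u, I v] = 0 ∧ Ω ![u, v] = 0 := by
  have h1 : Ω ![u, I v] = 0 := by
    have h := h0 (u + v) (W.add_mem hu hv)
    rw [map_add, apply₂_add_left, apply₂_add_right, apply₂_add_right, h0 u hu, h0 v hv,
      apply₂_map_right_comm hI Ω hΩI v u] at h
    linarith
  refine ⟨h1, ?_⟩
  have h2 : Ω ![u, I (I v)] = 0 := by
    have h := h0 (u + I v) (W.add_mem hu (hWI v hv))
    rw [map_add, apply₂_add_left, apply₂_add_right, apply₂_add_right, h0 u hu, h0 _ (hWI v hv),
      apply₂_map_right_comm hI Ω hΩI (I v) u] at h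
    linarith
  rw [hI, apply₂_neg_right] at h2
  linarith

/-! ### §4 The orthogonal-basis theorem for `h` on `(V_ℝ, I)`, `I ∈ Compl_Ω` -/

/-- **Every `I ∈ Compl_Ω` admits an `h`-ORTHOGONAL `I`-adapted basis of `V_ℝ`**: a basis `(c_i, I c_i)_{i<M}` (indexed by
`Fin M ⊕ Fin M`: `inl i ↦ c_i`, `inr i ↦ I c_i`) with `h(c_i, c_j) = 0` for `i ≠ j`, i.e. `Ω(c_i, c_j) = 0` and
`Ω(c_i, I c_j) = 0` — an orthogonal basis `c_1, …, c_M` of the hermitian form `h` on the complex space `(V_ℝ, I)`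
(`dim_ℂ = M`), the diagonal `η_i = h(c_i, c_i) = Ω(c_i, I c_i)` being `≠ 0` on a maximal non-degenerate family and `= 0` on
a basis of its orthogonal complement, on which `h ≡ 0`. These are the bases the proof of Lemma 5.2 starts from: "we fix
orthogonal decompositions into maximal positive, negative and null subspaces `V_ℝ = V₊ ⊕ V₋ ⊕ V₀` of `(V_ℝ, I₁)` with
respect to `h₁` […] choose an `h₁`-orthonormal basis `v₁, …, v_k` of the complex subpace `(V₊, I₁)` […], `−h₁`-orthonormal
[…] bases for the subspaces `V₋, W₋`, and some (arbitrary) bases for `(V₀, I₁)`" (normalisation `η_i ∈ {±1, 0}` is a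
rescaling `c_i ↦ |η_i|^{−1/2} c_i`, not performed here). In the block-basis vocabulary of the companion leaf
`HodgeLocusSignatureSurjective.lean`: `β` is a `2×2`-block basis of `Ω` (`Ω(e_i, e_j) = Ω(f_i, f_j) = 0`,
`Ω(e_i, f_j) = δ_ij η_i`) adapted to `I` with all signs `ε_i = +1` (`I e_i = f_i`, `I f_i = −e_i`).
[cite: BuskinIzadi2020TwistorLinesTori, v2 §5, proof of Lemma 5.2 (p.25 L13–24), with p.23 L20–30 (the hermitian form `h`
and its signature)] -/
theorem exists_adapted_orthogonal_basis [FiniteDimensional ℝ F] {I : F →L[ℝ] F} (hI : ∀ v, I (I v) = -v)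
    (Ω : F [⋀^Fin 2]→L[ℝ] ℝ) (hΩI : ∀ u v, Ω ![I u, I v] = Ω ![u, v]) :
    ∃ (M : ℕ) (c : Fin M → F) (β : Basis (Fin M ⊕ Fin M) ℝ F),
      (∀ i, β (.inl i) = c i) ∧ (∀ i, β (.inr i) = I (c i)) ∧
      ∀ i j, i ≠ j → Ω ![c i, c j] = 0 ∧ Ω ![c i, I (c j)] = 0 := by
  classical
  obtain ⟨k, c, horth, hη, hrem⟩ := exists_maximal_orthogonal_adapted_family hI Ω hΩI
  obtain ⟨W, hW⟩ := exists_orthogonalFamilyComplement Ω I c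
  have hWI : ∀ u ∈ W, I u ∈ W := fun u hu =>
    (hW _).mpr (map_mem_orthogonalFamilyComplement hI Ω hΩI ((hW u).mp hu))
  have hW0 : ∀ u ∈ W, Ω ![u, I u] = 0 := fun u hu => hrem u ((hW u).mp hu)
  have hWΩ : ∀ u ∈ W, ∀ v ∈ W, Ω ![u, I v] = 0 ∧ Ω ![u, v] = 0 := fun u hu v hv =>
    apply₂_eq_zero_of_forall_apply₂_self_map_eq_zero hI Ω hΩI hWI hW0 hu hv
  -- the restricted complex structure on `W` ("`(V₀, I₁)`") and an adapted basis of it ("some (arbitrary) bases")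
  let IW : W →L[ℝ] W := (I.comp W.subtypeL).codRestrict W (fun x => hWI x x.2)
  have hIW : ∀ x : W, (IW x : F) = I x := fun x => rfl
  have hIW2 : ∀ x, IW (IW x) = -x := fun x => by
    ext
    rw [hIW, hIW, hI, Submodule.coe_neg]
  obtain ⟨l, e, r, hr⟩ := exists_adapted_basis IW hIW2
  let d : Fin l → F := fun j => (e j : F)
  have hd : ∀ j i, Ω ![d j, c i] = 0 ∧ Ω ![d j, I (c i)] = 0 := fun j => (hW _).mp (e j).2
  -- the total family `c ⧺ d` and its `I`-images
  let ct : Fin (k + l) → F := Fin.append c d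
  let v : Fin (k + l) ⊕ Fin (k + l) → F := Sum.elim ct fun i => I (ct i)
  have horth' : ∀ i j, i ≠ j → Ω ![ct i, ct j] = 0 ∧ Ω ![ct i, I (ct j)] = 0 := by
    intro i j hij
    induction i using Fin.addCases with
    | left i =>
      induction j using Fin.addCases with
      | left j =>
        simp only [ct, Fin.append_left]
        exact horth i j fun h => hij (by rw [h])
      | right j =>
        simp only [ct, Fin.append_left, Fin.append_right]
        refine ⟨by rw [apply₂_swap, (hd j i).1, neg_zero], ?_⟩
        rw [apply₂_map_right_comm hI Ω hΩI]
        exact (hd j i).2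
    | right i =>
      induction j using Fin.addCases with
      | left j =>
        simp only [ct, Fin.append_left, Fin.append_right]
        exact hd i j
      | right j =>
        simp only [ct, Fin.append_right]
        exact ⟨(hWΩ _ (e i).2 _ (e j).2).2, (hWΩ _ (e i).2 _ (e j).2).1⟩
  -- every `u'` in `W` is a combination of the `d_j`, `I d_j`
  have hWspan : ∀ u' ∈ W, u' ∈ Submodule.span ℝ (Set.range v) := by
    intro u' hu'W
    have hrepr : u' = ∑ s, (r.repr ⟨u', hu'W⟩) s • (r s : F) := by
      have h := congrArg Subtype.val (r.sum_repr ⟨u', hu'W⟩)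
      simp only [Submodule.coe_sum, Submodule.coe_smul] at h
      exact h.symm
    rw [hrepr]
    refine Submodule.sum_mem _ fun s _ => Submodule.smul_mem _ _ (Submodule.subset_span ?_)
    obtain ⟨b, j⟩ := s
    cases b
    · exact ⟨.inl (Fin.natAdd k j), by simp [v, ct, d, hr]⟩
    · exact ⟨.inr (Fin.natAdd k j), by simp [v, ct, d, hr, hIW]⟩
  -- spanning: `u = Σ (a_i c_i + b_i I c_i) + u'`
  have hspan : Submodule.span ℝ (Set.range v) = ⊤ := by
    rw [eq_top_iff]
    intro u _
    obtain ⟨u', hu', hu⟩ := exists_orthogonal_decomposition hI Ω hΩI horth hη u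
    rw [hu]
    refine Submodule.add_mem _ (Submodule.sum_mem _ fun i _ => Submodule.add_mem _ ?_ ?_)
      (hWspan u' ((hW u').mpr hu'))
    · exact Submodule.smul_mem _ _ (Submodule.subset_span ⟨.inl (Fin.castAdd l i), by simp [v, ct]⟩)
    · exact Submodule.smul_mem _ _ (Submodule.subset_span ⟨.inr (Fin.castAdd l i), by simp [v, ct]⟩)
  -- dimension count `dim V_ℝ = 2(k + l)`: the family's span `P` (dimension `2k`) meets `W` (dimension `2l`) in `0`
  set P := Submodule.span ℝ (Set.range (Sum.elim c fun i => I (c i))) with hP_def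
  have hP : finrank ℝ P = 2 * k := by
    rw [hP_def, finrank_span_eq_card (linearIndependent_adapted_of_orthogonal hI Ω hΩI horth hη), Fintype.card_sum,
      Fintype.card_fin, two_mul]
  have hWd : finrank ℝ W = 2 * l := by
    rw [finrank_eq_card_basis r, Fintype.card_prod, Fintype.card_bool, Fintype.card_fin]
  have hinf : P ⊓ W = ⊥ := by
    rw [Submodule.eq_bot_iff]
    rintro x ⟨hxP, hxW⟩
    obtain ⟨g, rfl⟩ := (Submodule.mem_span_range_iff_exists_fun ℝ).mp hxP
    have hsum : ∑ s, g s • Sum.elim c (fun i => I (c i)) s = ∑ i, (g (.inl i) • c i + g (.inr i) • I (c i)) := by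
      rw [Fintype.sum_sum_type, Finset.sum_add_distrib]
      rfl
    rw [hsum] at hxW ⊢
    have hx := (hW _).mp hxW
    have key := fun j => apply₂_sum_adapted hI Ω hΩI horth (fun i => g (.inl i)) (fun i => g (.inr i)) j
    have ha : ∀ j, g (.inl j) = 0 := fun j => by
      have h := (key j).1
      rw [(hx j).2] at h
      exact (mul_eq_zero.mp h.symm).resolve_right (hη j)
    have hb : ∀ j, g (.inr j) = 0 := fun j => by
      have h := (key j).2
      rw [(hx j).1] at h
      have h' : g (.inr j) * Ω ![c j, I (c j)] = 0 := by linarith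
      exact (mul_eq_zero.mp h').resolve_right (hη j)
    simp [ha, hb]
  have hsup : P ⊔ W = ⊤ := by
    rw [eq_top_iff]
    intro u _
    obtain ⟨u', hu', hu⟩ := exists_orthogonal_decomposition hI Ω hΩI horth hη u
    rw [hu]
    refine Submodule.add_mem_sup (Submodule.sum_mem _ fun i _ => Submodule.add_mem _ ?_ ?_) ((hW u').mpr hu')
    · exact Submodule.smul_mem _ _ (Submodule.subset_span ⟨.inl i, rfl⟩)
    · exact Submodule.smul_mem _ _ (Submodule.subset_span ⟨.inr i, rfl⟩)
  have hdim : finrank ℝ F = 2 * (k + l) := by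
    have h := Submodule.finrank_sup_add_finrank_inf_eq P W
    rw [hinf, hsup, finrank_bot, finrank_top, hP, hWd] at h
    omega
  -- independence by counting, and the basis
  have hli : LinearIndependent ℝ v := by
    rw [linearIndependent_iff_card_eq_finrank_span, Set.finrank, hspan, finrank_top, hdim, Fintype.card_sum,
      Fintype.card_fin, two_mul]
  refine ⟨k + l, ct, Basis.mk hli hspan.ge, fun i => ?_, fun i => ?_, horth'⟩
  · rw [Basis.mk_apply]; rfl
  · rw [Basis.mk_apply]; rfl

/-- **The same as a `2×2`-block basis of `Ω` adapted to `I`** (the hypothesis shape of the companion leaf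
`HodgeLocusSignatureSurjective.lean`, §2–§3, with all signs `ε_i = 1` and block values `κ_i = η_i = h(c_i, c_i)`):
`Ω(e_i, e_j) = Ω(f_i, f_j) = 0`, `Ω(e_i, f_j) = δ_ij η_i`, `I e_i = f_i`, `I f_i = −e_i` for `e_i = β(inl i) = c_i`,
`f_i = β(inr i) = I c_i` — so that, for EVERY `I ∈ Compl_Ω`, `h(u, u) = Σ_i η_i (x_i² + y_i²)` in these coordinates and the
indices `n₊`, `n₋`, `n₀` of `h` are the numbers of `η_i > 0`, `< 0`, `= 0` (there). [cite: BuskinIzadi2020TwistorLinesTori,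
v2 §5 (p.23 L20–30), proof of Lemma 5.2 (p.25 L13–24)] -/
theorem exists_adapted_blockBasis [FiniteDimensional ℝ F] {I : F →L[ℝ] F} (hI : ∀ v, I (I v) = -v)
    (Ω : F [⋀^Fin 2]→L[ℝ] ℝ) (hΩI : ∀ u v, Ω ![I u, I v] = Ω ![u, v]) :
    ∃ (M : ℕ) (β : Basis (Fin M ⊕ Fin M) ℝ F) (η : Fin M → ℝ),
      (∀ i j, Ω ![β (.inl i), β (.inl j)] = 0) ∧ (∀ i j, Ω ![β (.inr i), β (.inr j)] = 0) ∧
      (∀ i j, Ω ![β (.inl i), β (.inr j)] = if i = j then η i else 0) ∧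
      (∀ i, I (β (.inl i)) = (1 : ℝ) • β (.inr i)) ∧ ∀ i, I (β (.inr i)) = -((1 : ℝ) • β (.inl i)) := by
  obtain ⟨M, c, β, hβl, hβr, horth⟩ := exists_adapted_orthogonal_basis hI Ω hΩI
  have hcc : ∀ i, Ω ![c i, c i] = 0 := fun i => by
    have h := apply₂_swap Ω (c i) (c i); linarith
  refine ⟨M, β, fun i => Ω ![c i, I (c i)], fun i j => ?_, fun i j => ?_, fun i j => ?_, fun i => ?_, fun i => ?_⟩
  · rw [hβl, hβl]
    by_cases h : i = j
    · subst h; exact hcc i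
    · exact (horth i j h).1
  · rw [hβr, hβr, hΩI]
    by_cases h : i = j
    · subst h; exact hcc i
    · exact (horth i j h).1
  · rw [hβl, hβr]
    by_cases h : i = j
    · subst h; simp
    · rw [if_neg h]; exact (horth i j h).2
  · rw [hβl, hβr, one_smul]
  · rw [hβl, hβr, one_smul, hI]

/-- **`h`-ORTHONORMAL adapted bases** ("an `h₁`-orthonormal basis … of `(V₊, I₁)`", "`−h₁`-orthonormal … bases for the
subspaces `V₋`", "some (arbitrary) bases for `(V₀, I₁)`"): rescaling `c_i ↦ |η_i|^{−1/2} c_i` on the non-degenerate vectors,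
every `I ∈ Compl_Ω` admits an `h`-orthogonal `I`-adapted basis `(c_i, I c_i)` with `h(c_i, c_i) = Ω(c_i, I c_i) ∈ {1, −1, 0}`.
[cite: BuskinIzadi2020TwistorLinesTori, v2 §5, proof of Lemma 5.2 (p.25 L16–24)] -/
theorem exists_adapted_orthonormal_basis [FiniteDimensional ℝ F] {I : F →L[ℝ] F} (hI : ∀ v, I (I v) = -v)
    (Ω : F [⋀^Fin 2]→L[ℝ] ℝ) (hΩI : ∀ u v, Ω ![I u, I v] = Ω ![u, v]) :
    ∃ (M : ℕ) (c : Fin M → F) (β : Basis (Fin M ⊕ Fin M) ℝ F),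
      (∀ i, β (.inl i) = c i) ∧ (∀ i, β (.inr i) = I (c i)) ∧
      (∀ i j, i ≠ j → Ω ![c i, c j] = 0 ∧ Ω ![c i, I (c j)] = 0) ∧
      ∀ i, Ω ![c i, I (c i)] = 1 ∨ Ω ![c i, I (c i)] = -1 ∨ Ω ![c i, I (c i)] = 0 := by
  classical
  obtain ⟨M, c, β, hβl, hβr, horth⟩ := exists_adapted_orthogonal_basis hI Ω hΩI
  -- the scaling factors `t_i = |η_i|^{-1/2}` (`1` on null vectors)
  let η : Fin M → ℝ := fun i => Ω ![c i, I (c i)]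
  let t : Fin M → ℝ := fun i => if η i = 0 then 1 else (Real.sqrt |η i|)⁻¹
  have ht : ∀ i, t i ≠ 0 := fun i => by
    by_cases h : η i = 0
    · simp [t, h]
    · simp only [t, if_neg h, ne_eq, inv_eq_zero]
      exact (Real.sqrt_pos.mpr (abs_pos.mpr h)).ne'
  have ht2 : ∀ i, η i ≠ 0 → t i ^ 2 * η i = η i / |η i| := fun i h => by
    simp only [t, if_neg h, inv_pow, Real.sq_sqrt (abs_nonneg _)]
    rw [div_eq_inv_mul]
  let w : Fin M ⊕ Fin M → ℝˣ := fun x => Sum.elim (fun i => Units.mk0 (t i) (ht i)) (fun i => Units.mk0 (t i) (ht i)) x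
  let β' := β.unitsSMul w
  refine ⟨M, fun i => t i • c i, β', fun i => ?_, fun i => ?_, fun i j hij => ⟨?_, ?_⟩, fun i => ?_⟩
  · simp [β', w, Basis.unitsSMul_apply, hβl, Units.smul_def]
  · simp [β', w, Basis.unitsSMul_apply, hβr, Units.smul_def, map_smul]
  · rw [apply₂_smul_left, apply₂_smul_right, (horth i j hij).1, smul_zero, smul_zero]
  · rw [map_smul, apply₂_smul_left, apply₂_smul_right, (horth i j hij).2, smul_zero, smul_zero]
  · rw [map_smul, apply₂_smul_left, apply₂_smul_right, smul_eq_mul, smul_eq_mul, ← mul_assoc, ← sq]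
    change t i ^ 2 * η i = 1 ∨ t i ^ 2 * η i = -1 ∨ t i ^ 2 * η i = 0
    rcases lt_trichotomy (η i) 0 with h | h | h
    · right; left
      rw [ht2 i h.ne, abs_of_neg h, div_neg, div_self h.ne]
    · right; right
      rw [h, mul_zero]
    · left
      rw [ht2 i h.ne', abs_of_pos h, div_self h.ne']

end Literature.Geometry.Hyperkaehler.HodgeLocus

/-!
## Part E — standalone draft `HodgeLocusEqualSignatureConjugate.v1` (sha256∕16 182f2369227657b2; never elaborated as a separate module,
since it imported Parts A, B, D as modules — it is elaborated here), reproduced verbatim below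
(its module docstring first: references to "this file" ∕ "this leaf" mean this Part; items it lists as
"NOT here" may be supplied by other Parts — see the file header; then its code, byte-identical).

# [BI20] Lemma 5.2 assembled (pointwise): `I₁, I₂ ∈ Compl_Ω` with the same signature are conjugate under `G_Ω`

[BI20] = Buskin–Izadi, *Twistor lines in the period domain of complex tori*, arXiv:1806.07831v2, §5 ("v2 p.N Lm" = PDF
page N, text-layer line m of the v2 PDF, the lineage's dump `widen/LIT-W/texts-verbitsky/bi20v2/dump/`; arXiv v1 has
no §5). Lemma 5.2 (v2 p.24 L33–36): "The group `G⁰_Ω` acts transitively on each fiber of `Sign`. In particular, `S̃ign`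
is injective." Its proof (p.25 L10–27): "Let `I₁, I₂` be periods in `Compl±_Ω`. Assume that `Sign(I₁) = Sign(I₂)`,
that is, the associated hermitian forms `h₁` on `(V_ℝ, I₁)` and `h₂` on `(V_ℝ, I₂)` have the same signature `(k, l, m)`.
First we fix orthogonal decompositions into maximal positive, negative and null subspaces `V_ℝ = V₊ ⊕ V₋ ⊕ V₀` of
`(V_ℝ, I₁)` with respect to `h₁` and `V_ℝ = W₊ ⊕ W₋ ⊕ V₀` of `(V_ℝ, I₂)` with respect to `h₂` […]. Let us choose an
`h₁`-orthonormal basis `v₁, …, v_k` of the complex subpace `(V₊, I₁)` and an `h₂`-orthonormal basis `w₁, …, w_k` of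
the complex subpace `(W₊, I₂)`, similarly choose `−h₁`-orthonormal and `−h₂`-orthonormal bases for the subspaces
`V₋, W₋`, and some (arbitrary) bases for `(V₀, I₁)` and `(V₀, I₂)`. Then we define `g ∈ G = GL(V_ℝ)` by setting
`g(v₁) = w₁, g(I₁v₁) = I₂w₁, g(v₂) = w₂, g(I₁v₂) = I₂w₂, …, g(v_k) = w_k, g(I₁v_k) = I₂w_k`, and similarly for the
remaining pairs of subspaces. Then we get `g ∈ G` such that `g*h₂ = h₁` and `I₂ = gI₁g⁻¹`, which is equivalent to
saying that `g*Ω = Ω` and `I₂ = gI₁g⁻¹ = ᵍI₁`. This implies that `g ∈ G_Ω`".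

This leaf ASSEMBLES the three ingredients the lineage has filed separately into the printed conclusion at the level of
`G_Ω` (the `G⁰_Ω`-refinement, p.25 L27–33, uses connectedness in `Compl` and is not formalised):
* the `h`-orthonormal `I`-adapted bases of `HodgeLocusAdaptedOrthogonalBasis.lean` (`exists_adapted_orthonormal_basis`);
* the signature counts of `HodgeLocusSignatureSurjective.lean` (`sigPos_eq_of_maximal`, `finrank_le_of_apply₂_self_map_pos`,
  … on a `2 × 2`-block basis), giving here `sigPos_sigNeg_eq_card_of_adapted_basis`: in such a basis
  `sigPos q_I = 2 · #{i : h(c_i, c_i) > 0}`, `sigNeg q_I = 2 · #{i : h(c_i, c_i) < 0}` for the real quadratic form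
  `q_I(u) = h(u, u) = Ω(u, Iu)` (Mathlib's Sylvester indices);
* the basis-to-basis conjugation of `HodgeLocusTwistorLineSignature.lean` (`exists_conj_invariant_of_matchedBases`),
  after matching the two sign tables by a permutation of the index set (`Equiv.ofFiberEquiv`);
into **`exists_conj_invariant_of_sigPos_eq`**: `sigPos q₁ = sigPos q₂ ∧ sigNeg q₁ = sigNeg q₂ ⇒ ∃ g : V_ℝ ≃L V_ℝ`,
`g I₁ = I₂ g ∧ Ω(g·, g·) = Ω`; with the easy converse `sigPos_eq_of_conj_invariant` (such a `g` is an isometry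
`q₁ ≅ q₂`, `QuadraticMap.Equivalent.sigPos_eq`) the equivalence **`exists_conj_invariant_iff_sigPos_eq`**. Together with
`HodgeLocusSignatureSurjective.lean` (Lemma 5.3: every signature occurs) and `HodgeLocusSignatureLocallyConstant.lean`
(Prop. 5.1) this is the linear algebra of Thm. 5.4's first sentence (p.24 L54–60: "The mapping
`S̃ign : π₀Compl±_Ω → S_Ω` is a bijection […]") minus the identification of `Sign`-fibers with connected components.

Nothing here says HC ∕ HC_CM ∕ HC_AV is proved, or that any object of the cell is hyperholomorphic, rotable or carries a
twistor line; the statements are finite-dimensional linear algebra.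

## References
* [BuskinIzadi2020TwistorLinesTori] N. Buskin, E. Izadi, *Twistor lines in the period domain of complex tori*,
  arXiv:1806.07831v2 (2020) = Geom. Dedicata 213 (2021) 21–47 (journal pages unseen by the cell), §5 Lemma 5.2
  (v2 p.24 L33–36), its proof (p.25 L10–34), Thm. 5.4 (p.24 L54–74).
-/

namespace Literature.Geometry.Hyperkaehler.HodgeLocus

open Literature.Geometry.Hyperkaehler.TwistorLine (apply₂_map_left apply₂_map_right_comm)

variable {F : Type*} [NormedAddCommGroup F] [NormedSpace ℝ F]

/-! ### Lemma 5.2 assembled: `Sign(I₁) = Sign(I₂) ⇒ ∃ g ∈ G_Ω, g I₁ g⁻¹ = I₂` -/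

/-- **The signature read off an `h`-orthonormal adapted basis**: for `I ∈ Compl_Ω` and an `I`-adapted `h`-orthogonal
basis `(c_i, I c_i)`, `sigPos q_I = 2 · #{i : h(c_i, c_i) > 0}` and `sigNeg q_I = 2 · #{i : h(c_i, c_i) < 0}`.
[cite: BuskinIzadi2020TwistorLinesTori, v2 §5 (p.23 L26–30; proof of Lemma 5.2 p.25 L13–24)] -/
theorem sigPos_sigNeg_eq_card_of_adapted_basis [FiniteDimensional ℝ F] {I : F →L[ℝ] F} (hI : ∀ v, I (I v) = -v)
    (Ω : F [⋀^Fin 2]→L[ℝ] ℝ) (hΩI : ∀ u v, Ω ![I u, I v] = Ω ![u, v]) {M : ℕ} (c : Fin M → F)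
    (β : Basis (Fin M ⊕ Fin M) ℝ F) (hβl : ∀ i, β (.inl i) = c i) (hβr : ∀ i, β (.inr i) = I (c i))
    (horth : ∀ i j, i ≠ j → Ω ![c i, c j] = 0 ∧ Ω ![c i, I (c j)] = 0)
    {q : QuadraticForm ℝ F} (hq : ∀ u, q u = Ω ![u, I u]) :
    sigPos q = 2 * (Finset.univ.filter fun i => 0 < Ω ![c i, I (c i)]).card ∧
      sigNeg q = 2 * (Finset.univ.filter fun i => Ω ![c i, I (c i)] < 0).card := by
  classical
  -- the block tables of `β` (ε ≡ 1, κ_i = η_i = h(c_i, c_i))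
  have hcc : ∀ i, Ω ![c i, c i] = 0 := fun i => by
    have h := apply₂_swap Ω (c i) (c i); linarith
  have hee : ∀ i j, Ω ![β (.inl i), β (.inl j)] = 0 := fun i j => by
    rw [hβl, hβl]
    by_cases h : i = j
    · subst h; exact hcc i
    · exact (horth i j h).1
  have hff : ∀ i j, Ω ![β (.inr i), β (.inr j)] = 0 := fun i j => by
    rw [hβr, hβr, hΩI]
    by_cases h : i = j
    · subst h; exact hcc i
    · exact (horth i j h).1
  have hef : ∀ i j, Ω ![β (.inl i), β (.inr j)] = if i = j then Ω ![c i, I (c i)] else 0 := fun i j => by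
    rw [hβl, hβr]
    by_cases h : i = j
    · subst h; simp
    · rw [if_neg h]; exact (horth i j h).2
  have hIe : ∀ i, I (β (.inl i)) = (1 : ℝ) • β (.inr i) := fun i => by rw [hβl, hβr, one_smul]
  have hIf : ∀ i, I (β (.inr i)) = -((1 : ℝ) • β (.inl i)) := fun i => by rw [hβl, hβr, one_smul, hI]
  set Sp : Finset (Fin M) := Finset.univ.filter fun i => 0 < Ω ![c i, I (c i)] with hSp
  set Sn : Finset (Fin M) := Finset.univ.filter fun i => Ω ![c i, I (c i)] < 0 with hSn
  constructor
  · refine sigPos_eq_of_maximal hq ⟨_, finrank_span_blocks β Sp, fun u hu hu0 => ?_⟩ fun P hP => ?_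
    · exact apply₂_self_map_pos_of_mem_span_blocks β Ω hee hff hef hIe hIf Sp
        (fun k hk => by rw [one_mul]; exact (Finset.mem_filter.mp hk).2) hu hu0
    · exact finrank_le_of_apply₂_self_map_pos β Ω hee hff hef hIe hIf Sp
        (fun k hk => by
          rw [one_mul]; exact not_lt.mp fun h => hk (Finset.mem_filter.mpr ⟨Finset.mem_univ _, h⟩)) hP
  · refine sigNeg_eq_of_maximal hq ⟨_, finrank_span_blocks β Sn, fun u hu hu0 => ?_⟩ fun Q hQ => ?_
    · exact apply₂_self_map_neg_of_mem_span_blocks β Ω hee hff hef hIe hIf Sn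
        (fun k hk => by rw [one_mul]; exact (Finset.mem_filter.mp hk).2) hu hu0
    · exact finrank_le_of_apply₂_self_map_neg β Ω hee hff hef hIe hIf Sn
        (fun k hk => by
          rw [one_mul]; exact not_lt.mp fun h => hk (Finset.mem_filter.mpr ⟨Finset.mem_univ _, h⟩)) hQ

/-- A permutation matching two `{1, −1, 0}`-valued tables with the same numbers of positive and of negative entries.
[folklore] -/
private theorem exists_perm_eq_comp {M : ℕ} (η₁ η₂ : Fin M → ℝ)
    (h₁ : ∀ i, η₁ i = 1 ∨ η₁ i = -1 ∨ η₁ i = 0) (h₂ : ∀ i, η₂ i = 1 ∨ η₂ i = -1 ∨ η₂ i = 0)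
    (hpos : (Finset.univ.filter fun i => 0 < η₁ i).card = (Finset.univ.filter fun i => 0 < η₂ i).card)
    (hneg : (Finset.univ.filter fun i => η₁ i < 0).card = (Finset.univ.filter fun i => η₂ i < 0).card) :
    ∃ σ : Fin M ≃ Fin M, ∀ i, η₂ (σ i) = η₁ i := by
  classical
  -- fibre cardinalities agree over every value
  have hzero : (Finset.univ.filter fun i => η₁ i = 0).card = (Finset.univ.filter fun i => η₂ i = 0).card := by
    have t : ∀ (η : Fin M → ℝ), (Finset.univ.filter fun i => 0 < η i).card +
        (Finset.univ.filter fun i => η i < 0).card + (Finset.univ.filter fun i => η i = 0).card =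
        (Finset.univ : Finset (Fin M)).card := by
      intro η
      rw [Finset.card_filter, Finset.card_filter, Finset.card_filter, ← Finset.sum_add_distrib,
        ← Finset.sum_add_distrib, Finset.card_eq_sum_ones]
      refine Finset.sum_congr rfl fun i _ => ?_
      rcases lt_trichotomy (η i) 0 with h | h | h
      · simp [h, h.ne, not_lt.mpr h.le]
      · simp [h]
      · simp [h, h.ne', not_lt.mpr h.le]
    have := t η₁; have := t η₂; omega
  have hfib : ∀ v : ℝ, Fintype.card {i // η₁ i = v} = Fintype.card {i // η₂ i = v} := by
    intro v
    rw [Fintype.card_subtype, Fintype.card_subtype]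
    by_cases hv1 : v = 1
    · subst hv1
      convert hpos using 2 <;> ext i <;> simp only [Finset.mem_filter, Finset.mem_univ, true_and]
      · rcases h₁ i with h | h | h <;> rw [h] <;> norm_num
      · rcases h₂ i with h | h | h <;> rw [h] <;> norm_num
    by_cases hv2 : v = -1
    · subst hv2
      convert hneg using 2 <;> ext i <;> simp only [Finset.mem_filter, Finset.mem_univ, true_and]
      · rcases h₁ i with h | h | h <;> rw [h] <;> norm_num
      · rcases h₂ i with h | h | h <;> rw [h] <;> norm_num
    by_cases hv0 : v = 0
    · subst hv0; exact hzero
    · rw [Finset.card_eq_zero.mpr, Finset.card_eq_zero.mpr]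
      · refine Finset.filter_eq_empty_iff.mpr fun i _ h => ?_
        rcases h₂ i with e | e | e <;> rw [e] at h
        · exact hv1 h.symm
        · exact hv2 h.symm
        · exact hv0 h.symm
      · refine Finset.filter_eq_empty_iff.mpr fun i _ h => ?_
        rcases h₁ i with e | e | e <;> rw [e] at h
        · exact hv1 h.symm
        · exact hv2 h.symm
        · exact hv0 h.symm
  exact ⟨Equiv.ofFiberEquiv (f := η₁) (g := η₂) fun v => Fintype.equivOfCardEq (hfib v),
    fun i => Equiv.ofFiberEquiv_map _ i⟩

/-- The alternating `2`-covector `Ω` as a continuous bilinear map (finite dimension). [folklore] -/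
private theorem exists_continuousBilin [FiniteDimensional ℝ F] (Ω : F [⋀^Fin 2]→L[ℝ] ℝ) :
    ∃ B : F →L[ℝ] F →L[ℝ] ℝ, ∀ u v, B u v = Ω ![u, v] :=
  ⟨LinearMap.toContinuousLinearMap
    ((LinearMap.toContinuousLinearMap : (F →ₗ[ℝ] ℝ) ≃ₗ[ℝ] (F →L[ℝ] ℝ)).toLinearMap ∘ₗ
      LinearMap.mk₂ ℝ (fun u v => Ω ![u, v]) (apply₂_add_left Ω) (apply₂_smul_left Ω) (apply₂_add_right Ω)
        (apply₂_smul_right Ω)), fun _ _ => rfl⟩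

/-- **[BI20] Lemma 5.2, pointwise, assembled: equal signatures ⇒ conjugate under `G_Ω`.** Let `Ω` be a real `2`-covector
on `V_ℝ` and `I₁, I₂ ∈ Compl_Ω` (`I_m² = −1`, `Ω(I_m·, I_m·) = Ω`). If the hermitian forms `h₁`, `h₂` have the same
signature — read through Mathlib's Sylvester indices of the real quadratic forms `q_m(u) = h_m(u, u) = Ω(u, I_m u)`:
`sigPos q₁ = sigPos q₂` and `sigNeg q₁ = sigNeg q₂` — then there is `g ∈ G_Ω` (`Ω(g·, g·) = Ω`) with `g I₁ = I₂ g`,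
i.e. `I₂ = g I₁ g⁻¹`. Proof as printed (p.25 L13–27): `h_m`-orthonormal `I_m`-adapted bases
(`exists_adapted_orthonormal_basis`), their signs matched by a permutation (the counts are `Sign`,
`sigPos_sigNeg_eq_card_of_adapted_basis`), and `g` = the basis-to-basis map (`exists_conj_invariant_of_matchedBases`):
"Then we get `g ∈ G` such that `g*h₂ = h₁` and `I₂ = gI₁g⁻¹`, which is equivalent to saying that `g*Ω = Ω` and
`I₂ = gI₁g⁻¹ = ᵍI₁`. This implies that `g ∈ G_Ω`" (p.25 L25–27). Lemma 5.2 itself (p.24 L33–36: "The group `G⁰_Ω` acts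
transitively on each fiber of `Sign`. In particular, `S̃ign` is injective.") is the `G⁰_Ω`-refinement (p.25 L27–33),
which is NOT formalised here. [cite: BuskinIzadi2020TwistorLinesTori, v2 §5 Lemma 5.2 (p.24 L33–36) and its proof (p.25 L10–27)] -/
theorem exists_conj_invariant_of_sigPos_eq [FiniteDimensional ℝ F] (Ω : F [⋀^Fin 2]→L[ℝ] ℝ) {I₁ I₂ : F →L[ℝ] F}
    (hI₁ : ∀ v, I₁ (I₁ v) = -v) (hI₂ : ∀ v, I₂ (I₂ v) = -v) (hΩ₁ : ∀ u v, Ω ![I₁ u, I₁ v] = Ω ![u, v])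
    (hΩ₂ : ∀ u v, Ω ![I₂ u, I₂ v] = Ω ![u, v]) {q₁ q₂ : QuadraticForm ℝ F} (hq₁ : ∀ u, q₁ u = Ω ![u, I₁ u])
    (hq₂ : ∀ u, q₂ u = Ω ![u, I₂ u]) (hpos : sigPos q₁ = sigPos q₂) (hneg : sigNeg q₁ = sigNeg q₂) :
    ∃ g : F ≃L[ℝ] F, (∀ v, g (I₁ v) = I₂ (g v)) ∧ ∀ u v, Ω ![g u, g v] = Ω ![u, v] := by
  classical
  obtain ⟨M₁, c₁, β₁, hβl₁, hβr₁, horth₁, hη₁⟩ := exists_adapted_orthonormal_basis hI₁ Ω hΩ₁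
  obtain ⟨M₂, c₂, β₂, hβl₂, hβr₂, horth₂, hη₂⟩ := exists_adapted_orthonormal_basis hI₂ Ω hΩ₂
  -- same number of pairs
  have hM : M₁ = M₂ := by
    have h1 := Module.finrank_eq_card_basis β₁
    have h2 := Module.finrank_eq_card_basis β₂
    simp only [Fintype.card_sum, Fintype.card_fin] at h1 h2
    omega
  subst hM
  -- the signs, and their counts
  obtain ⟨hp₁, hn₁⟩ := sigPos_sigNeg_eq_card_of_adapted_basis hI₁ Ω hΩ₁ c₁ β₁ hβl₁ hβr₁ horth₁ hq₁
  obtain ⟨hp₂, hn₂⟩ := sigPos_sigNeg_eq_card_of_adapted_basis hI₂ Ω hΩ₂ c₂ β₂ hβl₂ hβr₂ horth₂ hq₂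
  obtain ⟨σ, hσ⟩ := exists_perm_eq_comp (fun i => Ω ![c₁ i, I₁ (c₁ i)]) (fun i => Ω ![c₂ i, I₂ (c₂ i)]) hη₁ hη₂
    (by have := hpos; rw [hp₁, hp₂] at this; omega) (by have := hneg; rw [hn₁, hn₂] at this; omega)
  -- the matched bases, indexed by `Bool × Fin M₁` as in `exists_conj_invariant_of_matchedBases`
  let e : Fin M₁ ⊕ Fin M₁ ≃ Bool × Fin M₁ := (Equiv.boolProdEquivSum (Fin M₁)).symm
  let r₁ : Basis (Bool × Fin M₁) ℝ F := β₁.reindex e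
  let r₂ : Basis (Bool × Fin M₁) ℝ F := (β₂.reindex (Equiv.sumCongr σ.symm σ.symm)).reindex e
  have hr₁ : ∀ b i, r₁ (b, i) = bif b then I₁ (c₁ i) else c₁ i := by
    rintro (_ | _) i
    · change (β₁.reindex e) (false, i) = c₁ i
      rw [Basis.reindex_apply]; exact hβl₁ i
    · change (β₁.reindex e) (true, i) = I₁ (c₁ i)
      rw [Basis.reindex_apply]; exact hβr₁ i
  have hr₂ : ∀ b i, r₂ (b, i) = bif b then I₂ ((c₂ ∘ σ) i) else (c₂ ∘ σ) i := by
    rintro (_ | _) i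
    · change ((β₂.reindex _).reindex e) (false, i) = c₂ (σ i)
      rw [Basis.reindex_apply, Basis.reindex_apply]
      exact (congrArg β₂ (by simp [e])).trans (hβl₂ (σ i))
    · change ((β₂.reindex _).reindex e) (true, i) = I₂ (c₂ (σ i))
      rw [Basis.reindex_apply, Basis.reindex_apply]
      exact (congrArg β₂ (by simp [e])).trans (hβr₂ (σ i))
  -- `Ω` as a bilinear map and the matching of the two tables
  obtain ⟨B, hB⟩ := exists_continuousBilin Ω
  have hcc : ∀ (I : F →L[ℝ] F) (c : Fin M₁ → F) (i : Fin M₁), Ω ![c i, c i] = 0 := fun I c i => by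
    have h := apply₂_swap Ω (c i) (c i); linarith
  -- the four table entries, for a general adapted orthogonal family
  have table : ∀ {I : F →L[ℝ] F} (hI : ∀ v, I (I v) = -v) (hΩI : ∀ u v, Ω ![I u, I v] = Ω ![u, v])
      (c : Fin M₁ → F) (horth : ∀ i j, i ≠ j → Ω ![c i, c j] = 0 ∧ Ω ![c i, I (c j)] = 0) (b b' : Bool)
      (i j : Fin M₁),
      Ω ![bif b then I (c i) else c i, bif b' then I (c j) else c j] =
        if i = j then (bif b then (bif b' then 0 else -Ω ![c i, I (c i)]) else (bif b' then Ω ![c i, I (c i)] else 0))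
        else 0 := by
    intro I hI hΩI c horth b b' i j
    by_cases hij : i = j
    · subst hij
      rw [if_pos rfl]
      cases b <;> cases b' <;> simp only [cond_true, cond_false]
      · exact hcc I c i
      · rw [apply₂_map_left hI Ω hΩI]
      · rw [hΩI]; exact hcc I c i
    · rw [if_neg hij]
      cases b <;> cases b' <;> simp only [cond_true, cond_false]
      · exact (horth i j hij).1
      · exact (horth i j hij).2
      · rw [apply₂_map_left hI Ω hΩI, (horth i j hij).2, neg_zero]
      · rw [hΩI]; exact (horth i j hij).1
  have horth₂' : ∀ i j, i ≠ j → Ω ![(c₂ ∘ σ) i, (c₂ ∘ σ) j] = 0 ∧ Ω ![(c₂ ∘ σ) i, I₂ ((c₂ ∘ σ) j)] = 0 :=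
    fun i j hij => horth₂ (σ i) (σ j) fun h => hij (σ.injective h)
  have htable : ∀ x y : Bool × Fin M₁, B (r₁ x) (r₁ y) = B (r₂ x) (r₂ y) := by
    rintro ⟨b, i⟩ ⟨b', j⟩
    rw [hB, hB, hr₁, hr₁, hr₂, hr₂, table hI₁ hΩ₁ c₁ horth₁, table hI₂ hΩ₂ (c₂ ∘ σ) horth₂']
    simp only [Function.comp_apply, hσ]
  obtain ⟨g, hgI, hgΩ, -⟩ :=
    exists_conj_invariant_of_matchedBases hI₁ hI₂ (Ω := B) c₁ (c₂ ∘ σ) r₁ r₂ hr₁ hr₂ htable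
  exact ⟨g, hgI, fun u v => by rw [← hB, ← hB]; exact hgΩ u v⟩

/-- **The converse half of Lemma 5.2 (the easy direction, implicit in print: `Sign` is `G_Ω`-invariant).** If
`g ∈ G_Ω` conjugates `I₁` to `I₂` (`g I₁ = I₂ g`, `Ω(g·, g·) = Ω`), then `g` is an isometry `q₁ ≅ q₂` of the real
quadratic forms `q_m(u) = Ω(u, I_m u)`, so the Sylvester indices agree. [cite: BuskinIzadi2020TwistorLinesTori, v2 §5 Lemma 5.2 (p.24 L33–36; proof p.25 L25–26: "g ∈ G such that g*h₂ = h₁ and I₂ = gI₁g⁻¹, which is equivalent to saying that g*Ω = Ω and I₂ = gI₁g⁻¹")] -/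
theorem sigPos_eq_of_conj_invariant (Ω : F [⋀^Fin 2]→L[ℝ] ℝ) {I₁ I₂ : F →L[ℝ] F} (g : F ≃L[ℝ] F)
    (hgI : ∀ v, g (I₁ v) = I₂ (g v)) (hgΩ : ∀ u v, Ω ![g u, g v] = Ω ![u, v]) {q₁ q₂ : QuadraticForm ℝ F}
    (hq₁ : ∀ u, q₁ u = Ω ![u, I₁ u]) (hq₂ : ∀ u, q₂ u = Ω ![u, I₂ u]) :
    sigPos q₁ = sigPos q₂ ∧ sigNeg q₁ = sigNeg q₂ := by
  have e : q₁.IsometryEquiv q₂ :=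
    { g.toLinearEquiv with
      map_app' := fun m => by
        change q₂ (g m) = q₁ m
        rw [hq₁, hq₂, ← hgI, hgΩ] }
  exact ⟨QuadraticMap.Equivalent.sigPos_eq ⟨e⟩, QuadraticMap.Equivalent.sigNeg_eq ⟨e⟩⟩

/-- **[BI20] Lemma 5.2, pointwise, as an equivalence**: for `I₁, I₂ ∈ Compl_Ω`, a `g ∈ G_Ω` with `I₂ = g I₁ g⁻¹`
exists iff the hermitian forms `h₁`, `h₂` have the same signature (`sigPos`, `sigNeg` of `q₁`, `q₂` agree; `n₀` is
`dim V₀` for both) — the fibers of `Sign` are the `G_Ω`-orbits in `Compl_Ω` (the refinement to the connected subgroup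
`G⁰_Ω`, p.25 L27–33, is not formalised here). [cite: BuskinIzadi2020TwistorLinesTori, v2 §5 Lemma 5.2 (p.24 L33–36) and its proof (p.25 L10–27)] -/
theorem exists_conj_invariant_iff_sigPos_eq [FiniteDimensional ℝ F] (Ω : F [⋀^Fin 2]→L[ℝ] ℝ) {I₁ I₂ : F →L[ℝ] F}
    (hI₁ : ∀ v, I₁ (I₁ v) = -v) (hI₂ : ∀ v, I₂ (I₂ v) = -v) (hΩ₁ : ∀ u v, Ω ![I₁ u, I₁ v] = Ω ![u, v])
    (hΩ₂ : ∀ u v, Ω ![I₂ u, I₂ v] = Ω ![u, v]) {q₁ q₂ : QuadraticForm ℝ F} (hq₁ : ∀ u, q₁ u = Ω ![u, I₁ u])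
    (hq₂ : ∀ u, q₂ u = Ω ![u, I₂ u]) :
    (∃ g : F ≃L[ℝ] F, (∀ v, g (I₁ v) = I₂ (g v)) ∧ ∀ u v, Ω ![g u, g v] = Ω ![u, v]) ↔
      sigPos q₁ = sigPos q₂ ∧ sigNeg q₁ = sigNeg q₂ :=
  ⟨fun ⟨g, hgI, hgΩ⟩ => sigPos_eq_of_conj_invariant Ω g hgI hgΩ hq₁ hq₂,
    fun ⟨hpos, hneg⟩ => exists_conj_invariant_of_sigPos_eq Ω hI₁ hI₂ hΩ₁ hΩ₂ hq₁ hq₂ hpos hneg⟩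

end Literature.Geometry.Hyperkaehler.HodgeLocus

/-!
## Part F — [BI20] Theorem 5.4, FIRST SENTENCE, at the level of `G_Ω`-orbits: `S̃ign` is a bijection `Compl_Ω ∕ G_Ω ≅ S_Ω`
## (written for this consolidated file by lit-w-verbitsky g17, 2026-08-26; not one of the standalone drafts)

[BI20] v2 p.24 L6–16: "We set `Compl±_Ω := Compl_Ω ∩ Compl±`. Consider the finite set
`S_Ω := {(k, l, n₀) | k, l ∈ ℤ_{⩾0}, k + l + n₀ = 2n}` consisting of `2n − n₀ + 1` triples, and the mapping
`Sign : Compl±_Ω → S_Ω`, `I ↦` the signature `(n₊, n₋, n₀)` of `h` assoc. to `Ω` and `I`."; p.24 L25–30: "Proposition 5.1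
allows us to define the induced mapping `S̃ign : π₀Compl±_Ω → S_Ω` on the set `π₀Compl±_Ω` of connected components of
`Compl±_Ω`."; p.24 L54–60, **Theorem 5.4** (first sentence): "The mapping `S̃ign : π₀Compl±_Ω → S_Ω` is a bijection, thus
there are `2n + 1 − n₀` connected components of `Compl±_Ω` and they have the form `Sign⁻¹(n₊, n₋, n₀)`."

What is formalised here is that sentence with `π₀Compl±_Ω` REPLACED by the set of `G_Ω`-conjugacy classes in `Compl_Ω`
(`G_Ω = {g | g*Ω = Ω}`; the printed identification of `Sign`-fibres with connected components, p.24 L37–40 "Lemma 5.2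
implies that the fibers of `Sign` are connected components of `Compl±_Ω`, each of which is a `G⁰_Ω`-orbit", rests on the
`G⁰_Ω`-refinement of Lemma 5.2 and is NOT formalised), reading the signature through Mathlib's Sylvester indices of the real
form `q_I(u) = Ω(u, Iu)` (`sigPos q_I = 2n₊`, `sigNeg q_I = 2n₋`, `dim_ℝ V₀ = 2n₀`), in three clauses:
(i) RANGE — for every `I ∈ Compl_Ω`, `sigPos q_I` and `sigNeg q_I` are EVEN and `sigPos q_I + sigNeg q_I + dim_ℝ V₀ = dim_ℝ V_ℝ`
(`even_sigPos_and_even_sigNeg`, from Part D's `h`-orthonormal adapted basis and Part E's count; the sum is Part C's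
`sigPos_add_sigNeg_add_finrank_nullSpace`) — i.e. `Sign(I) ∈ S_Ω`; (ii) SURJECTIVE — every `(2k, 2l)` with
`2k + 2l + dim_ℝ V₀ = dim_ℝ V_ℝ` occurs (Part B, Lemma 5.3); (iii) INJECTIVE ON ORBITS — two members of `Compl_Ω` have the
same `(sigPos, sigNeg)` iff some `g ∈ G_Ω` conjugates one to the other (Part E, Lemma 5.2 pointwise). `sign_orbit_bijection`
states (i)–(iii) together. The counting clause "`2n + 1 − n₀` connected components" is the cardinality of `S_Ω` transported
by the printed bijection and is not restated (no `π₀` here).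
-/

namespace Literature.Geometry.Hyperkaehler.HodgeLocus

variable {F : Type*} [NormedAddCommGroup F] [NormedSpace ℝ F]

/-- **`Sign(I) ∈ S_Ω`, parity half**: for `I ∈ Compl_Ω` the Sylvester indices of `q_I(u) = Ω(u, Iu)` are even
(they are `2n₊`, `2n₋` for the complex signature `(n₊, n₋, n₀)` of the hermitian form `h`).
[cite: BuskinIzadi2020TwistorLinesTori, v2 §5 p.23 L26–30 and p.24 L6–16 (`Sign : Compl±_Ω → S_Ω`)] -/
theorem even_sigPos_and_even_sigNeg [FiniteDimensional ℝ F] {I : F →L[ℝ] F} (hI : ∀ v, I (I v) = -v)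
    (Ω : F [⋀^Fin 2]→L[ℝ] ℝ) (hΩI : ∀ u v, Ω ![I u, I v] = Ω ![u, v]) {q : QuadraticForm ℝ F}
    (hq : ∀ u, q u = Ω ![u, I u]) : Even (sigPos q) ∧ Even (sigNeg q) := by
  obtain ⟨M, c, β, hβl, hβr, horth, -⟩ := exists_adapted_orthonormal_basis hI Ω hΩI
  obtain ⟨hp, hn⟩ := sigPos_sigNeg_eq_card_of_adapted_basis hI Ω hΩI c β hβl hβr horth hq
  exact ⟨⟨_, hp.trans (two_mul _)⟩, ⟨_, hn.trans (two_mul _)⟩⟩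

/-- **`Sign(I) ∈ S_Ω`** ("`k + l + n₀ = 2n`"): for `I ∈ Compl_Ω` there are `k, l` with `sigPos q_I = 2k`, `sigNeg q_I = 2l`
and `2k + 2l + dim_ℝ V₀ = dim_ℝ V_ℝ`, `V₀` the null space of `Ω`.
[cite: BuskinIzadi2020TwistorLinesTori, v2 §5 p.24 L6–16] -/
theorem exists_sigPos_eq_two_mul_and_sigNeg_eq_two_mul [FiniteDimensional ℝ F] {I : F →L[ℝ] F}
    (hI : ∀ v, I (I v) = -v) (Ω : F [⋀^Fin 2]→L[ℝ] ℝ) (hΩI : ∀ u v, Ω ![I u, I v] = Ω ![u, v])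
    {q : QuadraticForm ℝ F} (hq : ∀ u, q u = Ω ![u, I u]) {V₀ : Submodule ℝ F}
    (hV₀ : ∀ u, u ∈ V₀ ↔ ∀ v, Ω ![u, v] = 0) :
    ∃ k l : ℕ, sigPos q = 2 * k ∧ sigNeg q = 2 * l ∧ 2 * k + 2 * l + finrank ℝ V₀ = finrank ℝ F := by
  obtain ⟨⟨k, hk⟩, ⟨l, hl⟩⟩ := even_sigPos_and_even_sigNeg hI Ω hΩI hq
  refine ⟨k, l, by omega, by omega, ?_⟩
  have h := sigPos_add_sigNeg_add_finrank_nullSpace hI hΩI hq hV₀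
  omega

/-- **[BI20] Theorem 5.4, first sentence, with `π₀Compl±_Ω` replaced by `Compl_Ω ∕ G_Ω`** ("The mapping
`S̃ign : π₀Compl±_Ω → S_Ω` is a bijection"): writing `Compl_Ω = {I | I² = −1, Ω(I·, I·) = Ω}`, `q_I(u) = Ω(u, Iu)`,
`V₀` = the null space of `Ω` and `S = {(a, b) ∈ ℕ² | a, b even, a + b + dim_ℝ V₀ = dim_ℝ V_ℝ}` (= `S_Ω` with real
dimensions `a = 2k`, `b = 2l`, `dim_ℝ V₀ = 2n₀`), for `dim_ℝ V_ℝ` even: (i) `I ∈ Compl_Ω ⇒ (sigPos q_I, sigNeg q_I) ∈ S`;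
(ii) every element of `S` is `(sigPos q_I, sigNeg q_I)` for some `I ∈ Compl_Ω` (Lemma 5.3, Part B); (iii) for
`I₁, I₂ ∈ Compl_Ω`, `(sigPos q_{I₁}, sigNeg q_{I₁}) = (sigPos q_{I₂}, sigNeg q_{I₂})` iff some `g` with `g*Ω = Ω`
satisfies `g I₁ = I₂ g` (Lemma 5.2 pointwise, Part E). The printed statement is about connected components and the
identity component `G⁰_Ω`; that refinement is NOT formalised here.
[cite: BuskinIzadi2020TwistorLinesTori, v2 §5 Thm 5.4 (p.24 L54–60), with p.24 L6–16 (`S_Ω`, `Sign`) and L37–40] -/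
theorem sign_orbit_bijection [FiniteDimensional ℝ F] (Ω : F [⋀^Fin 2]→L[ℝ] ℝ) {V₀ : Submodule ℝ F}
    (hV₀ : ∀ u, u ∈ V₀ ↔ ∀ v, Ω ![u, v] = 0) (hF : Even (finrank ℝ F))
    (q : (F →L[ℝ] F) → QuadraticForm ℝ F) (hq : ∀ I u, q I u = Ω ![u, I u]) :
    (∀ I : F →L[ℝ] F, (∀ v, I (I v) = -v) → (∀ u v, Ω ![I u, I v] = Ω ![u, v]) →
        Even (sigPos (q I)) ∧ Even (sigNeg (q I)) ∧ sigPos (q I) + sigNeg (q I) + finrank ℝ V₀ = finrank ℝ F) ∧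
      (∀ a b : ℕ, Even a → Even b → a + b + finrank ℝ V₀ = finrank ℝ F →
        ∃ I : F →L[ℝ] F, (∀ v, I (I v) = -v) ∧ (∀ u v, Ω ![I u, I v] = Ω ![u, v]) ∧
          sigPos (q I) = a ∧ sigNeg (q I) = b) ∧
      ∀ I₁ I₂ : F →L[ℝ] F, (∀ v, I₁ (I₁ v) = -v) → (∀ v, I₂ (I₂ v) = -v) →
        (∀ u v, Ω ![I₁ u, I₁ v] = Ω ![u, v]) → (∀ u v, Ω ![I₂ u, I₂ v] = Ω ![u, v]) →
          ((sigPos (q I₁) = sigPos (q I₂) ∧ sigNeg (q I₁) = sigNeg (q I₂)) ↔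
            ∃ g : F ≃L[ℝ] F, (∀ v, g (I₁ v) = I₂ (g v)) ∧ ∀ u v, Ω ![g u, g v] = Ω ![u, v]) := by
  refine ⟨fun I hI hΩI => ?_, fun a b ha hb hab => ?_, fun I₁ I₂ hI₁ hI₂ hΩ₁ hΩ₂ => ?_⟩
  · obtain ⟨hp, hn⟩ := even_sigPos_and_even_sigNeg hI Ω hΩI (hq I)
    exact ⟨hp, hn, sigPos_add_sigNeg_add_finrank_nullSpace hI hΩI (hq I) hV₀⟩
  · obtain ⟨n₀, hn₀⟩ := even_finrank_nullSpace Ω hV₀ hF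
    obtain ⟨k, hk⟩ := ha
    obtain ⟨l, hl⟩ := hb
    obtain ⟨I, hI, hΩI, hsig⟩ := exists_invariant_complexStructure_sigPos_eq Ω hV₀ (n₀ := n₀) (npos := k)
      (nneg := l) (by omega) (by omega)
    obtain ⟨hp, hn, -⟩ := hsig (q I) (hq I)
    exact ⟨I, hI, hΩI, by omega, by omega⟩
  · exact (exists_conj_invariant_iff_sigPos_eq Ω hI₁ hI₂ hΩ₁ hΩ₂ (hq I₁) (hq I₂)).symm

end Literature.Geometry.Hyperkaehler.HodgeLocus

end
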